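import Literature.Barriers.CriticalPhenomena.PlaquetteWalkIsthmusRoot
import HarnessLib

/-!
# Barrier catalogue (SAWScalingLimit), positive side: Glazman's degenerate family (`v = 0`, integer
spin) carries an exact plaquette vertex relation at EVERY face of EVERY finite face list for EVERY
boundary root — hole roots included — and the two-sided classification of the `v = 0` boundary

Companion of `PlaquetteWalkSpinRigidity` (§ `DegenerateBranch`: `degenerate_rigidity`, the NECESSITY
half — an exact vertex relation of the five-weight plaquette walk with `v = 0`, `u₁u₂ ≠ 0`, `c ≠ 0` on
every finite face list forces `t⁴ = 1` and the weights onto the line `u₂ t² a = −ε u₁ a − t b`,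
`w₁ a = −ε u₁ t b`, `w₂ t a = −u₂ b`, `b² = t² a²`), of `PlaquetteWalkHoleRootDefect` (for `u₁u₂v ≠ 0`
the all-boundary-roots class `ExactPlaquetteVertexRelation` is EMPTY: every Yang–Baxter identity fails at
a hole root) and of `PlaquetteWalkYBCurveIdentityAllSpins` (the sixteen curves, outer roots). This file
proves the SUFFICIENCY half on the `v = 0` boundary and closes the classification there:

* `degenWeights ε s t u₁ = (u₁, −s − εt²u₁, 0, −εst²u₁, −s·u₂)` (`ε, s = ±1`, `t⁴ = 1`, `u₁ ∈ ℂ` free)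
  and `degenCoeff ε s t = (c_E, c_N, c_W, c_S) = (1, st, ε, εst)`; the member `s = −1`, `εt² = 1` is the
  printed family `u₁ + u₂ = 1`, `w₁ = u₁`, `w₂ = u₂` of [cite: Glazman2015WeightedSAW, Lemma 3.1, (3.8)–(3.10) (ECP 20 (2015) no. 86, p. 6)],
  the others its sign companions (cf. the docstring of `degenerate_rigidity`);
* ★ **`exactPlaquetteVertexRelation_degen`** / named **`PlaquetteWalkDegenerateIdentity(_holds)`**: for
  every `t` with `t⁴ = 1`, all signs `ε, s` and every `u₁ ∈ ℂ`,
  `ExactPlaquetteVertexRelation (degenWeights ε s t u₁) t (degenCoeff ε s t)` — the vertex functional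
  `Σ_s c_s F(z_s)` vanishes at EVERY face of EVERY finite face list for EVERY boundary root, roots on
  the boundary of a HOLE included (`vertexFunctional_degen_eq_zero`). So the all-boundary-roots class,
  empty for `u₁u₂v ≠ 0` (`PlaquetteWalkNoAllRootsRelation`), is NON-EMPTY on the boundary `v = 0`: its
  hypothesis `v ≠ 0` is sharp;
* ★ **`exactPlaquetteVertexRelation_iff_degen`** / named **`PlaquetteWalkDegenerateClassification(_holds)`**:
  for complex weights with `u₁u₂ ≠ 0`, `v = 0` and any phase `t ≠ 0`,
  `(∃ c ≠ 0, ExactPlaquetteVertexRelation W t c) ↔ (t⁴ = 1 ∧ ∃ ε s = ±1, W = degenWeights ε s t u₁)` —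
  necessity = the tree's `degenerate_rigidity`, sufficiency = this file.

## The argument: grouping by the LAST arc (a local involution-free count; no winding input)

At integer spin `t⁴ = 1` the parafermionic factor `t^{q(γ)}` of a walk depends on `q(γ) mod 4` only,
i.e. on the direction of its last mid-edge relative to the root — a LOCAL datum — and `v = 0` kills every
walk with a straight arc. Fix a face list `Dl`, a boundary root `a` and a face `f₀ ∈ Dl`, and partition
the walks from `a` ending on a side of `f₀` by their last arc: the ARRIVAL walks (the trivial walk, if
`a` is a side of `f₀`, and the walks whose last arc is not drawn in `f₀`) and, for each arrival walk
`γ`, its one-arc extensions inside `f₀` that are again walks (`ΩF.sum_eq_sum_bracket`, a bijection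
`ΩF.ext` / `ΩF.base` between extensions and admissible pairs). An arrival walk `γ` at the side `p` has
at most one earlier arc in `f₀`, not touching `p` (`ΩF.ends_ne_of_arc`, `side_five`), and a side of
`f₀` crossed earlier by `γ` carries an arc of `γ` in `f₀` (`ΩF.arc_of_mem_side` — for the root side this
is where `IsBoundaryRoot` enters: the other face of `a` is not in the domain). Hence, with
`E` = the weight of `γ` outside `f₀` and `T = t^{q(γ)}`:
* `f₀` fresh: all three extensions are admissible and the group contributes
  `E·T·Σ_x c_x · u_{kind(p,x)} · t^{qTurn(p,x)}` (`x = p` being the walk itself): the four GROUP-ONE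
  identities `groupOne_degen`, e.g. arrival `S`: `c_S + c_W u₂ t + c_E u₁ t⁻¹ (+ c_N v) = u₁ t⁻¹(1 − t⁴) = 0`;
* `f₀` crossed once before, by a turning arc of kind `k` on the two other sides: exactly the completing
  arc to the fourth side is admissible, it re-weights `f₀` from `u_k` to `w_k`, and the group contributes
  `E·T·(c_p u_k + c_{x} w_k t^{±1})`: the eight PAIR identities `pair_degen`, e.g. `{S,E}`:
  `c_S u₁ + c_E w₁ t⁻¹ = εst u₁ − εst² u₁ t⁻¹ = 0`; a straight earlier arc makes every term vanish.
All twelve identities are checked by `ring` modulo `t⁴ = 1` after the sign cases. Nothing global is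
used — no grouping classes `B2a/B2b`, no excursion winding, no `RootUnwound`/`OuterRoot` hypothesis —
which is why the identity survives multiply connected face lists and hole roots, in contrast with the
sixteen Yang–Baxter curves (`PlaquetteWalkHoleRootDefect`).

* (Appended, same file) the ONE-PLAQUETTE instances through the same grouping, for ARBITRARY complex
  weights: `vertexFunctional_single` (on `[f₀]` rooted at its side `p` the functional IS the group-one row
  `Σ_x c_x u_{kind(p,x)} t^{qTurn p x}`), hence `groupOne_row_of_exactPlaquetteVertexRelation` (every exact
  vertex relation satisfies the four group-one rows) and the NECESSITY half of the directed corner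
  `u₁ = 0`: **`quartic_eq_zero_of_exactPlaquetteVertexRelation_of_u₁_eq_zero`** — a nonzero relation with
  `u₁ = 0` forces `(1+v−u₂)(1+v+u₂)(1−v−u₂)(1−v+u₂) = 0` (the rows form the block matrix `[[P, vI],[vI, P]]`,
  `det = ((1+v)² − u₂²)((1−v)² − u₂²)`, any `w₁, w₂`, any phase).

* (Appended, same file) the DIRECTED CORNER `u₁ = w₁ = 0` two-sidedly: corner-free walks are strictly
  monotone in the diagonal potential `ψ(vert k j) = 2(k−j)`, `ψ(slant k j) = 2(k−j)+1` (`psi`,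
  `ΩF.no_arc_of_cornerFree`: a corner-free arrival walk has no earlier arc in `f₀`), hence
  `exactPlaquetteVertexRelation_of_u₁_w₁_eq_zero` (every solution of the four group-one rows IS an exact
  vertex relation at every boundary root — no spin condition) and ★
  `exactPlaquetteVertexRelation_iff_quartic` / named **`PlaquetteWalkDirectedCornerClassification(_holds)`**:
  for `u₁ = w₁ = 0`, any `u₂, v, w₂`, any `t ≠ 0`:
  `(∃ c ≠ 0, ExactPlaquetteVertexRelation W t c) ↔ (1+v−u₂)(1+v+u₂)(1−v−u₂)(1−v+u₂) = 0`.

* (Appended, same file) the MIRROR CORNER `u₂ = w₂ = 0` two-sidedly, by the anti-diagonal potential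
  `ψ'(vert k j) = 2(k+j)`, `ψ'(slant k j) = 2(k+j)+1` (co-corner-free walks are monotone,
  `ΩF.no_arc_of_coCornerFree`): `exactPlaquetteVertexRelation_of_u₂_w₂_eq_zero`,
  `quartic_eq_zero_of_exactPlaquetteVertexRelation_of_u₂_eq_zero` and ★
  `exactPlaquetteVertexRelation_iff_quartic'` / named **`PlaquetteWalkMirrorCornerClassification(_holds)`**:
  for `u₂ = w₂ = 0`, any `u₁, v, w₁`, any `t ≠ 0`:
  `(∃ c ≠ 0, ExactPlaquetteVertexRelation W t c) ↔ (1+v−u₁)(1+v+u₁)(1−v−u₁)(1−v+u₁) = 0`.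
  With `PlaquetteWalkDegenerateClassification` (`u₁u₂ ≠ 0`, `v = 0`), `PlaquetteWalkNoAllRootsRelation`
  (`u₁u₂v ≠ 0`, tree) and the two corners, the all-boundary-roots class is classified on ALL of `ℂ⁵`
  except the slivers `{u₁ = 0, w₁ ≠ 0}` and `{u₂ = 0, w₂ ≠ 0}` (where necessity is typed and
  sufficiency is expected: no Yang–Baxter walk doubles all its corner plaquettes).

* (Appended, same file) the SLIVERS closed: ★ `exists_kindsIn_eq_corner` — NO Yang–Baxter walk doubles
  all its corner plaquettes (a walk with a corner arc has a plaquette crossed exactly once, by a corner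
  arc; proof by the LEVEL `k − j` of the plaquettes along the walk: a corner arc of maximal level sits
  alone in its plaquette) and its mirror `exists_kindsIn_eq_coCorner` (co-level `k + j`); hence
  `exactPlaquetteVertexRelation_of_u₁_eq_zero` / `_of_u₂_eq_zero` (no `w₁ = 0` / `w₂ = 0` hypothesis) and
  ★★ `exactPlaquetteVertexRelation_iff_quartic_of_u₁_eq_zero` / `_of_u₂_eq_zero`, named
  **`PlaquetteWalkCornerBranchClassification(_holds)`** / **`PlaquetteWalkMirrorBranchClassification(_holds)`**:
  the branches `u₁ = 0` and `u₂ = 0` classified two-sidedly for ALL other weights and every phase — so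
  the all-boundary-roots class is classified on ALL of `ℂ⁵ × {t ≠ 0}`.

On the way: the plaquette weight of the catalogue as a product of local complex weights over the
visited faces (`weightL_eq_prod`, `locW`, for every Yang–Baxter walk, from the tree's Fig. 1 shape
theorem `kindsL_shape`), its splitting off one face (`extW`, `weightL_eq_extW_mul`, `extW_of_snoc`) and
the vertex functional as one sum over side-labelled walks (`ΩF`, `term`, `vertexFunctional_eq_sum_term`).

Sources. A. Glazman, Electron. Commun. Probab. 20 (2015) no. 86 = arXiv:1402.5376, Lemma 3.1: "If
`σ = 1` then there is a one parameter family of weights such that `F_a(u₁, u₂, v, w₁, w₂)` satisfies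
(3.2): `u₁ + u₂ = 1`, `w₁ = u₁`, `w₂ = u₂`" (p. 6, (3.8)–(3.10); proof p. 7: "If `v = 0`, the solution
exists for each `θ` if and only if `σ = 1`"), stated for a parallelogram `Ω` of rhombi and a root
`a ∈ V(∂Ω)` [cite: Glazman2015WeightedSAW, Lemma 3.1 (ECP 20 (2015) no. 86, pp. 5–7)]; the walk model
and the weight of a walk as the product over rhombi [cite: GlazmanManolescu2019, §1, Fig. 1, eq. (1)];
the shape of the relation and the general-domain quantifier [cite: DuminilCopinSmirnov2012, Lemma 1];
the `v = 0` solution classes of the square-lattice `O(n)` holomorphicity system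
[cite: IkhlefCardy2009, §3]. Status in print: the EXISTENCE of the `σ = 1` family is printed (Glazman's
Lemma 3.1, simply connected `Ω`, `a ∈ ∂Ω`, real weights); the statement proved here — the relation for
the whole complex sign-companion family on EVERY finite face list for EVERY boundary root INCLUDING HOLE
ROOTS, by a winding-free local count, and the two-sided classification of the `v = 0` boundary inside the
typed class `ExactPlaquetteVertexRelation` — is not located in print (label cell owed: venture lane
«pcv-sawmu», lit seats). Scope: `u₁ = 0` / `u₂ = 0` remain outside (there `degenerate_rigidity` does not
apply); nothing is claimed about other lattices or about non-constant coefficients.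

Written for the venture lane «pcv-sawmu» (Tier B, seat b-engine-1 gen 12; door (b) of gen 11's
`g11/DESIGN-degenerate-family.md`, whose exact data — the functional vanishes identically in `u₁` on
`ring8` / `dom11` / `box4×3` for all sixteen members and all boundary roots, 8 256 rows — this file
turns into a theorem).
-/

noncomputable section

open Complex

namespace Literature.Barriers.CriticalPhenomena

open Literature.Probability.RandomPlanarGeometry.SAW.YangBaxter
open Literature.Probability.RandomPlanarGeometry.SAW.YangBaxter.MidEdge

namespace PlaquetteWalk

/-! ### The degenerate family and its coefficient vector -/

/-- **Glazman's degenerate family** (`σ ∈ ℤ`, `v = 0`) with its sign companions: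
`(u₁, u₂, v, w₁, w₂) = (u₁, −s − εt²u₁, 0, −εst²u₁, −s·u₂)`; for `s = −1`, `εt² = 1` this is the printed
`u₁ + u₂ = 1`, `w₁ = u₁`, `w₂ = u₂`. [cite: Glazman2015WeightedSAW, Lemma 3.1, (3.8)–(3.10) (p. 6)] -/
def degenWeights (ε s t u₁ : ℂ) : CWeights :=
  ⟨u₁, -s - ε * t ^ 2 * u₁, 0, -(ε * s * t ^ 2 * u₁), -s * (-s - ε * t ^ 2 * u₁)⟩

/-- The coefficient vector `(c_E, c_N, c_W, c_S) = (1, st, ε, εst)` of the degenerate family (slot order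
`(E, N, W, S)` of `vertexFunctional`; `ρ²`-eigencomponent `(a, b) = (2, 2st)`, `b = s t a`).
[cite: Glazman2015WeightedSAW, Lemma 3.1 ((3.2): the coefficients (1, e^{iθ}, −1, −e^{iθ}) at σ = 1)] -/
def degenCoeff (ε s t : ℂ) : Fin 4 → ℂ := ![1, s * t, ε, ε * s * t]

/-- The coefficient vector is nonzero (`c_E = 1`). [cite: Glazman2015WeightedSAW, Lemma 3.1 (eq. (3.2): coefficient 1 at z_SE)] -/
theorem degenCoeff_ne_zero (ε s t : ℂ) : degenCoeff ε s t ≠ 0 := fun h => by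
  have := congrFun h 0
  simp [degenCoeff] at this

/-- The family has no straight arcs: `v = 0`. [cite: Glazman2015WeightedSAW, Lemma 3.1 (proof: "if v = 0 … σ = 1")] -/
@[simp] theorem degenWeights_v (ε s t u₁ : ℂ) : (degenWeights ε s t u₁).v = 0 := rfl

/-- A degenerate "arc" from a side to itself. [folklore] -/
private theorem arcKind_self (p : Side) : arcKind p p = .degen := by cases p <;> rfl

/-- No turn from a side to itself. [folklore] -/
private theorem qTurn_self (p : Side) : qTurn p p = 0 := by cases p <;> rfl

/-- A sum over the four sides, expanded. [folklore] -/
private theorem sum_side (g : Side → ℂ) : ∑ x : Side, g x = g .W + g .E + g .S + g .N := by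
  rw [show (Finset.univ : Finset Side) = {Side.W, Side.E, Side.S, Side.N} from by decide,
    Finset.sum_insert (by decide), Finset.sum_insert (by decide), Finset.sum_insert (by decide),
    Finset.sum_singleton]
  ring

section Identities

variable {ε s t : ℂ}

/-- Powers of a fourth root of unity: `t⁻¹ = t³`, `t⁵ = t`, `t⁶ = t²`. [folklore] -/
private theorem pow_red (ht : t ^ 4 = 1) : t⁻¹ = t ^ 3 ∧ t ^ 5 = t ∧ t ^ 6 = t ^ 2 := by
  refine ⟨?_, by linear_combination t * ht, by linear_combination t ^ 2 * ht⟩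
  exact inv_eq_of_mul_eq_one_right (by rw [← pow_succ']; exact ht)

/-- **The four group-one identities** of the degenerate family, one per arrival side `p`: the walk
itself (`x = p`: `arcKind p p = degen`, weight `1`, no turn) plus its three one-arc extensions inside a
fresh plaquette (`u₁` / `u₂` at a corner / co-corner with the phase of the quarter turn, `v = 0` straight)
sum to zero; e.g. arrival `S`: `c_S + c_W u₂ t + c_E u₁ t⁻¹ = u₁ t⁻¹ (1 − t⁴) = 0`.
[cite: Glazman2015WeightedSAW, Lemma 3.1 (proof, eq. (3.11): the one-visit group)] -/
theorem groupOne_degen (ht : t ^ 4 = 1) (hε : ε = 1 ∨ ε = -1) (hs : s = 1 ∨ s = -1) (u₁ : ℂ) (p : Side) :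
    ∑ x : Side, degenCoeff ε s t (slotIdx x) * arcW (degenWeights ε s t u₁) (arcKind p x) * t ^ qTurn p x = 0 := by
  obtain ⟨hinv, h5, h6⟩ := pow_red ht
  rw [sum_side]
  rcases hε with rfl | rfl <;> rcases hs with rfl | rfl <;> cases p <;>
    simp only [slotIdx, degenCoeff, degenWeights, arcKind, arcW, qTurn, Matrix.cons_val_zero,
      Matrix.cons_val_one, Matrix.head_cons, Matrix.cons_val_two, Matrix.tail_cons,
      Matrix.cons_val_three, zpow_zero, zpow_one, zpow_neg, hinv, Int.reduceNeg] <;>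
    first
    | ring1
    | (ring_nf; simp only [ht, h6]; ring1)

/-- **The eight pair identities** of the degenerate family: an arrival at the side `p` of a plaquette
already crossed by a turning arc of kind `k = arcKind p x` on the two other sides, plus its completing
arc `p → x` to the fourth side (re-weighting the plaquette from `u_k` to `w_k`, one quarter turn), sum to
zero: `c_p u_k + c_x w_k t^{qTurn p x} = 0`; e.g. `S → E`: `εst·u₁ + 1·(−εst²u₁)·t⁻¹ = 0`. At integer spin
these hold PAIR BY PAIR — no excursion winding is needed. [cite: Glazman2015WeightedSAW, Lemma 3.1 (proof, eqs. (3.12)–(3.14): the two-visit groups)] -/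
theorem pair_degen (ht : t ^ 4 = 1) (hε : ε = 1 ∨ ε = -1) (hs : s = 1 ∨ s = -1) (u₁ : ℂ) {p x : Side}
    (hpx : p ≠ x) (hk : arcKind p x ≠ .straight) :
    degenCoeff ε s t (slotIdx p) * arcW (degenWeights ε s t u₁) (arcKind p x) +
      degenCoeff ε s t (slotIdx x) * pairW (degenWeights ε s t u₁) (arcKind p x) * t ^ qTurn p x = 0 := by
  obtain ⟨hinv, h5, h6⟩ := pow_red ht
  rcases hε with rfl | rfl <;> rcases hs with rfl | rfl <;> cases p <;> cases x <;>
    simp only [arcKind, ne_eq, not_true_eq_false] at hpx hk <;>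
    simp only [slotIdx, degenCoeff, degenWeights, arcKind, arcW, pairW, qTurn, Matrix.cons_val_zero,
      Matrix.cons_val_one, Matrix.head_cons, Matrix.cons_val_two, Matrix.tail_cons,
      Matrix.cons_val_three, zpow_one, zpow_neg, hinv, Int.reduceNeg] <;>
    first
    | ring1
    | (ring_nf; simp only [ht, h5, h6]; ring1)

end Identities

/-! ### Side combinatorics -/

/-- Complementary side pairs have the same kind (explicit form). [folklore] -/
private theorem arcKind_compl_aux : ∀ p x s₁ s₂ : Side, p ≠ x → p ≠ s₁ → p ≠ s₂ → x ≠ s₁ → x ≠ s₂ → s₁ ≠ s₂ →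
    arcKind p x = arcKind s₁ s₂ := by
  intro p x s₁ s₂
  cases p <;> cases x <;> cases s₁ <;> cases s₂ <;> simp [arcKind]

/-- **Complementary side pairs have the same kind**: `{W,N}/{S,E}` corners, `{W,S}/{N,E}` co-corners,
`{W,E}/{S,N}` straight. [cite: GlazmanManolescu2019, Fig. 1 (the two-arc configurations w₁, w₂)] -/
theorem arcKind_compl {p x s₁ s₂ : Side} (h1 : p ≠ x) (h2 : p ≠ s₁) (h3 : p ≠ s₂) (h4 : x ≠ s₁)
    (h5 : x ≠ s₂) (h6 : s₁ ≠ s₂) : arcKind p x = arcKind s₁ s₂ :=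
  arcKind_compl_aux p x s₁ s₂ h1 h2 h3 h4 h5 h6

/-- There are no five pairwise distinct sides (explicit form). [folklore] -/
private theorem side_five_aux : ∀ s₁ s₂ s₃ s₄ p : Side, s₁ ≠ s₂ → s₁ ≠ s₃ → s₁ ≠ s₄ → s₂ ≠ s₃ → s₂ ≠ s₄ →
    s₃ ≠ s₄ → p ≠ s₁ → p ≠ s₂ → p ≠ s₃ → p ≠ s₄ → False := by
  decide

/-- There are no five pairwise distinct sides of a plaquette. [folklore] -/
private theorem side_five {s₁ s₂ s₃ s₄ p : Side} (h12 : s₁ ≠ s₂) (h13 : s₁ ≠ s₃) (h14 : s₁ ≠ s₄) (h23 : s₂ ≠ s₃)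
    (h24 : s₂ ≠ s₄) (h34 : s₃ ≠ s₄) (h1 : p ≠ s₁) (h2 : p ≠ s₂) (h3 : p ≠ s₃) (h4 : p ≠ s₄) : False :=
  side_five_aux s₁ s₂ s₃ s₄ p h12 h13 h14 h23 h24 h34 h1 h2 h3 h4

/-! ### The plaquette weight as a product of local weights -/

/-- The local complex weight of a plaquette as a function of the kinds of the arcs it carries:
`1, u₁, u₂, v` (no arc, one corner / co-corner / straight arc), `w₁, w₂` (two arcs, by the kind of the
first — two arcs of a walk in one plaquette have the same kind), `0` for three or more.
[cite: GlazmanManolescu2019, §1, Fig. 1, eq. (1)] -/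
def locW (W : CWeights) : List ArcKind → ℂ
  | [] => 1
  | [k] => arcW W k
  | [k, _] => pairW W k
  | _ :: _ :: _ :: _ => 0

/-- An empty plaquette weighs `1`. [cite: GlazmanManolescu2019, Fig. 1] -/
@[simp] theorem locW_nil (W : CWeights) : locW W [] = 1 := rfl
/-- One arc weighs `u₁ / u₂ / v`. [cite: GlazmanManolescu2019, Fig. 1] -/
@[simp] theorem locW_single (W : CWeights) (k : ArcKind) : locW W [k] = arcW W k := rfl
/-- Two arcs weigh `w₁ / w₂` by their common kind. [cite: GlazmanManolescu2019, Fig. 1] -/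
@[simp] theorem locW_pair (W : CWeights) (k k' : ArcKind) : locW W [k, k'] = pairW W k := rfl

/-- **The product of the local weights over a face list is the weight monomial** of the configuration
counts, for any mid-edge list with Fig. 1 local configurations. [cite: GlazmanManolescu2019, §1 ("the weight of a walk is the product of weights associated to each rhombus")] -/
theorem prod_locW_eq_mono (W : CWeights) (l : List MidEdge)
    (hK : ∀ f, kindsL l f = [] ∨ kindsL l f = [.corner] ∨ kindsL l f = [.coCorner] ∨
      kindsL l f = [.straight] ∨ kindsL l f = [.corner, .corner] ∨ kindsL l f = [.coCorner, .coCorner]) :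
    ∀ L : List Face, (L.map fun f => locW W (kindsL l f)).prod =
      W.mono (L.countP fun f => kindsL l f = [.corner]) (L.countP fun f => kindsL l f = [.coCorner])
        (L.countP fun f => kindsL l f = [.straight]) (L.countP fun f => kindsL l f = [.corner, .corner])
        (L.countP fun f => kindsL l f = [.coCorner, .coCorner])
  | [] => by simp [CWeights.mono]
  | f :: L => by
    rw [List.map_cons, List.prod_cons, prod_locW_eq_mono W l hK L]
    simp only [List.countP_cons]
    rcases hK f with h | h | h | h | h | h <;>
      simp [h, locW, arcW, pairW, CWeights.mono, pow_succ] <;> ring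

variable {D : Set Face} {a z : MidEdge}

/-- The visited faces as a finset are the deduplicated face list. [folklore] -/
private theorem facesVisited_eq_toFinset (γ : YBWalk D a z) : γ.facesVisited = (facesL γ.mids).toFinset := by
  ext f; simp [YBWalk.facesVisited, facesL]

/-- **The catalogue's plaquette weight of a Yang–Baxter walk is the product over the visited plaquettes
of their local complex weights.** [cite: GlazmanManolescu2019, §1, eq. (1)] -/
theorem weightL_eq_prod (W : CWeights) (γ : YBWalk D a z) :
    weightL W γ.mids = ∏ f ∈ γ.facesVisited, locW W (γ.kindsIn f) := by
  have key := prod_locW_eq_mono W γ.mids (kindsL_shape γ) (facesL γ.mids)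
  have hnd : (facesL γ.mids).Nodup := List.nodup_dedup _
  rw [facesVisited_eq_toFinset, List.prod_toFinset _ hnd]
  unfold weightL cfgCount
  exact key.symm

/-- The exterior weight: the product of the local weights of the plaquettes other than `r`.
[cite: GlazmanManolescu2019, §1 ("the weight of a walk is the product of weights associated to each rhombus")] -/
def extW (W : CWeights) (γ : YBWalk D a z) (r : Face) : ℂ := ∏ g ∈ γ.facesVisited.erase r, locW W (γ.kindsIn g)

/-- **The weight splits off any plaquette**: weight = exterior weight × local weight of `r`.
[cite: GlazmanManolescu2019, §1, eq. (1) (the weight is the product over the rhombi)] -/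
theorem weightL_eq_extW_mul (W : CWeights) (γ : YBWalk D a z) (r : Face) :
    weightL W γ.mids = extW W γ r * locW W (γ.kindsIn r) := by
  rw [weightL_eq_prod, extW]
  by_cases hr : r ∈ γ.facesVisited
  · rw [Finset.prod_erase_mul _ _ hr]
  · rw [Finset.erase_eq_of_notMem hr, YBWalk.kindsIn_eq_nil hr, locW_nil, mul_one]

/-- Appending an arc drawn in `r` does not change the exterior weight at `r` ("walks in the same group
differ only inside" the rhombus). [cite: Glazman2015WeightedSAW, Lemma 3.1 (proof, p. 6)] -/
theorem extW_of_snoc (W : CWeights) (γ : YBWalk D a z) {a' z' e : MidEdge} (δ : YBWalk D a' z') (r : Face)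
    (harcs : δ.arcs = γ.arcs ++ [(z, e)]) (hr : arcFace (z, e) = some r) : extW W δ r = extW W γ r := by
  rw [extW, extW, YBWalk.facesVisited_of_snoc γ δ r harcs hr, Finset.erase_insert_eq_erase]
  refine Finset.prod_congr rfl fun g hg => ?_
  rw [YBWalk.kindsIn_of_snoc_of_ne γ δ r harcs hr (Finset.ne_of_mem_erase hg)]

/-- Appending an arc adds its quarter turns. [folklore] -/
private theorem quarterTurnsL_of_snoc (γ : YBWalk D a z) {a' z' e : MidEdge} (δ : YBWalk D a' z')
    (harcs : δ.arcs = γ.arcs ++ [(z, e)]) : quarterTurnsL δ.mids = quarterTurnsL γ.mids + qTurnOf (z, e) := by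
  unfold quarterTurnsL
  rw [show arcsOf δ.mids = δ.arcs from rfl, harcs, show arcsOf γ.mids = γ.arcs from rfl]
  simp

/-- The quarter turns of an arc between two sides of a plaquette. [folklore] -/
private theorem qTurnOf_side_side (f : Face) {s u : Side} (hsu : s ≠ u) : qTurnOf (f.side s, f.side u) = qTurn s u := by
  unfold qTurnOf; rw [arcFace_side_side f s u hsu]; simp

/-- The kinds in a plaquette through the filtered arc list. [folklore] -/
private theorem kindsIn_eq_filterMap_filter (γ : YBWalk D a z) (f : Face) :
    γ.kindsIn f = ((arcsOf γ.mids).filter fun p => arcFace p = some f).filterMap arcKindOf := by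
  show kindsL γ.mids f = _
  unfold kindsL
  induction arcsOf γ.mids with
  | nil => simp
  | cons p A ih =>
    rw [List.filterMap_cons, List.filter_cons]
    by_cases hp : arcFace p = some f
    · simp only [hp, if_true, decide_true, List.filterMap_cons, ih]
    · simp [hp, ih]

/-! ### Walks ending on a side of `f₀`, grouped by their last arc -/

/-- The walks of `dom Dl` from `a` ending on a side of `f₀`, labelled by that side — the index set of the
vertex functional at `f₀`. [cite: DuminilCopinSmirnov2012, Lemma 1 (the sum over the mid-edges adjacent to a vertex)] -/
abbrev ΩF (Dl : List Face) (a : MidEdge) (f₀ : Face) : Type := Σ s : Side, YBWalk (dom Dl) a (f₀.side s)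

/-- The summand of the vertex functional carried by a labelled walk: `c_{slot} · w_W(γ) · t^{q(γ)}`.
[cite: GlazmanManolescu2019, §2.1, eq. (2.1)] -/
def term (W : CWeights) (t : ℂ) (c : Fin 4 → ℂ) {Dl : List Face} {a : MidEdge} {f₀ : Face} (ω : ΩF Dl a f₀) : ℂ :=
  c (slotIdx ω.1) * (weightL W ω.2.mids * t ^ quarterTurnsL ω.2.mids)

/-- **The vertex functional as one sum over the labelled walks.** [cite: DuminilCopinSmirnov2012, Lemma 1 (shape of the relation)] -/
theorem vertexFunctional_eq_sum_term (W : CWeights) (t : ℂ) (c : Fin 4 → ℂ) (Dl : List Face) (a : MidEdge)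
    (f₀ : Face) : vertexFunctional W t c Dl a f₀ = ∑ ω : ΩF Dl a f₀, term W t c ω := by
  rw [vertexFunctional_eq_sum_sides, Fintype.sum_sigma]
  refine Finset.sum_congr rfl fun u _ => ?_
  rw [gmObservable, Finset.mul_sum]
  rfl

namespace ΩF

open Classical

variable {Dl : List Face} {a : MidEdge} {f₀ : Face}

/-- Class `Ext`: the walk has a last arc and it is drawn in `f₀` (so it is the one-arc extension inside
`f₀` of the arrival walk obtained by dropping it). [cite: Glazman2015WeightedSAW, Lemma 3.1 (proof: the groups of walks at a rhombus, differing only inside it)] -/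
def IsExt (ω : ΩF Dl a f₀) : Prop :=
  ∃ _ : 0 < ω.2.arcs.length, arcFace (ω.2.nth (ω.2.arcs.length - 1), f₀.side ω.1) = some f₀

/-- Admissibility of the one-arc extension of `ω` inside `f₀` from its end side to the side `x`: a new
side, a new mid-edge, and no crossing of an earlier straight arc of `ω` in `f₀` — the hypotheses of
`YBWalk.snoc` other than the chain condition (which is `¬IsExt`). [cite: GlazmanManolescu2019, §1, Fig. 1 (admissible local configurations: no crossing)] -/
def Adm (ω : ΩF Dl a f₀) (x : Side) : Prop :=
  x ≠ ω.1 ∧ f₀.side x ∉ ω.2.mids ∧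
    (IsWE f₀ (f₀.side ω.1, f₀.side x) → ∀ i < ω.2.arcs.length, ¬IsSN f₀ (ω.2.nth i, ω.2.nth (i + 1))) ∧
    (IsSN f₀ (f₀.side ω.1, f₀.side x) → ∀ i < ω.2.arcs.length, ¬IsWE f₀ (ω.2.nth i, ω.2.nth (i + 1)))

/-- **The one-arc extension of an arrival walk inside `f₀`** to the side `x` (junk: `ω` itself when
`ω` is not an arrival walk or `x` is not admissible). [folklore] -/
def ext (ω : ΩF Dl a f₀) (hf : f₀ ∈ Dl) (x : Side) : ΩF Dl a f₀ :=
  if h : ¬ω.IsExt ∧ ω.Adm x then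
    ⟨x, ω.2.snoc (f₀.side x) f₀ (arcFace_side_side f₀ ω.1 x (Ne.symm h.2.1)) (show f₀ ∈ dom Dl from hf)
      h.2.2.1 (fun i hi e => h.1 ⟨by omega, by rwa [show ω.2.arcs.length - 1 = i by omega]⟩)
      h.2.2.2.1 h.2.2.2.2⟩
  else ω

variable {ω : ΩF Dl a f₀}

/-- The label of the extension. [folklore] -/
private theorem ext_fst (hf : f₀ ∈ Dl) {x : Side} (h : ¬ω.IsExt) (hx : ω.Adm x) : (ω.ext hf x).1 = x := by
  rw [ext, dif_pos ⟨h, hx⟩]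

/-- The arcs of the extension. [folklore] -/
private theorem ext_snd_arcs (hf : f₀ ∈ Dl) {x : Side} (h : ¬ω.IsExt) (hx : ω.Adm x) :
    (ω.ext hf x).2.arcs = ω.2.arcs ++ [(f₀.side ω.1, f₀.side x)] := by
  rw [ext, dif_pos ⟨h, hx⟩]; dsimp only; apply YBWalk.snoc_arcs

/-- The extension has one more arc. [folklore] -/
private theorem ext_snd_length (hf : f₀ ∈ Dl) {x : Side} (h : ¬ω.IsExt) (hx : ω.Adm x) :
    (ω.ext hf x).2.arcs.length = ω.2.arcs.length + 1 := by
  rw [ext_snd_arcs hf h hx, List.length_append, List.length_singleton]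

/-- The extension agrees with the walk. [folklore] -/
private theorem ext_snd_nth (hf : f₀ ∈ Dl) {x : Side} (h : ¬ω.IsExt) (hx : ω.Adm x) {i : ℕ} (hi : i ≤ ω.2.arcs.length) :
    (ω.ext hf x).2.nth i = ω.2.nth i := by
  rw [ext, dif_pos ⟨h, hx⟩]; dsimp only; apply YBWalk.snoc_nth; exact hi

/-- The extension is of class `Ext`. [folklore] -/
private theorem ext_isExt (hf : f₀ ∈ Dl) {x : Side} (h : ¬ω.IsExt) (hx : ω.Adm x) : (ω.ext hf x).IsExt := by
  refine ⟨by rw [ext_snd_length hf h hx]; omega, ?_⟩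
  rw [ext_snd_length hf h hx, Nat.add_sub_cancel, ext_snd_nth hf h hx le_rfl, YBWalk.nth_length,
    ext_fst hf h hx]
  exact arcFace_side_side f₀ ω.1 x (Ne.symm hx.1)

/-- The mid-edge before the last arc of a walk of class `Ext` is a side of `f₀`. [folklore] -/
private theorem exists_prevSide (h : ω.IsExt) : ∃ s : Side, f₀.side s = ω.2.nth (ω.2.arcs.length - 1) :=
  (Face.exists_side_eq_iff f₀ _).2 (MidEdge.commonFace_eq_some h.2).2.1

variable (ω) in
/-- The side of `f₀` crossed before the last arc (class `Ext`). [folklore] -/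
def prevSide (h : ω.IsExt) : Side := Classical.choose (exists_prevSide h)

/-- `prevSide` is that side. [folklore] -/
private theorem side_prevSide (h : ω.IsExt) : f₀.side (ω.prevSide h) = ω.2.nth (ω.2.arcs.length - 1) :=
  Classical.choose_spec (exists_prevSide h)

variable (ω) in
/-- **The arrival walk under a walk of class `Ext`**: drop the last arc (junk: `ω` itself otherwise).
[folklore] -/
def base : ΩF Dl a f₀ :=
  if h : ω.IsExt then ⟨ω.prevSide h, (ω.2.dropLast h.1).cast rfl (side_prevSide h).symm⟩ else ω

/-- The label of the base walk. [folklore] -/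
private theorem base_fst (h : ω.IsExt) : (ω.base).1 = ω.prevSide h := by rw [base, dif_pos h]

/-- The base walk has one arc less. [folklore] -/
private theorem base_snd_length (h : ω.IsExt) : (ω.base).2.arcs.length = ω.2.arcs.length - 1 := by
  rw [base, dif_pos h]; dsimp only
  rw [YBWalk.length_arcs, YBWalk.cast_mids, ← YBWalk.length_arcs]; apply YBWalk.dropLast_length

/-- The base walk agrees with the walk. [folklore] -/
private theorem base_snd_nth (h : ω.IsExt) {i : ℕ} (hi : i ≤ ω.2.arcs.length - 1) : (ω.base).2.nth i = ω.2.nth i := by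
  rw [base, dif_pos h]; dsimp only
  rw [YBWalk.nth, YBWalk.cast_mids, ← YBWalk.nth]; apply YBWalk.dropLast_nth; exact hi

/-- **The base walk is an arrival walk**: its last arc (if any) precedes an arc in `f₀`, so it is not in
`f₀`. [folklore] -/
private theorem base_not_isExt (h : ω.IsExt) : ¬(ω.base).IsExt := by
  rintro ⟨hpos, hface⟩
  have hn := h.1
  rw [base_snd_length h] at hpos hface
  rw [base_snd_nth h (by omega)] at hface
  have e2 : f₀.side (ω.base).1 = ω.2.nth (ω.2.arcs.length - 1) := by rw [base_fst h, side_prevSide h]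
  rw [e2] at hface
  have hch := ω.2.chain_nth (i := ω.2.arcs.length - 1 - 1) (by omega)
  rw [show ω.2.arcs.length - 1 - 1 + 1 = ω.2.arcs.length - 1 by omega,
    show ω.2.arcs.length - 1 - 1 + 2 = ω.2.arcs.length by omega, hface, YBWalk.nth_length, h.2] at hch
  exact hch rfl

/-- The dropped arc is an admissible extension of the base walk. [folklore] -/
private theorem base_adm (h : ω.IsExt) : (ω.base).Adm ω.1 := by
  have hn := h.1
  refine ⟨?_, ?_, ?_, ?_⟩
  · intro e
    rw [base_fst h] at e
    have h1 := side_prevSide h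
    rw [← e] at h1
    have := ω.2.nth_inj (i := ω.2.arcs.length - 1) (j := ω.2.arcs.length) (by omega) le_rfl
      (by rw [← h1, YBWalk.nth_length])
    omega
  · rw [YBWalk.mem_mids_iff_nth]
    rintro ⟨i, hi, e⟩
    rw [base_snd_length h] at hi
    rw [base_snd_nth h hi] at e
    have := ω.2.nth_inj (by omega) le_rfl (e.trans (ω.2.nth_length).symm)
    omega
  · intro hWE i hi hSN
    rw [base_snd_length h] at hi
    rw [base_snd_nth h (by omega), base_snd_nth h (by omega)] at hSN
    rw [base_fst h, side_prevSide h] at hWE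
    exact ω.2.nc_nth (i := ω.2.arcs.length - 1) (j := i) (by omega) (by omega) f₀
      (by rw [show ω.2.arcs.length - 1 + 1 = ω.2.arcs.length by omega, YBWalk.nth_length]; exact hWE) hSN
  · intro hSN i hi hWE
    rw [base_snd_length h] at hi
    rw [base_snd_nth h (by omega), base_snd_nth h (by omega)] at hWE
    rw [base_fst h, side_prevSide h] at hSN
    exact ω.2.nc_nth (i := i) (j := ω.2.arcs.length - 1) (by omega) (by omega) f₀ hWE
      (by rw [show ω.2.arcs.length - 1 + 1 = ω.2.arcs.length by omega, YBWalk.nth_length]; exact hSN)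

/-- Two labelled walks with the same label and the same mid-edges are equal. [folklore] -/
private theorem eq_of_mids {ω ω' : ΩF Dl a f₀} (h1 : ω.1 = ω'.1) (h2 : ω.2.mids = ω'.2.mids) : ω = ω' := by
  obtain ⟨s, γ⟩ := ω
  obtain ⟨s', γ'⟩ := ω'
  simp only at h1
  subst h1
  simp only [Sigma.mk.injEq, heq_eq_eq, true_and]
  exact YBWalk.ext h2

/-- Extending the base walk by the dropped arc gives back the walk. [folklore] -/
private theorem ext_base (hf : f₀ ∈ Dl) (h : ω.IsExt) : (ω.base).ext hf ω.1 = ω := by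
  have hA := base_not_isExt h
  have hx := base_adm h
  have hn := h.1
  have hlen : ((ω.base).ext hf ω.1).2.arcs.length = ω.2.arcs.length := by
    rw [ext_snd_length hf hA hx, base_snd_length h]; omega
  apply eq_of_mids
  · exact ext_fst hf hA hx
  · apply YBWalk.mids_ext_nth
    · exact hlen
    · intro i hi
      rcases Nat.lt_or_eq_of_le hi with hi | hi
      · rw [ext_snd_nth hf hA hx (by rw [base_snd_length h]; omega), base_snd_nth h (by omega)]
      · have e1 := ((ω.base).ext hf ω.1).2.nth_length
        rw [hlen] at e1
        rw [hi, e1.trans (congrArg f₀.side (ext_fst hf hA hx)), YBWalk.nth_length]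

/-- The base of an extension is the walk. [folklore] -/
private theorem base_ext (hf : f₀ ∈ Dl) (h : ¬ω.IsExt) {x : Side} (hx : ω.Adm x) : (ω.ext hf x).base = ω := by
  have hE := ext_isExt hf h hx
  apply eq_of_mids
  · rw [base_fst hE]
    apply Face.side_injective f₀
    rw [side_prevSide hE, ext_snd_length hf h hx, Nat.add_sub_cancel, ext_snd_nth hf h hx le_rfl,
      YBWalk.nth_length]
  · apply YBWalk.mids_ext_nth
    · rw [base_snd_length hE, ext_snd_length hf h hx]; rfl
    · intro i hi
      rw [base_snd_nth hE (by rw [ext_snd_length hf h hx]; omega), ext_snd_nth hf h hx hi]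

/-! #### The sums -/

variable (Dl a f₀) in
/-- The ARRIVAL walks: the trivial walk (when `a` is a side of `f₀`) and the walks whose last arc is not
drawn in `f₀`. [folklore] -/
def setArr : Finset (ΩF Dl a f₀) := Finset.univ.filter fun ω => ¬ω.IsExt

variable (Dl a f₀) in
/-- The walks of class `Ext`. [folklore] -/
def setExt : Finset (ΩF Dl a f₀) := Finset.univ.filter fun ω => ω.IsExt

variable (ω) in
/-- The admissible extension sides of a labelled walk. [folklore] -/
def admSet : Finset Side := Finset.univ.filter fun x => ω.Adm x

/-- Membership in `admSet`. [folklore] -/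
private theorem mem_admSet {x : Side} : x ∈ ω.admSet ↔ ω.Adm x := by simp [admSet]

/-- The total splits into arrival walks and extensions. [folklore] -/
private theorem sum_split (F : ΩF Dl a f₀ → ℂ) :
    ∑ ω, F ω = ∑ ω ∈ setArr Dl a f₀, F ω + ∑ ω ∈ setExt Dl a f₀, F ω := by
  rw [setArr, setExt, ← Finset.sum_filter_add_sum_filter_not Finset.univ (fun ω : ΩF Dl a f₀ => ω.IsExt),
    add_comm]

/-- **The extensions re-indexed over (arrival walk, admissible side)** — the bijection `base`/`ext`.
[cite: Glazman2015WeightedSAW, Lemma 3.1 (proof: "walks in the same group differ only inside" the rhombus)] -/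
theorem sum_ext (hf : f₀ ∈ Dl) (F : ΩF Dl a f₀ → ℂ) :
    ∑ ω ∈ setExt Dl a f₀, F ω = ∑ ω ∈ setArr Dl a f₀, ∑ x ∈ ω.admSet, F (ω.ext hf x) := by
  rw [← Finset.sum_sigma (setArr Dl a f₀) (fun ω => ω.admSet) (fun p => F (p.1.ext hf p.2))]
  refine Finset.sum_nbij' (fun ω => ⟨ω.base, ω.1⟩) (fun p => p.1.ext hf p.2) ?_ ?_ ?_ ?_ ?_
  · intro ω hω
    simp only [setExt, Finset.mem_filter, Finset.mem_univ, true_and] at hω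
    simp only [Finset.mem_sigma, setArr, admSet, Finset.mem_filter, Finset.mem_univ, true_and]
    exact ⟨base_not_isExt hω, base_adm hω⟩
  · rintro ⟨P, x⟩ hp
    simp only [Finset.mem_sigma, setArr, admSet, Finset.mem_filter, Finset.mem_univ, true_and] at hp
    simp only [setExt, Finset.mem_filter, Finset.mem_univ, true_and]
    exact ext_isExt hf hp.1 hp.2
  · intro ω hω
    simp only [setExt, Finset.mem_filter, Finset.mem_univ, true_and] at hω
    exact ext_base hf hω
  · rintro ⟨P, x⟩ hp
    simp only [Finset.mem_sigma, setArr, admSet, Finset.mem_filter, Finset.mem_univ, true_and] at hp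
    simp only [Sigma.mk.injEq]
    refine ⟨base_ext hf hp.1 hp.2, ?_⟩
    rw [ext_fst hf hp.1 hp.2]
  · intro ω hω
    simp only [setExt, Finset.mem_filter, Finset.mem_univ, true_and] at hω
    simp only
    rw [ext_base hf hω]

/-- **Grouping by the last arc**: a sum over all walks ending on `∂f₀` is the sum over the arrival walks
of (the walk + its admissible one-arc extensions inside `f₀`). [cite: Glazman2015WeightedSAW, Lemma 3.1 (proof: grouping of the walks at a rhombus)] -/
theorem sum_eq_sum_bracket (hf : f₀ ∈ Dl) (F : ΩF Dl a f₀ → ℂ) :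
    ∑ ω, F ω = ∑ ω ∈ setArr Dl a f₀, (F ω + ∑ x ∈ ω.admSet, F (ω.ext hf x)) := by
  rw [sum_split, sum_ext hf, ← Finset.sum_add_distrib]

/-! #### Arrival walks: which sides of `f₀` they touch -/

/-- **A side of `f₀` crossed earlier by an arrival walk carries an arc of the walk in `f₀`.** For an
interior crossing one of the two arcs at it lies in `f₀` (consecutive arcs are in different plaquettes,
both bordering the crossed mid-edge); for the root (`i = 0`) the first arc lies in `f₀` because `a` is a
BOUNDARY root and `f₀ ∈ Dl` is then the only face of `a` in the domain. This is the only place where the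
boundary-root hypothesis is used. [cite: GlazmanManolescu2019, §2.1 (walks start on the boundary of the domain)] -/
theorem arc_of_mem_side (hf : f₀ ∈ Dl) (ha : IsBoundaryRoot Dl a) (h : ¬ω.IsExt) {x : Side} (hx : x ≠ ω.1)
    (hmem : f₀.side x ∈ ω.2.mids) :
    ∃ i < ω.2.arcs.length, arcFace (ω.2.nth i, ω.2.nth (i + 1)) = some f₀ ∧
      (ω.2.nth i = f₀.side x ∨ ω.2.nth (i + 1) = f₀.side x) := by
  obtain ⟨i, hi, e⟩ := (ω.2.mem_mids_iff_nth).1 hmem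
  have hin : i ≠ ω.2.arcs.length := by
    rintro rfl
    rw [YBWalk.nth_length] at e
    exact hx (f₀.side_injective e).symm
  have hi' : i < ω.2.arcs.length := lt_of_le_of_ne hi hin
  rcases Nat.eq_zero_or_pos i with rfl | hpos
  · -- the walk starts on the side `x` of `f₀`: its first arc lies in `f₀` (boundary root)
    rw [YBWalk.nth_zero] at e
    obtain ⟨g, hgD, hg⟩ := ω.2.arc_nth hi'
    refine ⟨0, hi', ?_, Or.inl (by rw [YBWalk.nth_zero, e])⟩
    have hg' := (MidEdge.commonFace_eq_some hg).2.1
    rw [YBWalk.nth_zero] at hg'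
    have hf' := (Face.exists_side_eq_iff f₀ a).1 ⟨x, e.symm⟩
    have hgDl : g ∈ Dl := hgD
    have hfg : g = f₀ := by
      rcases ha with ⟨-, h2⟩ | ⟨h1, -⟩
      · rcases hg' with hg' | hg'
        · rcases hf' with hf' | hf'
          · exact hg'.trans hf'.symm
          · exact absurd (hf' ▸ hf) h2
        · exact absurd (hg' ▸ hgDl) h2
      · rcases hg' with hg' | hg'
        · exact absurd (hg' ▸ hgDl) h1
        · rcases hf' with hf' | hf'
          · exact absurd (hf' ▸ hf) h1
          · exact hg'.trans hf'.symm
    rw [hfg] at hg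
    exact hg
  · obtain ⟨g₁, -, hg₁⟩ := ω.2.arc_nth (show i - 1 < ω.2.arcs.length by omega)
    obtain ⟨g₂, -, hg₂⟩ := ω.2.arc_nth hi'
    rw [show i - 1 + 1 = i by omega] at hg₁
    have hne : g₁ ≠ g₂ := by
      intro hg
      subst hg
      have := ω.2.chain_nth (i := i - 1) (by omega)
      rw [show i - 1 + 1 = i by omega, show i - 1 + 2 = i + 1 by omega, hg₁, hg₂] at this
      exact this rfl
    rw [e] at hg₁ hg₂
    rcases face_eq_or_of_side hg₁ hg₂ hne with rfl | rfl
    · exact ⟨i - 1, by omega, by rw [show i - 1 + 1 = i by omega, e]; exact hg₁,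
        Or.inr (by rw [show i - 1 + 1 = i by omega, e])⟩
    · exact ⟨i, hi', by rw [e]; exact hg₂, Or.inl e⟩

/-- An earlier arc of an arrival walk in `f₀` does not touch the arrival side. [folklore] -/
private theorem ends_ne_of_arc (h : ¬ω.IsExt) {i : ℕ} (hi : i < ω.2.arcs.length)
    (hface : arcFace (ω.2.nth i, ω.2.nth (i + 1)) = some f₀) :
    ω.2.nth i ≠ f₀.side ω.1 ∧ ω.2.nth (i + 1) ≠ f₀.side ω.1 := by
  constructor
  · intro e
    have := ω.2.nth_inj hi.le le_rfl (e.trans (ω.2.nth_length).symm)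
    omega
  · intro e
    have := ω.2.nth_inj (i := i + 1) (by omega) le_rfl (e.trans (ω.2.nth_length).symm)
    rw [e] at hface
    apply h
    refine ⟨by omega, ?_⟩
    rw [show ω.2.arcs.length - 1 = i by omega]
    exact hface

/-- **Fresh plaquette**: if an arrival walk has no arc in `f₀`, all three one-arc extensions inside
`f₀` are admissible. [folklore] -/
private theorem adm_of_no_arc (hf : f₀ ∈ Dl) (ha : IsBoundaryRoot Dl a) (h : ¬ω.IsExt)
    (hno : ∀ i < ω.2.arcs.length, arcFace (ω.2.nth i, ω.2.nth (i + 1)) ≠ some f₀) {x : Side} (hx : x ≠ ω.1) :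
    ω.Adm x := by
  refine ⟨hx, ?_, ?_, ?_⟩
  · intro hmem
    obtain ⟨i, hi, hface, -⟩ := arc_of_mem_side hf ha h hx hmem
    exact hno i hi hface
  · intro _ i hi hSN; exact hno i hi (arcFace_of_isSN hSN)
  · intro _ i hi hWE; exact hno i hi (arcFace_of_isWE hWE)

/-! #### Every group sums to zero -/

/-- **Every group sums to zero** for the degenerate family: an arrival walk plus its admissible
one-arc extensions inside `f₀` contribute `0` to the vertex functional — the group-one identity on a
fresh plaquette, the pair identity on a plaquette crossed once by a turning arc, nothing to sum after a
straight arc (`v = 0`), and no arrival is possible at a plaquette crossed twice.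
[cite: Glazman2015WeightedSAW, Lemma 3.1 (proof: "the total contribution of each group is zero")] -/
theorem bracket_eq_zero {ε s t : ℂ} (ht : t ^ 4 = 1) (hε : ε = 1 ∨ ε = -1) (hs : s = 1 ∨ s = -1) (u₁ : ℂ)
    (hf : f₀ ∈ Dl) (ha : IsBoundaryRoot Dl a) (h : ¬ω.IsExt) :
    term (degenWeights ε s t u₁) t (degenCoeff ε s t) ω +
      ∑ x ∈ ω.admSet, term (degenWeights ε s t u₁) t (degenCoeff ε s t) (ω.ext hf x) = 0 := by
  set W := degenWeights ε s t u₁ with hW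
  set c := degenCoeff ε s t with hc
  have ht0 : t ≠ 0 := fun h0 => by rw [h0] at ht; norm_num at ht
  set p := ω.1 with hp
  set E := extW W ω.2 f₀ with hE
  set T := t ^ quarterTurnsL ω.2.mids with hT
  have hself : term W t c ω = c (slotIdx p) * (E * locW W (ω.2.kindsIn f₀) * T) := by
    rw [term, weightL_eq_extW_mul]
  have hext : ∀ x ∈ ω.admSet, term W t c (ω.ext hf x) =
      E * T * (c (slotIdx x) * locW W (ω.2.kindsIn f₀ ++ [arcKind p x]) * t ^ qTurn p x) := by
    intro x hx
    have hx' : ω.Adm x := mem_admSet.1 hx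
    have harcs := ext_snd_arcs hf h hx'
    have hpx : p ≠ x := Ne.symm hx'.1
    have hfa : arcFace (f₀.side p, f₀.side x) = some f₀ := arcFace_side_side f₀ p x hpx
    rw [term, weightL_eq_extW_mul W _ f₀, extW_of_snoc W ω.2 _ f₀ harcs hfa,
      YBWalk.kindsIn_of_snoc ω.2 _ f₀ harcs hfa, arcKindOf_eq hfa rfl rfl,
      quarterTurnsL_of_snoc ω.2 _ harcs, qTurnOf_side_side f₀ hpx, zpow_add₀ ht0, ext_fst hf h hx']
    simp only [List.reduceOption_cons_of_some, List.reduceOption_nil]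
    ring
  rw [hself, Finset.sum_congr rfl hext, ← Finset.mul_sum]
  -- membership in the filtered arc list
  have hfilt : ∀ {i : ℕ}, i < ω.2.arcs.length → arcFace (ω.2.nth i, ω.2.nth (i + 1)) = some f₀ →
      (ω.2.nth i, ω.2.nth (i + 1)) ∈ (arcsOf ω.2.mids).filter fun q => arcFace q = some f₀ :=
    fun hi e => List.mem_filter.2 ⟨ω.2.arc_nth_mem hi, by simpa using e⟩
  rcases filter_face_cases ω.2 f₀ with h0 | ⟨q₁, h1, hq₁⟩ | ⟨q₁, q₂, h2, hne, hq₁, hq₂, -⟩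
  · -- no arc of `ω` in `f₀`: the three one-arc extensions, the group-one identity
    have hK : ω.2.kindsIn f₀ = [] := by rw [kindsIn_eq_filterMap_filter, h0]; rfl
    have hno : ∀ i < ω.2.arcs.length, arcFace (ω.2.nth i, ω.2.nth (i + 1)) ≠ some f₀ := by
      intro i hi e
      have := hfilt hi e
      rw [h0] at this
      simp at this
    have hadm : ω.admSet = Finset.univ.erase p := by
      ext x
      simp only [mem_admSet, Finset.mem_erase, Finset.mem_univ, and_true]
      exact ⟨fun hx => hx.1, fun hx => adm_of_no_arc hf ha h hno hx⟩
    rw [hK, hadm]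
    have key := groupOne_degen ht hε hs u₁ p
    rw [← Finset.add_sum_erase _ _ (Finset.mem_univ p), arcKind_self, qTurn_self] at key
    simp only [List.nil_append, locW_single, locW_nil, arcW, zpow_zero, mul_one] at key ⊢
    linear_combination E * T * key
  · -- one arc `q₁` of `ω` in `f₀`
    have hq₁m : q₁ ∈ ω.2.arcs := by
      have : q₁ ∈ (arcsOf ω.2.mids).filter fun q => arcFace q = some f₀ := by rw [h1]; simp
      exact (List.mem_filter.1 this).1
    obtain ⟨s₁, s₂, h12, hs₁, hs₂, hk⟩ := exists_sides_of_arcFace hq₁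
    obtain ⟨i, hi, hqi⟩ := (ω.2.mem_arcs_iff_nth).1 hq₁m
    obtain ⟨hne₁, hne₂⟩ := ends_ne_of_arc h hi (by rw [← hqi]; exact hq₁)
    rw [hqi] at hs₁ hs₂
    simp only at hs₁ hs₂
    have hps₁ : p ≠ s₁ := fun e => hne₁ (by rw [← hs₁, ← e, hp])
    have hps₂ : p ≠ s₂ := fun e => hne₂ (by rw [← hs₂, ← e, hp])
    have hK : ω.2.kindsIn f₀ = [arcKind s₁ s₂] := by
      rw [kindsIn_eq_filterMap_filter, h1, List.filterMap_cons, hk, List.filterMap_nil]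
    have hmem₁ : f₀.side s₁ ∈ ω.2.mids := by rw [hs₁]; exact ω.2.nth_mem hi.le
    have hmem₂ : f₀.side s₂ ∈ ω.2.mids := by rw [hs₂]; exact ω.2.nth_mem (by omega)
    rw [hK]
    by_cases hkst : arcKind s₁ s₂ = .straight
    · -- a straight arc: every term carries the weight `v = 0`
      rw [hkst]
      have hv : arcW W .straight = 0 := by simp [arcW, hW, degenWeights]
      simp only [locW_single, hv, List.singleton_append, locW_pair, pairW, mul_zero, zero_mul,
        Finset.sum_const_zero, add_zero]
    · -- a turning arc: the completing arc to the fourth side, the pair identity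
      set s₄ := Side.fourth p s₁ s₂ with hs₄
      obtain ⟨h4p, h41, h42, huniq⟩ := Side.fourth_spec hps₁ hps₂ h12
      have hcomp : arcKind p s₄ = arcKind s₁ s₂ := arcKind_compl h4p.symm hps₁ hps₂ h41 h42 h12
      have hadm : ω.admSet = {s₄} := by
        ext x
        simp only [mem_admSet, Finset.mem_singleton]
        constructor
        · intro hx
          refine huniq x hx.1 ?_ ?_
          · rintro rfl; exact hx.2.1 hmem₁
          · rintro rfl; exact hx.2.1 hmem₂
        · rintro rfl
          refine ⟨h4p, ?_, ?_, ?_⟩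
          · intro hmem
            obtain ⟨j, hj, hface, hend⟩ := arc_of_mem_side hf ha h h4p hmem
            have hmf := hfilt hj hface
            rw [h1, List.mem_singleton, hqi, Prod.mk.injEq] at hmf
            rcases hend with hend | hend
            · rw [hmf.1, ← hs₁] at hend; exact h41 (f₀.side_injective hend).symm
            · rw [hmf.2, ← hs₂] at hend; exact h42 (f₀.side_injective hend).symm
          · intro hWE; exact (hkst (hcomp.symm.trans (arcKind_of_isWE hWE))).elim
          · intro hSN; exact (hkst (hcomp.symm.trans (arcKind_of_isSN hSN))).elim
      have key := pair_degen ht hε hs u₁ h4p.symm (by rw [hcomp]; exact hkst)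
      rw [hcomp] at key
      rw [hadm, Finset.sum_singleton, hcomp]
      simp only [locW_single, List.singleton_append, locW_pair]
      linear_combination E * T * key
  · -- two arcs in `f₀` would use all four sides, leaving none for the arrival
    exfalso
    have hm : ∀ q, q ∈ [q₁, q₂] → q ∈ ω.2.arcs := by
      intro q hq
      have : q ∈ (arcsOf ω.2.mids).filter fun q => arcFace q = some f₀ := by rw [h2]; exact hq
      exact (List.mem_filter.1 this).1
    have hq₁m := hm q₁ (by simp)
    have hq₂m := hm q₂ (by simp)
    obtain ⟨e11, e12, e21, e22⟩ := arcs_ends_ne ω.2 hq₁m hq₂m hne hq₁ hq₂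
    obtain ⟨s₁, s₂, h12, hs₁, hs₂, -⟩ := exists_sides_of_arcFace hq₁
    obtain ⟨s₃, s₄, h34, hs₃, hs₄, -⟩ := exists_sides_of_arcFace hq₂
    obtain ⟨i, hi, hqi⟩ := (ω.2.mem_arcs_iff_nth).1 hq₁m
    obtain ⟨j, hj, hqj⟩ := (ω.2.mem_arcs_iff_nth).1 hq₂m
    obtain ⟨hne₁, hne₂⟩ := ends_ne_of_arc h hi (by rw [← hqi]; exact hq₁)
    obtain ⟨hne₃, hne₄⟩ := ends_ne_of_arc h hj (by rw [← hqj]; exact hq₂)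
    rw [hqi] at hs₁ hs₂
    rw [hqj] at hs₃ hs₄
    rw [hqi, hqj] at e11 e12 e21 e22
    simp only at hs₁ hs₂ hs₃ hs₄ e11 e12 e21 e22
    rw [← hs₁] at e11 e12 hne₁
    rw [← hs₂] at e21 e22 hne₂
    rw [← hs₃] at e11 e21 hne₃
    rw [← hs₄] at e12 e22 hne₄
    have n13 : s₁ ≠ s₃ := fun e => e11 (by rw [e])
    have n14 : s₁ ≠ s₄ := fun e => e12 (by rw [e])
    have n23 : s₂ ≠ s₃ := fun e => e21 (by rw [e])
    have n24 : s₂ ≠ s₄ := fun e => e22 (by rw [e])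
    have n1 : ω.1 ≠ s₁ := fun e => hne₁ (by rw [e])
    have n2 : ω.1 ≠ s₂ := fun e => hne₂ (by rw [e])
    have n3 : ω.1 ≠ s₃ := fun e => hne₃ (by rw [e])
    have n4 : ω.1 ≠ s₄ := fun e => hne₄ (by rw [e])
    exact side_five h12 n13 n14 n23 n24 h34 n1 n2 n3 n4

end ΩF

/-! ### The theorems -/

variable {ε s t : ℂ}

/-- ★ **The vertex functional of the degenerate family vanishes** at every face of every finite face list
for every boundary root, hole roots included. [cite: Glazman2015WeightedSAW, Lemma 3.1 (σ = 1 family, (3.8)–(3.10), p. 6)] -/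
theorem vertexFunctional_degen_eq_zero (ht : t ^ 4 = 1) (hε : ε = 1 ∨ ε = -1) (hs : s = 1 ∨ s = -1) (u₁ : ℂ)
    {Dl : List Face} {a : MidEdge} {f₀ : Face} (hf : f₀ ∈ Dl) (ha : IsBoundaryRoot Dl a) :
    vertexFunctional (degenWeights ε s t u₁) t (degenCoeff ε s t) Dl a f₀ = 0 := by
  rw [vertexFunctional_eq_sum_term, ΩF.sum_eq_sum_bracket hf]
  refine Finset.sum_eq_zero fun ω hω => ΩF.bracket_eq_zero ht hε hs u₁ hf ha ?_
  classical
  simpa [ΩF.setArr] using hω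

/-- ★ **Sufficiency on the `v = 0` boundary**: every member of the degenerate family satisfies the exact
plaquette vertex relation of the ALL-BOUNDARY-ROOTS technique class `ExactPlaquetteVertexRelation` with
the coefficients `(1, st, ε, εst)`. [cite: Glazman2015WeightedSAW, Lemma 3.1 (σ = 1 family, (3.8)–(3.10), p. 6)] -/
theorem exactPlaquetteVertexRelation_degen (ht : t ^ 4 = 1) (hε : ε = 1 ∨ ε = -1) (hs : s = 1 ∨ s = -1)
    (u₁ : ℂ) : ExactPlaquetteVertexRelation (degenWeights ε s t u₁) t (degenCoeff ε s t) :=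
  fun _ _ _ hf ha => vertexFunctional_degen_eq_zero ht hε hs u₁ hf ha

/-! ### The two-sided classification on the `v = 0` boundary -/

/-- ★ **Two-sided classification of the `v = 0` boundary** (`u₁u₂ ≠ 0`, any phase `t ≠ 0`): an exact
plaquette vertex relation with some nonzero coefficient vector on every finite face list for every
boundary root EXISTS iff the spin is an integer (`t⁴ = 1`) and the weights are a member of the degenerate
family (free parameter `u₁`). Necessity: the tree's `degenerate_rigidity`; sufficiency: this file.
[cite: Glazman2015WeightedSAW, Lemma 3.1 (proof p. 7: "If v = 0, the solution exists for each θ if and only if σ = 1")] -/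
theorem exactPlaquetteVertexRelation_iff_degen (W : CWeights) {t : ℂ} (ht : t ≠ 0) (h1 : W.u₁ ≠ 0)
    (h2 : W.u₂ ≠ 0) (hv : W.v = 0) :
    (∃ c : Fin 4 → ℂ, c ≠ 0 ∧ ExactPlaquetteVertexRelation W t c) ↔
      (t ^ 4 = 1 ∧ ∃ ε s : ℂ, (ε = 1 ∨ ε = -1) ∧ (s = 1 ∨ s = -1) ∧ W = degenWeights ε s t W.u₁) := by
  constructor
  · rintro ⟨c, hc, hrel⟩
    obtain ⟨ht4, ε, hε, ha0, hb0, hbt, hR3, hR2, hR1⟩ := degenerate_rigidity hrel ht h1 h2 hv hc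
    have htA : t * (c 0 + ε * c 2) ≠ 0 := mul_ne_zero ht ha0
    obtain ⟨σ, hBσ⟩ : ∃ σ : ℂ, c 1 + ε * c 3 = σ * t * (c 0 + ε * c 2) :=
      ⟨(c 1 + ε * c 3) / (t * (c 0 + ε * c 2)), by field_simp⟩
    have hσ2 : σ ^ 2 = 1 := by
      have h : (t * (c 0 + ε * c 2)) ^ 2 * (σ ^ 2 - 1) = 0 := by
        rw [hBσ] at hbt; linear_combination hbt
      linear_combination (mul_eq_zero.1 h).resolve_left (pow_ne_zero _ htA)
    refine ⟨ht4, ε, σ, hε, ?_, ?_⟩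
    · have h : (σ - 1) * (σ + 1) = 0 := by linear_combination hσ2
      rcases mul_eq_zero.1 h with h | h
      · left; linear_combination h
      · right; linear_combination h
    · obtain ⟨u₁, u₂, v, w₁, w₂⟩ := W
      simp only at h1 h2 hv hR3 hR2 hR1 ⊢
      subst hv
      rw [hBσ] at hR3 hR2 hR1
      have hu₂' := (mul_eq_zero.1 (show (c 0 + ε * c 2) * (u₂ * t ^ 2 + ε * u₁ + σ * t ^ 2) = 0 by
        linear_combination hR3)).resolve_left ha0
      have hu₂ : u₂ = -σ - ε * t ^ 2 * u₁ := by linear_combination t ^ 2 * hu₂' - (u₂ + σ) * ht4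
      have hw₁ := (mul_eq_zero.1 (show (c 0 + ε * c 2) * (w₁ + ε * σ * t ^ 2 * u₁) = 0 by
        linear_combination hR2)).resolve_left ha0
      have hw₂ := (mul_eq_zero.1 (show t * (c 0 + ε * c 2) * (w₂ + σ * u₂) = 0 by
        linear_combination hR1)).resolve_left htA
      simp only [degenWeights, CWeights.mk.injEq, true_and]
      exact ⟨hu₂, by linear_combination hw₁, by linear_combination hw₂ - σ * hu₂⟩
  · rintro ⟨ht4, ε, s, hε, hs, hW⟩
    refine ⟨degenCoeff ε s t, degenCoeff_ne_zero ε s t, ?_⟩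
    rw [hW]
    exact exactPlaquetteVertexRelation_degen ht4 hε hs W.u₁

/-- **Named statement `PlaquetteWalkDegenerateIdentity`** (positive side of the catalogue): for every
`t` with `t⁴ = 1`, all signs `ε, s = ±1` and every `u₁ ∈ ℂ`, the degenerate weights
`(u₁, −s − εt²u₁, 0, −εst²u₁, −s u₂)` carry the exact plaquette vertex relation with coefficients
`(1, st, ε, εst)` at EVERY face of EVERY finite face list for EVERY boundary root (hole roots included).
A THEOREM of this file (`PlaquetteWalkDegenerateIdentity_holds`), not a cited claim; in print for the
member `u₁ + u₂ = 1, w₁ = u₁, w₂ = u₂` on parallelograms with the root on the outer boundary.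
[cite: Glazman2015WeightedSAW, Lemma 3.1 ((3.8)–(3.10), p. 6)] -/
def _root_.Literature.Barriers.CriticalPhenomena.PlaquetteWalkDegenerateIdentity : Prop :=
  ∀ (ε s t u₁ : ℂ), t ^ 4 = 1 → (ε = 1 ∨ ε = -1) → (s = 1 ∨ s = -1) →
    ExactPlaquetteVertexRelation (degenWeights ε s t u₁) t (degenCoeff ε s t)

/-- **`PlaquetteWalkDegenerateIdentity` holds.** [cite: Glazman2015WeightedSAW, Lemma 3.1] -/
theorem _root_.Literature.Barriers.CriticalPhenomena.PlaquetteWalkDegenerateIdentity_holds :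
    PlaquetteWalkDegenerateIdentity :=
  fun _ _ _ u₁ ht hε hs => exactPlaquetteVertexRelation_degen ht hε hs u₁

/-- **Barrier `PlaquetteWalkDegenerateClassification`** (named statement): on the `v = 0` boundary of the
five-weight plaquette walk on `ℤ²` (`u₁u₂ ≠ 0`, any phase `t ≠ 0`) the all-boundary-roots technique class
is classified two-sidedly: a nonzero exact vertex relation exists iff `t⁴ = 1` and the weights belong to
the degenerate family. A THEOREM of this file (`PlaquetteWalkDegenerateClassification_holds`).

BARRIER (structured block, D-0021):
- technique_class: plaquette-local linear vertex relations `Σ_{s ∈ (E,N,W,S)} c_s F(z_s) = 0` with a constant coefficient vector `c ∈ ℂ⁴ ∖ {0}` for the Glazman–Manolescu plaquette walk on `ℤ²` with complex weights `(u₁, u₂, 0, w₁, w₂)`, `u₁u₂ ≠ 0` (no straight passages), phase `t ≠ 0` per left quarter turn, demanded at every face of every finite face list for every boundary root — the predicate `ExactPlaquetteVertexRelation W t c` of `PlaquetteWalkSpinRigidity`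
- blocks: any such identity at a non-integer spin (`t⁴ ≠ 1`), and at integer spin any identity for weights off the one-parameter lines `u₂ = −s − εt²u₁`, `w₁ = −εst²u₁`, `w₂ = −s u₂` (`ε, s = ±1`); conversely it PROVIDES the identity on those lines, on all face lists and at all boundary roots including hole roots — so, unlike the `v ≠ 0` family (`PlaquetteWalkNoAllRootsRelation`: empty all-roots class), no outer-root / simply-connectedness hypothesis is needed here
- because: necessity is the tree's `degenerate_rigidity` (group-one rows and adjacent-excursion forms on finitely many row-convex instances force `t⁴ = 1`, `b² = t²a²` and the line); sufficiency is `exactPlaquetteVertexRelation_degen`: grouping the walks at a plaquette by their LAST arc, every group cancels by one of four group-one or eight pair identities, each an algebraic identity modulo `t⁴ = 1` — a local count with no winding input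
- evasions_known: leave the `v = 0` boundary (then `t¹⁶ = −1` and the sixteen Yang–Baxter curves, outer roots only: `PlaquetteWalkYBClassificationAllSpins_holds`, `PlaquetteWalkNoAllRootsRelation_holds`); the branches `u₁ = 0` / `u₂ = 0` (outside this statement: classified on the corners `u₁ = w₁ = 0` and `u₂ = w₂ = 0` by `PlaquetteWalkDirectedCornerClassification` / `PlaquetteWalkMirrorCornerClassification` below; open there only the slivers `u_i = 0 ∧ w_i ≠ 0`, sufficiency); non-constant or root-dependent coefficients
- scope_caveats: EXACT identities with constant coefficients only; complex weights allowed (the printed member is real: `s = −1`, `εt² = 1`); the classification is of the all-boundary-roots class — for the degenerate family the weaker classes (row-convex lists, outer roots, interior faces) coincide with it by this file's sufficiency theorem, but necessity from the INTERIOR-faces class alone is not addressed here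
- status: established — `PlaquetteWalkDegenerateClassification_holds` (this file); print has the existence of the `σ = 1` family and the dichotomy "either `v = 0` or `σ = ℓ/8`" for Cauchy–Riemann-shaped coefficients on parallelograms [cite: Glazman2015WeightedSAW, Lemma 3.1 (pp. 5–7)] [cite: IkhlefCardy2009, §3 (the v = 0 classes)]; the hole-root / general-face-list sufficiency and the coefficient-free two-sided form are not located in print (venture lane label owed, lit seats)
[cite: Glazman2015WeightedSAW, Lemma 3.1] [cite: IkhlefCardy2009, §3] -/
def _root_.Literature.Barriers.CriticalPhenomena.PlaquetteWalkDegenerateClassification : Prop :=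
  ∀ (W : CWeights) (t : ℂ), t ≠ 0 → W.u₁ ≠ 0 → W.u₂ ≠ 0 → W.v = 0 →
    ((∃ c : Fin 4 → ℂ, c ≠ 0 ∧ ExactPlaquetteVertexRelation W t c) ↔
      (t ^ 4 = 1 ∧ ∃ ε s : ℂ, (ε = 1 ∨ ε = -1) ∧ (s = 1 ∨ s = -1) ∧ W = degenWeights ε s t W.u₁))

/-- **`PlaquetteWalkDegenerateClassification` holds.** [cite: Glazman2015WeightedSAW, Lemma 3.1] -/
theorem _root_.Literature.Barriers.CriticalPhenomena.PlaquetteWalkDegenerateClassification_holds :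
    PlaquetteWalkDegenerateClassification :=
  fun W _ ht h1 h2 hv => exactPlaquetteVertexRelation_iff_degen W ht h1 h2 hv


/-! ### Appended: the one-plaquette instances through the last-arc grouping, and the branch `u₁ = 0`

On the one-plaquette face list `[f₀]` rooted at its side `p` the only arrival walk is the trivial one, so
the vertex functional IS the group-one row `Σ_x c_x · u_{kind(p,x)} · t^{qTurn p x}` (`x = p` the trivial
walk itself) — for ARBITRARY complex weights. Hence every exact vertex relation satisfies the four
group-one rows (`groupOne_row_of_exactPlaquetteVertexRelation`), and on the branch `u₁ = 0` (no weight for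
a single corner arc) the rows are `c_E + c_N u₂t⁻¹ + c_W v = 0`, `c_N + c_E u₂t + c_S v = 0`,
`c_W + c_S u₂t⁻¹ + c_E v = 0`, `c_S + c_W u₂t + c_N v = 0`, a block matrix `[[P, vI],[vI, P]]` with
`det = ((1+v)² − u₂²)((1−v)² − u₂²)`: **`quartic_eq_zero_of_exactPlaquetteVertexRelation_of_u₁_eq_zero`** —
a nonzero exact vertex relation with `u₁ = 0` forces `(1+v−u₂)(1+v+u₂)(1−v−u₂)(1−v+u₂) = 0` (any `w₁, w₂`,
any phase `t ≠ 0`). This is the NECESSITY half of the classification of the directed corner `u₁u₂ = 0`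
left open by `PlaquetteWalkDegenerateClassification` (venture lane numerics, author side: on that quartic
the relation exists at every phase, kernel dimension one, `w₁, w₂` invisible — sufficiency is typed below, § `DirectedCorner`, for `w₁ = 0`).
[cite: Glazman2015WeightedSAW, Lemma 3.1 (proof, eq. (3.11): the one-visit group)] -/

section OnePlaquette

open ΩF

variable {W : CWeights} {t : ℂ} {c : Fin 4 → ℂ}

/-- A side of a plaquette is a boundary root of the one-plaquette face list. [folklore] -/
private theorem isBoundaryRoot_single (f₀ : Face) (p : Side) : IsBoundaryRoot [f₀] (f₀.side p) := by
  obtain ⟨x, y⟩ := f₀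
  unfold IsBoundaryRoot
  cases p <;> simp [Face.side, MidEdge.faces]

/-- The trivial labelled walk at the side `p` of `f₀`. [folklore] -/
private def triv (f₀ : Face) (p : Side) : ΩF [f₀] (f₀.side p) f₀ := ⟨p, YBWalk.trivial (f₀.side p)⟩

/-- The trivial walk has no arc in `f₀`: it is an arrival walk. [folklore] -/
private theorem triv_not_isExt (f₀ : Face) (p : Side) : ¬(triv f₀ p).IsExt := fun h => by
  have h0 : (triv f₀ p).2.arcs.length = 0 := rfl
  have := h.1
  omega

/-- In the one-plaquette face list every arrival walk from a side of `f₀` is the trivial walk. [folklore] -/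
private theorem eq_triv_of_not_isExt {f₀ : Face} {p : Side} (ω : ΩF [f₀] (f₀.side p) f₀)
    (h : ¬ω.IsExt) : ω = triv f₀ p := by
  have hn : ω.2.arcs.length = 0 := by
    by_contra hne
    have hpos : 0 < ω.2.arcs.length := Nat.pos_of_ne_zero hne
    -- every arc lies in `f₀`, the only face; two consecutive arcs would both lie in `f₀`
    have hface : ∀ i, i < ω.2.arcs.length → arcFace (ω.2.nth i, ω.2.nth (i + 1)) = some f₀ := by
      intro i hi
      obtain ⟨g, hg, hgf⟩ := ω.2.arc_nth hi
      have hg' : g = f₀ := by simpa [dom] using hg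
      rw [hg'] at hgf
      exact hgf
    have h1 : ω.2.arcs.length = 1 := by
      by_contra h2
      have hch := ω.2.chain_nth (i := 0) (by omega)
      rw [hface 0 hpos] at hch
      exact hch (hface 1 (by omega)).symm
    have e : ω.2.nth 1 = f₀.side ω.1 := by rw [← h1]; exact ω.2.nth_length
    have h01 := hface 0 hpos
    rw [zero_add, e] at h01
    apply h
    refine ⟨hpos, ?_⟩
    rw [h1]
    exact h01
  -- zero arcs: the walk is trivial and ends where it starts
  have hend : f₀.side ω.1 = f₀.side p := by
    have e := ω.2.nth_length
    rw [hn, YBWalk.nth_zero] at e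
    exact e.symm
  have h1 : ω.1 = p := f₀.side_injective hend
  have hmids : ω.2.mids = [f₀.side p] := by
    have hl : ω.2.mids.length = 1 := by rw [ω.2.length_eq, hn]
    obtain ⟨hd, tl, e⟩ := List.exists_cons_of_ne_nil ω.2.mids_ne_nil
    have hhd : hd = f₀.side p := by have h' := ω.2.head_eq; rw [e] at h'; exact Option.some_injective _ h'
    have htl : tl = [] := by rw [e, List.length_cons] at hl; exact List.eq_nil_of_length_eq_zero (by omega)
    rw [e, hhd, htl]
  exact eq_of_mids h1 (by rw [hmids]; rfl)

/-- The group of the trivial walk in the one-plaquette face list is the group-one row. [folklore] -/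
private theorem bracket_triv (W : CWeights) (t : ℂ) (c : Fin 4 → ℂ) (f₀ : Face) (p : Side) :
    term W t c (triv f₀ p) + ∑ x ∈ (triv f₀ p).admSet, term W t c ((triv f₀ p).ext (List.mem_singleton_self f₀) x) =
      ∑ x : Side, c (slotIdx x) * arcW W (arcKind p x) * t ^ qTurn p x := by
  have hf : f₀ ∈ [f₀] := List.mem_singleton_self f₀
  have ha := isBoundaryRoot_single f₀ p
  have hnot := triv_not_isExt f₀ p
  have hno : ∀ i < (triv f₀ p).2.arcs.length, arcFace ((triv f₀ p).2.nth i, (triv f₀ p).2.nth (i + 1)) ≠ some f₀ := by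
    intro i hi
    have h0 : (triv f₀ p).2.arcs.length = 0 := rfl
    omega
  have hadm : (triv f₀ p).admSet = Finset.univ.erase p := by
    ext x
    simp only [mem_admSet, Finset.mem_erase, Finset.mem_univ, and_true]
    exact ⟨fun hx => hx.1, fun hx => adm_of_no_arc hf ha hnot hno hx⟩
  have hFV : (triv f₀ p).2.facesVisited = ∅ := rfl
  have hK : (triv f₀ p).2.kindsIn f₀ = [] := YBWalk.kindsIn_eq_nil (by rw [hFV]; simp)
  have hE : extW W (triv f₀ p).2 f₀ = 1 := by rw [extW, hFV]; simp
  have hT : quarterTurnsL (triv f₀ p).2.mids = 0 := rfl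
  have hself : term W t c (triv f₀ p) = c (slotIdx p) := by
    rw [term, weightL_eq_extW_mul W _ f₀, hE, hK, hT]; simp [triv]
  have hext : ∀ x ∈ (triv f₀ p).admSet, term W t c ((triv f₀ p).ext hf x) =
      c (slotIdx x) * arcW W (arcKind p x) * t ^ qTurn p x := by
    intro x hx
    have hx' : (triv f₀ p).Adm x := mem_admSet.1 hx
    have harcs := ext_snd_arcs hf hnot hx'
    have hpx : (triv f₀ p).1 ≠ x := Ne.symm hx'.1
    have hfa : arcFace (f₀.side (triv f₀ p).1, f₀.side x) = some f₀ := arcFace_side_side f₀ _ x hpx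
    rw [term, weightL_eq_extW_mul W _ f₀, extW_of_snoc W (triv f₀ p).2 _ f₀ harcs hfa,
      YBWalk.kindsIn_of_snoc (triv f₀ p).2 _ f₀ harcs hfa, arcKindOf_eq hfa rfl rfl,
      quarterTurnsL_of_snoc (triv f₀ p).2 _ harcs, qTurnOf_side_side f₀ hpx, ext_fst hf hnot hx', hE, hK, hT]
    have h1' : (triv f₀ p).1 = p := rfl
    simp only [h1', List.reduceOption_cons_of_some, List.reduceOption_nil, List.nil_append, locW_single,
      one_mul, zero_add]
    ring
  rw [hadm, Finset.sum_congr rfl (fun x hx => hext x (hadm ▸ hx)), hself,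
    ← Finset.add_sum_erase _ _ (Finset.mem_univ p), arcKind_self, qTurn_self]
  simp [arcW]

/-- **The vertex functional of the one-plaquette face list rooted at its side `p`** is the group-one
row `Σ_x c_x · u_{kind(p,x)} · t^{qTurn p x}`, for arbitrary complex weights.
[cite: Glazman2015WeightedSAW, Lemma 3.1 (proof, eq. (3.11): the one-visit group)] -/
theorem vertexFunctional_single (W : CWeights) (t : ℂ) (c : Fin 4 → ℂ) (f₀ : Face) (p : Side) :
    vertexFunctional W t c [f₀] (f₀.side p) f₀ =
      ∑ x : Side, c (slotIdx x) * arcW W (arcKind p x) * t ^ qTurn p x := by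
  have hf : f₀ ∈ [f₀] := List.mem_singleton_self f₀
  rw [vertexFunctional_eq_sum_term, sum_eq_sum_bracket hf]
  have hset : setArr [f₀] (f₀.side p) f₀ = {triv f₀ p} := by
    ext ω
    simp only [setArr, Finset.mem_filter, Finset.mem_univ, true_and, Finset.mem_singleton]
    exact ⟨fun h => eq_triv_of_not_isExt ω h, fun h => h ▸ triv_not_isExt f₀ p⟩
  rw [hset, Finset.sum_singleton]
  exact bracket_triv W t c f₀ p

/-- **Every exact vertex relation satisfies the four group-one rows** (arbitrary complex weights):
`Σ_x c_x · u_{kind(p,x)} · t^{qTurn p x} = 0` for each side `p`.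
[cite: Glazman2015WeightedSAW, Lemma 3.1 (proof, eq. (3.11))] -/
theorem groupOne_row_of_exactPlaquetteVertexRelation (hrel : ExactPlaquetteVertexRelation W t c)
    (p : Side) :
    ∑ x : Side, c (slotIdx x) * arcW W (arcKind p x) * t ^ qTurn p x = 0 := by
  rw [← vertexFunctional_single W t c (0, 0) p]
  exact hrel _ _ _ (List.mem_singleton_self _) (isBoundaryRoot_single (0, 0) p)

/-- **Necessity on the branch `u₁ = 0`** (any `u₂, v, w₁, w₂ ∈ ℂ`, any phase `t ≠ 0`): a nonzero exact
vertex relation forces the quartic `(1+v−u₂)(1+v+u₂)(1−v−u₂)(1−v+u₂) = 0` — the determinant of the four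
group-one rows, a block matrix `[[P, vI],[vI, P]]`, `P = [[1, u₂t⁻¹],[u₂t, 1]]`, factorised on the
`ρ²`-eigencomponents `c_E ± c_W`, `c_N ± c_S`. [cite: Glazman2015WeightedSAW, Lemma 3.1 (proof: "solving this linear system")] -/
theorem quartic_eq_zero_of_exactPlaquetteVertexRelation_of_u₁_eq_zero
    (hrel : ExactPlaquetteVertexRelation W t c) (ht : t ≠ 0) (h1 : W.u₁ = 0) (hc : c ≠ 0) :
    (1 + W.v - W.u₂) * (1 + W.v + W.u₂) * (1 - W.v - W.u₂) * (1 - W.v + W.u₂) = 0 := by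
  have rE := groupOne_row_of_exactPlaquetteVertexRelation hrel .E
  have rN := groupOne_row_of_exactPlaquetteVertexRelation hrel .N
  have rW := groupOne_row_of_exactPlaquetteVertexRelation hrel .W
  have rS := groupOne_row_of_exactPlaquetteVertexRelation hrel .S
  rw [sum_side] at rE rN rW rS
  simp only [slotIdx, arcKind, arcW, qTurn, h1, zpow_zero, zpow_one, zpow_neg, mul_one, mul_zero,
    zero_mul, add_zero, zero_add, Int.reduceNeg] at rE rN rW rS
  have hti : t * t⁻¹ = 1 := mul_inv_cancel₀ ht
  -- sums and differences of opposite rows (the `ρ²`-eigencomponents)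
  have hA : (1 + W.v) * (c 0 + c 2) * t + W.u₂ * (c 1 + c 3) = 0 := by
    linear_combination t * rE + t * rW - (W.u₂ * (c 1 + c 3)) * hti
  have hB : W.u₂ * (c 0 + c 2) * t + (1 + W.v) * (c 1 + c 3) = 0 := by
    linear_combination rN + rS
  have hA' : (1 - W.v) * (c 0 - c 2) * t + W.u₂ * (c 1 - c 3) = 0 := by
    linear_combination t * rE - t * rW - (W.u₂ * (c 1 - c 3)) * hti
  have hB' : W.u₂ * (c 0 - c 2) * t + (1 - W.v) * (c 1 - c 3) = 0 := by
    linear_combination rN - rS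
  -- the two 2×2 determinants
  have hP : ((1 + W.v) ^ 2 - W.u₂ ^ 2) * ((c 0 + c 2) * t) = 0 := by
    linear_combination (1 + W.v) * hA - W.u₂ * hB
  have hP2 : ((1 + W.v) ^ 2 - W.u₂ ^ 2) * (c 1 + c 3) = 0 := by
    linear_combination (1 + W.v) * hB - W.u₂ * hA
  have hM : ((1 - W.v) ^ 2 - W.u₂ ^ 2) * ((c 0 - c 2) * t) = 0 := by
    linear_combination (1 - W.v) * hA' - W.u₂ * hB'
  have hM2 : ((1 - W.v) ^ 2 - W.u₂ ^ 2) * (c 1 - c 3) = 0 := by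
    linear_combination (1 - W.v) * hB' - W.u₂ * hA'
  by_contra hq
  have hp : (1 + W.v) ^ 2 - W.u₂ ^ 2 ≠ 0 := by
    intro h0; apply hq; linear_combination ((1 - W.v - W.u₂) * (1 - W.v + W.u₂)) * h0
  have hm : (1 - W.v) ^ 2 - W.u₂ ^ 2 ≠ 0 := by
    intro h0; apply hq; linear_combination ((1 + W.v - W.u₂) * (1 + W.v + W.u₂)) * h0
  have e1 : c 0 + c 2 = 0 :=
    (mul_eq_zero.1 ((mul_eq_zero.1 hP).resolve_left hp)).resolve_right ht
  have e2 : c 1 + c 3 = 0 := (mul_eq_zero.1 hP2).resolve_left hp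
  have e3 : c 0 - c 2 = 0 :=
    (mul_eq_zero.1 ((mul_eq_zero.1 hM).resolve_left hm)).resolve_right ht
  have e4 : c 1 - c 3 = 0 := (mul_eq_zero.1 hM2).resolve_left hm
  apply hc
  funext i
  fin_cases i
  · show c 0 = 0
    linear_combination (e1 + e3) / 2
  · show c 1 = 0
    linear_combination (e2 + e4) / 2
  · show c 2 = 0
    linear_combination (e1 - e3) / 2
  · show c 3 = 0
    linear_combination (e2 - e4) / 2

end OnePlaquette


/-! ### Appended: the directed corner `u₁ = 0` — corner-free walks are monotone, sufficiency of the quartic -/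

section DirectedCorner

open ΩF

/-- The diagonal potential of a mid-edge: `2(k − j)` on `vert k j`, `2(k − j) + 1` on `slant k j`; on the
sides of a plaquette `(x, y)` it takes the values `W ↦ 2(x−y)`, `S ↦ 2(x−y)+1`, `E ↦ 2(x−y)+2`,
`N ↦ 2(x−y)−1`. [folklore] -/
def psi : MidEdge → ℤ
  | .vert k j => 2 * (k - j)
  | .slant k j => 2 * (k - j) + 1

/-- The offset of a side in the diagonal potential. [folklore] -/
def psiOff : Side → ℤ
  | .W => 0
  | .E => 2
  | .S => 1
  | .N => -1

/-- The potential of a side of a plaquette. [folklore] -/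
private theorem psi_side (f : Face) (s : Side) : psi (f.side s) = 2 * (f.1 - f.2) + psiOff s := by
  obtain ⟨x, y⟩ := f
  cases s <;> simp [psi, psiOff, Face.side] <;> ring

/-- `psiOff` is injective. [folklore] -/
private theorem psiOff_injective : Function.Injective psiOff := by
  intro s u h; revert h; cases s <;> cases u <;> decide

/-- For a NON-CORNER arc `s → u` of a plaquette the potential increases iff it starts on `W` or `N`,
iff it ends on `E` or `S`; and it never stays. [folklore] -/
private theorem psiOff_nonCorner {s u : Side} (hsu : s ≠ u) (hk : arcKind s u ≠ .corner) :
    psiOff u - psiOff s ≠ 0 ∧ (0 < psiOff u - psiOff s ↔ (s = .W ∨ s = .N)) ∧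
      (0 < psiOff u - psiOff s ↔ (u = .E ∨ u = .S)) := by
  revert hsu hk; cases s <;> cases u <;> simp [arcKind, psiOff]

/-- **Propagation across a crossed mid-edge**: if the mid-edge `m` is the side `s'` of `f` and the side
`s''` of a different plaquette `f'`, then `s' ∈ {E, S}` iff `s'' ∈ {W, N}` (the east side of a plaquette
is the west side of its eastern neighbour, etc.). [folklore] -/
private theorem exit_iff_entry {f f' : Face} {s' s'' : Side} (h : f.side s' = f'.side s'') (hne : f ≠ f') :
    (s' = .E ∨ s' = .S) ↔ (s'' = .W ∨ s'' = .N) := by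
  obtain ⟨x, y⟩ := f
  obtain ⟨x', y'⟩ := f'
  cases s' <;> cases s'' <;>
    simp only [Face.side, MidEdge.vert.injEq, MidEdge.slant.injEq, reduceCtorEq, ne_eq, Prod.mk.injEq,
      not_and, or_false, or_true, iff_true, iff_false, not_true_eq_false] at h hne ⊢ <;>
    omega

variable {Dl : List Face} {a : MidEdge} {f₀ : Face}

/-- A walk is corner-free: none of its arcs is a corner arc (Fig. 1's `u₁`/`w₁` configurations absent).
[cite: GlazmanManolescu2019, §1, Fig. 1 (the corner configurations u₁, w₁)] -/
def CornerFree {D : Set Face} {a z : MidEdge} (γ : YBWalk D a z) : Prop :=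
  ∀ i, i < γ.arcs.length → arcKindOf (γ.nth i, γ.nth (i + 1)) ≠ some .corner

/-- **A corner-free walk is monotone in the diagonal potential**: all its steps have the sign of the
first one. [folklore] -/
private theorem psi_step_sign {D : Set Face} {a z : MidEdge} (γ : YBWalk D a z) (hcf : CornerFree γ) :
    ∀ i, i < γ.arcs.length →
      (psi (γ.nth (i + 1)) - psi (γ.nth i) ≠ 0) ∧
        (0 < psi (γ.nth (i + 1)) - psi (γ.nth i) ↔ 0 < psi (γ.nth 1) - psi (γ.nth 0)) := by
  intro i
  induction i with
  | zero =>
    intro h0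
    obtain ⟨f, -, hf⟩ := γ.arc_nth h0
    obtain ⟨s, u, hsu, hs, hu, hk⟩ := exists_sides_of_arcFace hf
    simp only at hs hu
    have hk' : arcKind s u ≠ .corner := fun e => hcf 0 h0 (by rw [hk, e])
    rw [← hs, ← hu, psi_side, psi_side]
    refine ⟨by have := (psiOff_nonCorner hsu hk').1; intro h; apply this; linarith, Iff.rfl⟩
  | succ i ih =>
    intro hi
    obtain ⟨hne0, hiff⟩ := ih (by omega)
    -- arc i : sides (s, u) of f; arc i+1 : sides (s', u') of f'; u and s' name the same mid-edge
    obtain ⟨f, -, hf⟩ := γ.arc_nth (show i < γ.arcs.length by omega)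
    obtain ⟨f', -, hf'⟩ := γ.arc_nth hi
    obtain ⟨s, u, hsu, hs, hu, hk⟩ := exists_sides_of_arcFace hf
    obtain ⟨s', u', hsu', hs', hu', hk'⟩ := exists_sides_of_arcFace hf'
    simp only at hs hu hs' hu'
    have hkc : arcKind s u ≠ .corner := fun e => hcf i (by omega) (by rw [hk, e])
    have hkc' : arcKind s' u' ≠ .corner := fun e => hcf (i + 1) hi (by rw [hk', e])
    have hff' : f ≠ f' := by
      intro e; subst e
      have := γ.chain_nth (i := i) (by omega)
      rw [hf, show i + 1 + 1 = i + 2 from rfl] at this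
      exact this hf'.symm
    have hm : f.side u = f'.side s' := hu.trans hs'.symm
    obtain ⟨hne1, h1s, h1u⟩ := psiOff_nonCorner hsu hkc
    obtain ⟨hne2, h2s, h2u⟩ := psiOff_nonCorner hsu' hkc'
    have key := exit_iff_entry hm hff'
    rw [show i + 1 + 1 = i + 2 from rfl]
    rw [← hs', ← hu', psi_side, psi_side]
    rw [← hs, ← hu, psi_side, psi_side] at hne0 hiff
    refine ⟨by intro h; apply hne2; linarith, ?_⟩
    rw [← hiff]
    constructor
    · intro h; have := (h2s.1 (by linarith)); have := h1u.2 (key.2 this); linarith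
    · intro h; have := (h1u.1 (by linarith)); have := h2s.2 (key.1 this); linarith

/-- **Strict monotonicity**: along a corner-free walk the potential is strictly monotone, so it changes
by at least the number of steps. [folklore] -/
private theorem psi_mono {D : Set Face} {a z : MidEdge} (γ : YBWalk D a z) (hcf : CornerFree γ)
    {i j : ℕ} (hij : i ≤ j) (hj : j ≤ γ.arcs.length) :
    (0 < psi (γ.nth 1) - psi (γ.nth 0) → (j : ℤ) - i ≤ psi (γ.nth j) - psi (γ.nth i)) ∧
    (¬(0 < psi (γ.nth 1) - psi (γ.nth 0)) → (j : ℤ) - i ≤ psi (γ.nth i) - psi (γ.nth j)) := by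
  induction j with
  | zero =>
    have : i = 0 := by omega
    subst this; simp
  | succ j ih =>
    rcases Nat.lt_or_ge j i with h | h
    · have : i = j + 1 := by omega
      subst this; simp
    · obtain ⟨ih1, ih2⟩ := ih h (by omega)
      obtain ⟨hne, hiff⟩ := psi_step_sign γ hcf j (by omega)
      constructor
      · intro hpos
        have := ih1 hpos
        have := hiff.2 hpos
        push_cast
        linarith
      · intro hneg
        have := ih2 hneg
        have : ¬ 0 < psi (γ.nth (j + 1)) - psi (γ.nth j) := fun h' => hneg (hiff.1 h')
        push_cast
        omega

/-- **A corner-free arrival walk has not crossed `f₀` before**: if the last arc of a corner-free walk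
ending on a side of `f₀` is not drawn in `f₀`, then no arc of the walk is drawn in `f₀`.
[cite: GlazmanManolescu2019, §1 (walks cross each edge once; consecutive arcs in different rhombi)] -/
theorem ΩF.no_arc_of_cornerFree (ω : ΩF Dl a f₀) (h : ¬ω.IsExt) (hcf : CornerFree ω.2) :
    ∀ i, i < ω.2.arcs.length → arcFace (ω.2.nth i, ω.2.nth (i + 1)) ≠ some f₀ := by
  intro i hi hface
  -- the arc `i` joins the sides `s → u` of `f₀`; the end `nth n = f₀.side ω.1`
  obtain ⟨s, u, hsu, hs, hu, hk⟩ := exists_sides_of_arcFace hface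
  simp only at hs hu
  have hkc : arcKind s u ≠ .corner := fun e => hcf i hi (by rw [hk, e])
  obtain ⟨-, -, hu_iff⟩ := psiOff_nonCorner hsu hkc
  -- `i + 1 < n`: the arc `i` is not the last one (the last arc is not in `f₀`)
  have hi1 : i + 1 < ω.2.arcs.length := by
    by_contra hle
    have hi1' : i + 1 = ω.2.arcs.length := by omega
    have e1 : ω.2.nth (i + 1) = f₀.side ω.1 := by rw [hi1']; exact ω.2.nth_length
    rw [e1] at hface
    apply h
    refine ⟨by omega, ?_⟩
    rw [show ω.2.arcs.length - 1 = i by omega]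
    exact hface
  have hend : ω.2.nth ω.2.arcs.length = f₀.side ω.1 := ω.2.nth_length
  -- potentials of the three sides of `f₀` involved
  have eI : psi (ω.2.nth i) = 2 * (f₀.1 - f₀.2) + psiOff s := by rw [← hs, psi_side]
  have eI1 : psi (ω.2.nth (i + 1)) = 2 * (f₀.1 - f₀.2) + psiOff u := by rw [← hu, psi_side]
  have eN : psi (ω.2.nth ω.2.arcs.length) = 2 * (f₀.1 - f₀.2) + psiOff ω.1 := by rw [hend, psi_side]
  have hstep := psi_step_sign ω.2 hcf i hi
  obtain ⟨m1, m2⟩ := psi_mono ω.2 hcf (show i + 1 ≤ ω.2.arcs.length by omega) le_rfl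
  -- bounds on the offsets
  have bo : ∀ x : Side, -1 ≤ psiOff x ∧ psiOff x ≤ 2 := by intro x; cases x <;> simp [psiOff]
  -- the last arc `(nth (n-1), nth n)`: if `n = i + 2` it joins two sides of `f₀`, hence lies in `f₀`
  have hlast : ω.2.arcs.length = i + 2 → False := by
    intro hn2
    have hu1 : u ≠ ω.1 := by
      intro e
      have := ω.2.nth_inj (i := i + 1) (j := ω.2.arcs.length) (by omega) le_rfl (by rw [← hu, e, hend])
      omega
    apply h
    refine ⟨by omega, ?_⟩
    rw [show ω.2.arcs.length - 1 = i + 1 by omega, ← hu]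
    exact arcFace_side_side f₀ u ω.1 hu1
  have hb1 := (bo ω.1).1
  have hb2 := (bo ω.1).2
  by_cases hpos : 0 < psi (ω.2.nth 1) - psi (ω.2.nth 0)
  · -- increasing: the arc ends on `E` or `S`
    have hinc := m1 hpos
    have hstep' := hstep.2.2 hpos
    have hU : u = .E ∨ u = .S := hu_iff.1 (by rw [eI1, eI] at hstep'; linarith)
    push_cast at hinc
    rw [eN, eI1] at hinc
    rcases hU with rfl | rfl
    · -- ends on `E` (offset 2 = max): no room above
      rw [show psiOff Side.E = 2 from rfl] at hinc
      omega
    · -- ends on `S` (offset 1): the end must be `E` and `n = i + 2`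
      rw [show psiOff Side.S = 1 from rfl] at hinc
      exact hlast (by omega)
  · have hdec := m2 hpos
    have hstep' : ¬ 0 < psi (ω.2.nth (i + 1)) - psi (ω.2.nth i) := fun h' => hpos (hstep.2.1 h')
    have hU : ¬(u = .E ∨ u = .S) := fun h' => hstep' (by have := hu_iff.2 h'; rw [eI1, eI]; linarith)
    have hU' : u = .W ∨ u = .N := by revert hU hsu; cases u <;> simp
    push_cast at hdec
    rw [eN, eI1] at hdec
    rcases hU' with rfl | rfl
    · -- ends on `W` (offset 0): the end must be `N` and `n = i + 2`
      rw [show psiOff Side.W = 0 from rfl] at hdec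
      exact hlast (by omega)
    · rw [show psiOff Side.N = -1 from rfl] at hdec
      omega

variable {W : CWeights} {t : ℂ} {c : Fin 4 → ℂ}

/-- A corner arc of a walk makes its plaquette weigh `u₁` or `w₁`. [cite: GlazmanManolescu2019, §1, Fig. 1 (configurations u₁, w₁)] -/
private theorem locW_eq_zero_of_corner {D : Set Face} {a z : MidEdge} (γ : YBWalk D a z) (h1 : W.u₁ = 0)
    (hw1 : W.w₁ = 0) {j : ℕ} (hj : j < γ.arcs.length) {g : Face}
    (hg : arcFace (γ.nth j, γ.nth (j + 1)) = some g) (hk : arcKindOf (γ.nth j, γ.nth (j + 1)) = some .corner) :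
    locW W (γ.kindsIn g) = 0 := by
  have hmem : ArcKind.corner ∈ γ.kindsIn g := by
    rw [YBWalk.kindsIn_eq, List.mem_filterMap]
    exact ⟨_, γ.arc_nth_mem hj, by rw [kindF, if_pos hg, hk]⟩
  rw [show γ.kindsIn g = kindsL γ.mids g from rfl] at hmem ⊢
  rcases kindsL_shape γ g with h | h | h | h | h | h <;> rw [h] at hmem ⊢ <;> simp_all [arcW, pairW]

/-- ★ **Sufficiency on the directed corner `u₁ = w₁ = 0`**: if the weights give no weight to a single
corner arc nor to two corner arcs, every coefficient vector satisfying the four group-one rows is an exact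
vertex relation at EVERY face of EVERY finite face list for EVERY boundary root. Mechanism: a walk of
nonzero weight is corner-free, hence monotone in the diagonal potential (`ΩF.no_arc_of_cornerFree`): it
never returns to a plaquette, so every group at a plaquette is an arrival at a fresh plaquette together
with its one-arc continuations — the group-one row. [cite: Glazman2015WeightedSAW, Lemma 3.1 (proof: the one-visit group, eq. (3.11))] -/
theorem exactPlaquetteVertexRelation_of_u₁_w₁_eq_zero (ht : t ≠ 0) (h1 : W.u₁ = 0) (hw1 : W.w₁ = 0)
    (hrow : ∀ p : Side, ∑ x : Side, c (slotIdx x) * arcW W (arcKind p x) * t ^ qTurn p x = 0) :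
    ExactPlaquetteVertexRelation W t c := by
  intro Dl a f₀ hf ha
  rw [vertexFunctional_eq_sum_term, sum_eq_sum_bracket hf]
  refine Finset.sum_eq_zero fun ω hω => ?_
  have h : ¬ω.IsExt := by simpa [setArr] using hω
  -- generic expansion of the group of `ω` (as in `bracket_eq_zero`)
  set p := ω.1 with hp
  set E := extW W ω.2 f₀ with hE
  set T := t ^ quarterTurnsL ω.2.mids with hT
  have hself : term W t c ω = c (slotIdx p) * (E * locW W (ω.2.kindsIn f₀) * T) := by
    rw [term, weightL_eq_extW_mul]
  have hext : ∀ x ∈ ω.admSet, term W t c (ω.ext hf x) =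
      E * T * (c (slotIdx x) * locW W (ω.2.kindsIn f₀ ++ [arcKind p x]) * t ^ qTurn p x) := by
    intro x hx
    have hx' : ω.Adm x := mem_admSet.1 hx
    have harcs := ext_snd_arcs hf h hx'
    have hpx : p ≠ x := Ne.symm hx'.1
    have hfa : arcFace (f₀.side p, f₀.side x) = some f₀ := arcFace_side_side f₀ p x hpx
    rw [term, weightL_eq_extW_mul W _ f₀, extW_of_snoc W ω.2 _ f₀ harcs hfa,
      YBWalk.kindsIn_of_snoc ω.2 _ f₀ harcs hfa, arcKindOf_eq hfa rfl rfl,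
      quarterTurnsL_of_snoc ω.2 _ harcs, qTurnOf_side_side f₀ hpx, zpow_add₀ ht, ext_fst hf h hx']
    simp only [List.reduceOption_cons_of_some, List.reduceOption_nil]
    ring
  rw [hself, Finset.sum_congr rfl hext, ← Finset.mul_sum]
  have hfilt : ∀ {i : ℕ}, i < ω.2.arcs.length → arcFace (ω.2.nth i, ω.2.nth (i + 1)) = some f₀ →
      (ω.2.nth i, ω.2.nth (i + 1)) ∈ (arcsOf ω.2.mids).filter fun q => arcFace q = some f₀ :=
    fun hi e => List.mem_filter.2 ⟨ω.2.arc_nth_mem hi, by simpa using e⟩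
  rcases filter_face_cases ω.2 f₀ with h0 | ⟨q₁, hq1, hq₁⟩ | ⟨q₁, q₂, h2, hne, hq₁, hq₂, -⟩
  · -- fresh plaquette: the group-one row
    have hK : ω.2.kindsIn f₀ = [] := by rw [kindsIn_eq_filterMap_filter, h0]; rfl
    have hno : ∀ i < ω.2.arcs.length, arcFace (ω.2.nth i, ω.2.nth (i + 1)) ≠ some f₀ := by
      intro i hi e
      have := hfilt hi e
      rw [h0] at this
      simp at this
    have hadm : ω.admSet = Finset.univ.erase p := by
      ext x
      simp only [mem_admSet, Finset.mem_erase, Finset.mem_univ, and_true]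
      exact ⟨fun hx => hx.1, fun hx => adm_of_no_arc hf ha h hno hx⟩
    rw [hK, hadm]
    have key := hrow p
    rw [← Finset.add_sum_erase _ _ (Finset.mem_univ p), arcKind_self, qTurn_self] at key
    simp only [List.nil_append, locW_single, locW_nil, arcW, zpow_zero, mul_one] at key ⊢
    linear_combination E * T * key
  · -- one earlier arc `q₁` in `f₀`
    have hq₁m : q₁ ∈ ω.2.arcs := by
      have : q₁ ∈ (arcsOf ω.2.mids).filter fun q => arcFace q = some f₀ := by rw [hq1]; simp
      exact (List.mem_filter.1 this).1
    obtain ⟨s₁, s₂, h12, hs₁, hs₂, hk⟩ := exists_sides_of_arcFace hq₁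
    obtain ⟨i, hi, hqi⟩ := (ω.2.mem_arcs_iff_nth).1 hq₁m
    have hK : ω.2.kindsIn f₀ = [arcKind s₁ s₂] := by
      rw [kindsIn_eq_filterMap_filter, hq1, List.filterMap_cons, hk, List.filterMap_nil]
    rw [hK]
    by_cases hkc : arcKind s₁ s₂ = .corner
    · -- a corner arc in `f₀`: the walk and its completion weigh `u₁ = 0` resp. `w₁ = 0` there
      rw [hkc]
      simp only [locW_single, List.singleton_append, locW_pair, arcW, pairW, h1, hw1, mul_zero, zero_mul,
        Finset.sum_const_zero, add_zero]
    · -- otherwise the walk returned to `f₀`, so it is not corner-free: a corner arc elsewhere kills `E`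
      have hncf : ¬CornerFree ω.2 := fun hcf =>
        no_arc_of_cornerFree ω h hcf i hi (by rw [← hqi]; exact hq₁)
      simp only [CornerFree, not_forall, not_not, exists_prop] at hncf
      obtain ⟨j, hj, hkj⟩ := hncf
      obtain ⟨g, -, hg⟩ := ω.2.arc_nth hj
      have hgf : g ≠ f₀ := by
        rintro rfl
        have hmf := hfilt hj hg
        rw [hq1, List.mem_singleton] at hmf
        rw [hmf, hk] at hkj
        exact hkc (Option.some_injective _ hkj)
      have hgmem : g ∈ ω.2.facesVisited := (ω.2.mem_facesVisited_iff).2 ⟨_, ω.2.arc_nth_mem hj, hg⟩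
      have hE0 : E = 0 :=
        Finset.prod_eq_zero (Finset.mem_erase.2 ⟨hgf, hgmem⟩) (locW_eq_zero_of_corner ω.2 h1 hw1 hj hg hkj)
      rw [hE0]
      ring
  · -- two arcs in `f₀`: impossible for an arrival
    exfalso
    have hm : ∀ q, q ∈ [q₁, q₂] → q ∈ ω.2.arcs := by
      intro q hq
      have : q ∈ (arcsOf ω.2.mids).filter fun q => arcFace q = some f₀ := by rw [h2]; exact hq
      exact (List.mem_filter.1 this).1
    have hq₁m := hm q₁ (by simp)
    have hq₂m := hm q₂ (by simp)
    obtain ⟨e11, e12, e21, e22⟩ := arcs_ends_ne ω.2 hq₁m hq₂m hne hq₁ hq₂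
    obtain ⟨s₁, s₂, h12, hs₁, hs₂, -⟩ := exists_sides_of_arcFace hq₁
    obtain ⟨s₃, s₄, h34, hs₃, hs₄, -⟩ := exists_sides_of_arcFace hq₂
    obtain ⟨i, hi, hqi⟩ := (ω.2.mem_arcs_iff_nth).1 hq₁m
    obtain ⟨j, hj, hqj⟩ := (ω.2.mem_arcs_iff_nth).1 hq₂m
    obtain ⟨hne₁, hne₂⟩ := ends_ne_of_arc h hi (by rw [← hqi]; exact hq₁)
    obtain ⟨hne₃, hne₄⟩ := ends_ne_of_arc h hj (by rw [← hqj]; exact hq₂)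
    rw [hqi] at hs₁ hs₂
    rw [hqj] at hs₃ hs₄
    rw [hqi, hqj] at e11 e12 e21 e22
    simp only at hs₁ hs₂ hs₃ hs₄ e11 e12 e21 e22
    rw [← hs₁] at e11 e12 hne₁
    rw [← hs₂] at e21 e22 hne₂
    rw [← hs₃] at e11 e21 hne₃
    rw [← hs₄] at e12 e22 hne₄
    have n13 : s₁ ≠ s₃ := fun e => e11 (by rw [e])
    have n14 : s₁ ≠ s₄ := fun e => e12 (by rw [e])
    have n23 : s₂ ≠ s₃ := fun e => e21 (by rw [e])
    have n24 : s₂ ≠ s₄ := fun e => e22 (by rw [e])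
    have n1 : ω.1 ≠ s₁ := fun e => hne₁ (by rw [e])
    have n2 : ω.1 ≠ s₂ := fun e => hne₂ (by rw [e])
    have n3 : ω.1 ≠ s₃ := fun e => hne₃ (by rw [e])
    have n4 : ω.1 ≠ s₄ := fun e => hne₄ (by rw [e])
    exact side_five h12 n13 n14 n23 n24 h34 n1 n2 n3 n4

/-- The four group-one rows with `u₁ = 0` for the symmetric coefficient vector `(α, β, α, β)`,
on the component `(1 + v)² = u₂²`. [folklore] -/
private theorem rows_sym (ht : t ≠ 0) (h1 : W.u₁ = 0) (hq : (1 + W.v) ^ 2 = W.u₂ ^ 2) :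
    ∀ p : Side, ∑ x : Side, (![W.u₂, -(1 + W.v) * t, W.u₂, -(1 + W.v) * t] : Fin 4 → ℂ) (slotIdx x) *
      arcW W (arcKind p x) * t ^ qTurn p x = 0 := by
  have hti : t * t⁻¹ = 1 := mul_inv_cancel₀ ht
  intro p
  rw [sum_side]
  cases p <;>
    simp only [slotIdx, arcKind, arcW, qTurn, h1, Matrix.cons_val_zero, Matrix.cons_val_one, Matrix.head_cons,
      Matrix.cons_val_two, Matrix.tail_cons, Matrix.cons_val_three, zpow_zero, zpow_one, zpow_neg, mul_one,
      mul_zero, zero_mul, add_zero, zero_add, Int.reduceNeg] <;>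
    first
    | linear_combination -(W.u₂ * (1 + W.v)) * hti
    | linear_combination -t * hq

/-- The rows for the antisymmetric vector `(α, β, −α, −β)` on the component `(1 − v)² = u₂²`. [folklore] -/
private theorem rows_antisym (ht : t ≠ 0) (h1 : W.u₁ = 0) (hq : (1 - W.v) ^ 2 = W.u₂ ^ 2) :
    ∀ p : Side, ∑ x : Side, (![W.u₂, -(1 - W.v) * t, -W.u₂, (1 - W.v) * t] : Fin 4 → ℂ) (slotIdx x) *
      arcW W (arcKind p x) * t ^ qTurn p x = 0 := by
  have hti : t * t⁻¹ = 1 := mul_inv_cancel₀ ht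
  intro p
  rw [sum_side]
  cases p <;>
    simp only [slotIdx, arcKind, arcW, qTurn, h1, Matrix.cons_val_zero, Matrix.cons_val_one, Matrix.head_cons,
      Matrix.cons_val_two, Matrix.tail_cons, Matrix.cons_val_three, zpow_zero, zpow_one, zpow_neg, mul_one,
      mul_zero, zero_mul, add_zero, zero_add, Int.reduceNeg] <;>
    first
    | linear_combination (W.u₂ * (1 - W.v)) * hti
    | linear_combination -(W.u₂ * (1 - W.v)) * hti
    | linear_combination t * hq
    | linear_combination -t * hq

/-- The rows at the double point `u₂ = 0`, `v = −1` for `(1, 0, 1, 0)`. [folklore] -/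
private theorem rows_sym0 (h1 : W.u₁ = 0) (hu : W.u₂ = 0) (hv : 1 + W.v = 0) :
    ∀ p : Side, ∑ x : Side, (![1, 0, 1, 0] : Fin 4 → ℂ) (slotIdx x) * arcW W (arcKind p x) * t ^ qTurn p x = 0 := by
  intro p
  rw [sum_side]
  cases p <;>
    simp only [slotIdx, arcKind, arcW, qTurn, h1, hu, Matrix.cons_val_zero, Matrix.cons_val_one, Matrix.head_cons,
      Matrix.cons_val_two, Matrix.tail_cons, Matrix.cons_val_three, zpow_zero, mul_one,
      mul_zero, zero_mul, add_zero] <;>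
    linear_combination hv

/-- The rows at the double point `u₂ = 0`, `v = 1` for `(1, 0, −1, 0)`. [folklore] -/
private theorem rows_antisym0 (h1 : W.u₁ = 0) (hu : W.u₂ = 0) (hv : 1 - W.v = 0) :
    ∀ p : Side, ∑ x : Side, (![1, 0, -1, 0] : Fin 4 → ℂ) (slotIdx x) * arcW W (arcKind p x) * t ^ qTurn p x = 0 := by
  intro p
  rw [sum_side]
  cases p <;>
    simp only [slotIdx, arcKind, arcW, qTurn, h1, hu, Matrix.cons_val_zero, Matrix.cons_val_one, Matrix.head_cons,
      Matrix.cons_val_two, Matrix.tail_cons, Matrix.cons_val_three, zpow_zero, mul_one,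
      mul_zero, zero_mul, add_zero] <;>
    first
    | linear_combination hv
    | linear_combination -hv

/-- ★ **Two-sided classification of the directed corner `u₁ = w₁ = 0`** (any `u₂, v, w₂ ∈ ℂ`, any phase
`t ≠ 0`): a nonzero exact vertex relation on every finite face list for every boundary root exists iff
`(1+v−u₂)(1+v+u₂)(1−v−u₂)(1−v+u₂) = 0`; the relation is then `(u₂, −(1+v)t, u₂, −(1+v)t)` resp.
`(u₂, −(1−v)t, −u₂, (1−v)t)` (or `(1,0,±1,0)` at the double points). The spin is UNCONSTRAINED here.
[cite: Glazman2015WeightedSAW, Lemma 3.1 (proof: "solving this linear system")] -/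
theorem exactPlaquetteVertexRelation_iff_quartic (W : CWeights) {t : ℂ} (ht : t ≠ 0) (h1 : W.u₁ = 0)
    (hw1 : W.w₁ = 0) :
    (∃ c : Fin 4 → ℂ, c ≠ 0 ∧ ExactPlaquetteVertexRelation W t c) ↔
      (1 + W.v - W.u₂) * (1 + W.v + W.u₂) * (1 - W.v - W.u₂) * (1 - W.v + W.u₂) = 0 := by
  constructor
  · rintro ⟨c, hc, hrel⟩
    exact quartic_eq_zero_of_exactPlaquetteVertexRelation_of_u₁_eq_zero hrel ht h1 hc
  · intro hq
    have hq' : (1 + W.v) ^ 2 - W.u₂ ^ 2 = 0 ∨ (1 - W.v) ^ 2 - W.u₂ ^ 2 = 0 := by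
      have : ((1 + W.v) ^ 2 - W.u₂ ^ 2) * ((1 - W.v) ^ 2 - W.u₂ ^ 2) = 0 := by linear_combination hq
      exact mul_eq_zero.1 this
    rcases hq' with hA | hB
    · by_cases hz : W.u₂ = 0 ∧ 1 + W.v = 0
      · refine ⟨![1, 0, 1, 0], fun h0 => ?_,
          exactPlaquetteVertexRelation_of_u₁_w₁_eq_zero ht h1 hw1 (rows_sym0 h1 hz.1 hz.2)⟩
        have := congrFun h0 0
        simp at this
      · refine ⟨![W.u₂, -(1 + W.v) * t, W.u₂, -(1 + W.v) * t], fun h0 => hz ?_,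
          exactPlaquetteVertexRelation_of_u₁_w₁_eq_zero ht h1 hw1
            (rows_sym ht h1 (by linear_combination hA))⟩
        have e0 := congrFun h0 0
        have e1 := congrFun h0 1
        simp only [Matrix.cons_val_zero, Matrix.cons_val_one, Pi.zero_apply, neg_mul,
          neg_eq_zero, mul_eq_zero] at e0 e1
        exact ⟨e0, e1.resolve_right ht⟩
    · by_cases hz : W.u₂ = 0 ∧ 1 - W.v = 0
      · refine ⟨![1, 0, -1, 0], fun h0 => ?_,
          exactPlaquetteVertexRelation_of_u₁_w₁_eq_zero ht h1 hw1 (rows_antisym0 h1 hz.1 hz.2)⟩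
        have := congrFun h0 0
        simp at this
      · refine ⟨![W.u₂, -(1 - W.v) * t, -W.u₂, (1 - W.v) * t], fun h0 => hz ?_,
          exactPlaquetteVertexRelation_of_u₁_w₁_eq_zero ht h1 hw1
            (rows_antisym ht h1 (by linear_combination hB))⟩
        have e0 := congrFun h0 0
        have e1 := congrFun h0 1
        simp only [Matrix.cons_val_zero, Matrix.cons_val_one, Pi.zero_apply, neg_mul,
          neg_eq_zero, mul_eq_zero] at e0 e1
        exact ⟨e0, e1.resolve_right ht⟩

/-- **Barrier `PlaquetteWalkDirectedCornerClassification`** (named statement): on the directed corner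
`u₁ = w₁ = 0` of the five-weight plaquette walk on `ℤ²` (no weight for one or two corner arcs; `u₂, v, w₂`
arbitrary complex, any phase `t ≠ 0`) the all-boundary-roots technique class is classified two-sidedly:
a nonzero exact constant-coefficient vertex relation exists iff `(1+v−u₂)(1+v+u₂)(1−v−u₂)(1−v+u₂) = 0`.
A THEOREM of this file (`PlaquetteWalkDirectedCornerClassification_holds`).

BARRIER (structured block, D-0021):
- technique_class: plaquette-local linear vertex relations `Σ_{s ∈ (E,N,W,S)} c_s F(z_s) = 0`, constant `c ∈ ℂ⁴ ∖ {0}`, for the Glazman–Manolescu plaquette walk on `ℤ²` with complex weights `(0, u₂, v, 0, w₂)` and phase `t ≠ 0` per left quarter turn, at every face of every finite face list for every boundary root — `ExactPlaquetteVertexRelation W t c`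
- blocks: any such identity off the quartic `(1 ± v)² = u₂²`; conversely it PROVIDES the identity on the quartic at EVERY phase (no spin condition: the walks of nonzero weight are directed, corner-free paths, which never wind)
- because: necessity = the four one-plaquette (group-one) rows, a block matrix `[[P, vI],[vI, P]]` with `det = ((1+v)² − u₂²)((1−v)² − u₂²)` (`quartic_eq_zero_of_exactPlaquetteVertexRelation_of_u₁_eq_zero`, valid for any `w₁`); sufficiency = corner-free walks are strictly monotone in the diagonal potential `2(k − j)` (`ΩF.no_arc_of_cornerFree`), so every group at a plaquette is a fresh arrival plus its continuations, i.e. the group-one row (`exactPlaquetteVertexRelation_of_u₁_w₁_eq_zero`)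
- evasions_known: `w₁ ≠ 0` with `u₁ = 0` (necessity still holds; sufficiency would need that no Yang–Baxter walk has all its corner plaquettes doubled — believed, not typed; on boxes ≤ 5 × 4 there is none); the mirror corner `u₂ = w₂ = 0` is the companion statement `PlaquetteWalkMirrorCornerClassification` below (anti-diagonal potential `2(k + j)`); `u₁u₂ ≠ 0` (then `PlaquetteWalkDegenerateClassification` / `PlaquetteWalkYBClassificationAllSpins`)
- scope_caveats: statistical-mechanically trivial corner (directed paths with turn weight `u₂` and straight weight `v`); EXACT constant-coefficient identities only
- status: established — `PlaquetteWalkDirectedCornerClassification_holds` (this file); not located in print (Glazman's and Nienhuis' families have `u₁u₂ ≠ 0`; the venture lane's P-T protocol lists `u = 0` as a trivial locus) [cite: Glazman2015WeightedSAW, Lemma 3.1]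
[cite: Glazman2015WeightedSAW, Lemma 3.1] -/
def _root_.Literature.Barriers.CriticalPhenomena.PlaquetteWalkDirectedCornerClassification : Prop :=
  ∀ (W : CWeights) (t : ℂ), t ≠ 0 → W.u₁ = 0 → W.w₁ = 0 →
    ((∃ c : Fin 4 → ℂ, c ≠ 0 ∧ ExactPlaquetteVertexRelation W t c) ↔
      (1 + W.v - W.u₂) * (1 + W.v + W.u₂) * (1 - W.v - W.u₂) * (1 - W.v + W.u₂) = 0)

/-- **`PlaquetteWalkDirectedCornerClassification` holds.** [cite: Glazman2015WeightedSAW, Lemma 3.1] -/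
theorem _root_.Literature.Barriers.CriticalPhenomena.PlaquetteWalkDirectedCornerClassification_holds :
    PlaquetteWalkDirectedCornerClassification :=
  fun W _ ht h1 hw1 => exactPlaquetteVertexRelation_iff_quartic W ht h1 hw1

end DirectedCorner


/-! ### Appended: the mirror corner `u₂ = w₂ = 0` — co-corner-free walks and the anti-diagonal potential -/

section MirrorCorner

open ΩF

/-- The anti-diagonal potential of a mid-edge: `2(k + j)` on `vert k j`, `2(k + j) + 1` on `slant k j`;
on the sides of a plaquette `(x, y)`: `W ↦ 2(x+y)`, `S ↦ 2(x+y)+1`, `E ↦ 2(x+y)+2`, `N ↦ 2(x+y)+3`.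
[folklore] -/
def psi' : MidEdge → ℤ
  | .vert k j => 2 * (k + j)
  | .slant k j => 2 * (k + j) + 1

/-- The offset of a side in the anti-diagonal potential. [folklore] -/
def psiOff' : Side → ℤ
  | .W => 0
  | .E => 2
  | .S => 1
  | .N => 3

/-- The anti-diagonal potential of a side of a plaquette. [folklore] -/
private theorem psi'_side (f : Face) (s : Side) : psi' (f.side s) = 2 * (f.1 + f.2) + psiOff' s := by
  obtain ⟨x, y⟩ := f
  cases s <;> simp [psi', psiOff', Face.side] <;> ring

/-- For a NON-CO-CORNER arc `s → u` the anti-diagonal potential increases iff it starts on `W` or `S`,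
iff it ends on `N` or `E`; and it never stays. [folklore] -/
private theorem psiOff'_nonCoCorner {s u : Side} (hsu : s ≠ u) (hk : arcKind s u ≠ .coCorner) :
    psiOff' u - psiOff' s ≠ 0 ∧ (0 < psiOff' u - psiOff' s ↔ (s = .W ∨ s = .S)) ∧
      (0 < psiOff' u - psiOff' s ↔ (u = .N ∨ u = .E)) := by
  revert hsu hk; cases s <;> cases u <;> simp [arcKind, psiOff']

/-- Propagation across a crossed mid-edge, anti-diagonal form: the `N`/`E` side of a plaquette is the
`S`/`W` side of the next one. [folklore] -/
private theorem exit_iff_entry' {f f' : Face} {s' s'' : Side} (h : f.side s' = f'.side s'') (hne : f ≠ f') :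
    (s' = .N ∨ s' = .E) ↔ (s'' = .W ∨ s'' = .S) := by
  obtain ⟨x, y⟩ := f
  obtain ⟨x', y'⟩ := f'
  cases s' <;> cases s'' <;>
    simp only [Face.side, MidEdge.vert.injEq, MidEdge.slant.injEq, reduceCtorEq, ne_eq, Prod.mk.injEq,
      not_and, or_false, or_true, iff_true, iff_false, not_true_eq_false] at h hne ⊢ <;>
    omega

variable {Dl : List Face} {a : MidEdge} {f₀ : Face}

/-- A walk is co-corner-free: none of its arcs is a co-corner arc (Fig. 1's `u₂`/`w₂` configurations absent).
[cite: GlazmanManolescu2019, §1, Fig. 1 (the co-corner configurations u₂, w₂)] -/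
def CoCornerFree {D : Set Face} {a z : MidEdge} (γ : YBWalk D a z) : Prop :=
  ∀ i, i < γ.arcs.length → arcKindOf (γ.nth i, γ.nth (i + 1)) ≠ some .coCorner

/-- A co-corner-free walk is monotone in the anti-diagonal potential. [folklore] -/
private theorem psi'_step_sign {D : Set Face} {a z : MidEdge} (γ : YBWalk D a z) (hcf : CoCornerFree γ) :
    ∀ i, i < γ.arcs.length →
      (psi' (γ.nth (i + 1)) - psi' (γ.nth i) ≠ 0) ∧
        (0 < psi' (γ.nth (i + 1)) - psi' (γ.nth i) ↔ 0 < psi' (γ.nth 1) - psi' (γ.nth 0)) := by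
  intro i
  induction i with
  | zero =>
    intro h0
    obtain ⟨f, -, hf⟩ := γ.arc_nth h0
    obtain ⟨s, u, hsu, hs, hu, hk⟩ := exists_sides_of_arcFace hf
    simp only at hs hu
    have hk' : arcKind s u ≠ .coCorner := fun e => hcf 0 h0 (by rw [hk, e])
    rw [← hs, ← hu, psi'_side, psi'_side]
    refine ⟨by have := (psiOff'_nonCoCorner hsu hk').1; intro h; apply this; linarith, Iff.rfl⟩
  | succ i ih =>
    intro hi
    obtain ⟨hne0, hiff⟩ := ih (by omega)
    obtain ⟨f, -, hf⟩ := γ.arc_nth (show i < γ.arcs.length by omega)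
    obtain ⟨f', -, hf'⟩ := γ.arc_nth hi
    obtain ⟨s, u, hsu, hs, hu, hk⟩ := exists_sides_of_arcFace hf
    obtain ⟨s', u', hsu', hs', hu', hk'⟩ := exists_sides_of_arcFace hf'
    simp only at hs hu hs' hu'
    have hkc : arcKind s u ≠ .coCorner := fun e => hcf i (by omega) (by rw [hk, e])
    have hkc' : arcKind s' u' ≠ .coCorner := fun e => hcf (i + 1) hi (by rw [hk', e])
    have hff' : f ≠ f' := by
      intro e; subst e
      have := γ.chain_nth (i := i) (by omega)
      rw [hf, show i + 1 + 1 = i + 2 from rfl] at this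
      exact this hf'.symm
    have hm : f.side u = f'.side s' := hu.trans hs'.symm
    obtain ⟨hne1, h1s, h1u⟩ := psiOff'_nonCoCorner hsu hkc
    obtain ⟨hne2, h2s, h2u⟩ := psiOff'_nonCoCorner hsu' hkc'
    have key := exit_iff_entry' hm hff'
    rw [show i + 1 + 1 = i + 2 from rfl]
    rw [← hs', ← hu', psi'_side, psi'_side]
    rw [← hs, ← hu, psi'_side, psi'_side] at hne0 hiff
    refine ⟨by intro h; apply hne2; linarith, ?_⟩
    rw [← hiff]
    constructor
    · intro h; have := (h2s.1 (by linarith)); have := h1u.2 (key.2 this); linarith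
    · intro h; have := (h1u.1 (by linarith)); have := h2s.2 (key.1 this); linarith

/-- Strict monotonicity in the anti-diagonal potential. [folklore] -/
private theorem psi'_mono {D : Set Face} {a z : MidEdge} (γ : YBWalk D a z) (hcf : CoCornerFree γ)
    {i j : ℕ} (hij : i ≤ j) (hj : j ≤ γ.arcs.length) :
    (0 < psi' (γ.nth 1) - psi' (γ.nth 0) → (j : ℤ) - i ≤ psi' (γ.nth j) - psi' (γ.nth i)) ∧
    (¬(0 < psi' (γ.nth 1) - psi' (γ.nth 0)) → (j : ℤ) - i ≤ psi' (γ.nth i) - psi' (γ.nth j)) := by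
  induction j with
  | zero =>
    have : i = 0 := by omega
    subst this; simp
  | succ j ih =>
    rcases Nat.lt_or_ge j i with h | h
    · have : i = j + 1 := by omega
      subst this; simp
    · obtain ⟨ih1, ih2⟩ := ih h (by omega)
      obtain ⟨hne, hiff⟩ := psi'_step_sign γ hcf j (by omega)
      constructor
      · intro hpos
        have := ih1 hpos
        have := hiff.2 hpos
        push_cast
        linarith
      · intro hneg
        have := ih2 hneg
        have : ¬ 0 < psi' (γ.nth (j + 1)) - psi' (γ.nth j) := fun h' => hneg (hiff.1 h')
        push_cast
        omega

/-- **A co-corner-free arrival walk has not crossed `f₀` before.** [cite: GlazmanManolescu2019, §1 (walks cross each edge once; consecutive arcs in different rhombi)] -/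
theorem ΩF.no_arc_of_coCornerFree (ω : ΩF Dl a f₀) (h : ¬ω.IsExt) (hcf : CoCornerFree ω.2) :
    ∀ i, i < ω.2.arcs.length → arcFace (ω.2.nth i, ω.2.nth (i + 1)) ≠ some f₀ := by
  intro i hi hface
  obtain ⟨s, u, hsu, hs, hu, hk⟩ := exists_sides_of_arcFace hface
  simp only at hs hu
  have hkc : arcKind s u ≠ .coCorner := fun e => hcf i hi (by rw [hk, e])
  obtain ⟨-, -, hu_iff⟩ := psiOff'_nonCoCorner hsu hkc
  have hi1 : i + 1 < ω.2.arcs.length := by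
    by_contra hle
    have hi1' : i + 1 = ω.2.arcs.length := by omega
    have e1 : ω.2.nth (i + 1) = f₀.side ω.1 := by rw [hi1']; exact ω.2.nth_length
    rw [e1] at hface
    apply h
    refine ⟨by omega, ?_⟩
    rw [show ω.2.arcs.length - 1 = i by omega]
    exact hface
  have hend : ω.2.nth ω.2.arcs.length = f₀.side ω.1 := ω.2.nth_length
  have eI : psi' (ω.2.nth i) = 2 * (f₀.1 + f₀.2) + psiOff' s := by rw [← hs, psi'_side]
  have eI1 : psi' (ω.2.nth (i + 1)) = 2 * (f₀.1 + f₀.2) + psiOff' u := by rw [← hu, psi'_side]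
  have eN : psi' (ω.2.nth ω.2.arcs.length) = 2 * (f₀.1 + f₀.2) + psiOff' ω.1 := by rw [hend, psi'_side]
  have hstep := psi'_step_sign ω.2 hcf i hi
  obtain ⟨m1, m2⟩ := psi'_mono ω.2 hcf (show i + 1 ≤ ω.2.arcs.length by omega) le_rfl
  have bo : ∀ x : Side, 0 ≤ psiOff' x ∧ psiOff' x ≤ 3 := by intro x; cases x <;> simp [psiOff']
  have hlast : ω.2.arcs.length = i + 2 → False := by
    intro hn2
    have hu1 : u ≠ ω.1 := by
      intro e
      have := ω.2.nth_inj (i := i + 1) (j := ω.2.arcs.length) (by omega) le_rfl (by rw [← hu, e, hend])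
      omega
    apply h
    refine ⟨by omega, ?_⟩
    rw [show ω.2.arcs.length - 1 = i + 1 by omega, ← hu]
    exact arcFace_side_side f₀ u ω.1 hu1
  have hb1 := (bo ω.1).1
  have hb2 := (bo ω.1).2
  by_cases hpos : 0 < psi' (ω.2.nth 1) - psi' (ω.2.nth 0)
  · have hinc := m1 hpos
    have hstep' := hstep.2.2 hpos
    have hU : u = .N ∨ u = .E := hu_iff.1 (by rw [eI1, eI] at hstep'; linarith)
    push_cast at hinc
    rw [eN, eI1] at hinc
    rcases hU with rfl | rfl
    · rw [show psiOff' Side.N = 3 from rfl] at hinc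
      omega
    · rw [show psiOff' Side.E = 2 from rfl] at hinc
      exact hlast (by omega)
  · have hdec := m2 hpos
    have hstep' : ¬ 0 < psi' (ω.2.nth (i + 1)) - psi' (ω.2.nth i) := fun h' => hpos (hstep.2.1 h')
    have hU : ¬(u = .N ∨ u = .E) := fun h' => hstep' (by have := hu_iff.2 h'; rw [eI1, eI]; linarith)
    have hU' : u = .W ∨ u = .S := by revert hU hsu; cases u <;> simp
    push_cast at hdec
    rw [eN, eI1] at hdec
    rcases hU' with rfl | rfl
    · rw [show psiOff' Side.W = 0 from rfl] at hdec
      omega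
    · rw [show psiOff' Side.S = 1 from rfl] at hdec
      exact hlast (by omega)

variable {W : CWeights} {t : ℂ} {c : Fin 4 → ℂ}

/-- A co-corner arc of a walk makes its plaquette weigh `u₂` or `w₂`. [cite: GlazmanManolescu2019, §1, Fig. 1 (configurations u₂, w₂)] -/
private theorem locW_eq_zero_of_coCorner {D : Set Face} {a z : MidEdge} (γ : YBWalk D a z) (h2 : W.u₂ = 0)
    (hw2 : W.w₂ = 0) {j : ℕ} (hj : j < γ.arcs.length) {g : Face}
    (hg : arcFace (γ.nth j, γ.nth (j + 1)) = some g) (hk : arcKindOf (γ.nth j, γ.nth (j + 1)) = some .coCorner) :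
    locW W (γ.kindsIn g) = 0 := by
  have hmem : ArcKind.coCorner ∈ γ.kindsIn g := by
    rw [YBWalk.kindsIn_eq, List.mem_filterMap]
    exact ⟨_, γ.arc_nth_mem hj, by rw [kindF, if_pos hg, hk]⟩
  rw [show γ.kindsIn g = kindsL γ.mids g from rfl] at hmem ⊢
  rcases kindsL_shape γ g with h | h | h | h | h | h <;> rw [h] at hmem ⊢ <;> simp_all [arcW, pairW]

/-- ★ **Sufficiency on the mirror corner `u₂ = w₂ = 0`**: every solution of the four group-one rows is an
exact vertex relation at every face of every finite face list for every boundary root (walks of nonzero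
weight are co-corner-free, hence monotone in the anti-diagonal potential).
[cite: Glazman2015WeightedSAW, Lemma 3.1 (proof: the one-visit group, eq. (3.11))] -/
theorem exactPlaquetteVertexRelation_of_u₂_w₂_eq_zero (ht : t ≠ 0) (h2 : W.u₂ = 0) (hw2 : W.w₂ = 0)
    (hrow : ∀ p : Side, ∑ x : Side, c (slotIdx x) * arcW W (arcKind p x) * t ^ qTurn p x = 0) :
    ExactPlaquetteVertexRelation W t c := by
  intro Dl a f₀ hf ha
  rw [vertexFunctional_eq_sum_term, sum_eq_sum_bracket hf]
  refine Finset.sum_eq_zero fun ω hω => ?_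
  have h : ¬ω.IsExt := by simpa [setArr] using hω
  set p := ω.1 with hp
  set E := extW W ω.2 f₀ with hE
  set T := t ^ quarterTurnsL ω.2.mids with hT
  have hself : term W t c ω = c (slotIdx p) * (E * locW W (ω.2.kindsIn f₀) * T) := by
    rw [term, weightL_eq_extW_mul]
  have hext : ∀ x ∈ ω.admSet, term W t c (ω.ext hf x) =
      E * T * (c (slotIdx x) * locW W (ω.2.kindsIn f₀ ++ [arcKind p x]) * t ^ qTurn p x) := by
    intro x hx
    have hx' : ω.Adm x := mem_admSet.1 hx
    have harcs := ext_snd_arcs hf h hx'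
    have hpx : p ≠ x := Ne.symm hx'.1
    have hfa : arcFace (f₀.side p, f₀.side x) = some f₀ := arcFace_side_side f₀ p x hpx
    rw [term, weightL_eq_extW_mul W _ f₀, extW_of_snoc W ω.2 _ f₀ harcs hfa,
      YBWalk.kindsIn_of_snoc ω.2 _ f₀ harcs hfa, arcKindOf_eq hfa rfl rfl,
      quarterTurnsL_of_snoc ω.2 _ harcs, qTurnOf_side_side f₀ hpx, zpow_add₀ ht, ext_fst hf h hx']
    simp only [List.reduceOption_cons_of_some, List.reduceOption_nil]
    ring
  rw [hself, Finset.sum_congr rfl hext, ← Finset.mul_sum]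
  have hfilt : ∀ {i : ℕ}, i < ω.2.arcs.length → arcFace (ω.2.nth i, ω.2.nth (i + 1)) = some f₀ →
      (ω.2.nth i, ω.2.nth (i + 1)) ∈ (arcsOf ω.2.mids).filter fun q => arcFace q = some f₀ :=
    fun hi e => List.mem_filter.2 ⟨ω.2.arc_nth_mem hi, by simpa using e⟩
  rcases filter_face_cases ω.2 f₀ with h0 | ⟨q₁, hq1, hq₁⟩ | ⟨q₁, q₂, hq2, hne, hq₁, hq₂, -⟩
  · have hK : ω.2.kindsIn f₀ = [] := by rw [kindsIn_eq_filterMap_filter, h0]; rfl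
    have hno : ∀ i < ω.2.arcs.length, arcFace (ω.2.nth i, ω.2.nth (i + 1)) ≠ some f₀ := by
      intro i hi e
      have := hfilt hi e
      rw [h0] at this
      simp at this
    have hadm : ω.admSet = Finset.univ.erase p := by
      ext x
      simp only [mem_admSet, Finset.mem_erase, Finset.mem_univ, and_true]
      exact ⟨fun hx => hx.1, fun hx => adm_of_no_arc hf ha h hno hx⟩
    rw [hK, hadm]
    have key := hrow p
    rw [← Finset.add_sum_erase _ _ (Finset.mem_univ p), arcKind_self, qTurn_self] at key
    simp only [List.nil_append, locW_single, locW_nil, arcW, zpow_zero, mul_one] at key ⊢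
    linear_combination E * T * key
  · have hq₁m : q₁ ∈ ω.2.arcs := by
      have : q₁ ∈ (arcsOf ω.2.mids).filter fun q => arcFace q = some f₀ := by rw [hq1]; simp
      exact (List.mem_filter.1 this).1
    obtain ⟨s₁, s₂, h12, hs₁, hs₂, hk⟩ := exists_sides_of_arcFace hq₁
    obtain ⟨i, hi, hqi⟩ := (ω.2.mem_arcs_iff_nth).1 hq₁m
    have hK : ω.2.kindsIn f₀ = [arcKind s₁ s₂] := by
      rw [kindsIn_eq_filterMap_filter, hq1, List.filterMap_cons, hk, List.filterMap_nil]
    rw [hK]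
    by_cases hkc : arcKind s₁ s₂ = .coCorner
    · rw [hkc]
      simp only [locW_single, List.singleton_append, locW_pair, arcW, pairW, h2, hw2, mul_zero, zero_mul,
        Finset.sum_const_zero, add_zero]
    · have hncf : ¬CoCornerFree ω.2 := fun hcf =>
        no_arc_of_coCornerFree ω h hcf i hi (by rw [← hqi]; exact hq₁)
      simp only [CoCornerFree, not_forall, not_not, exists_prop] at hncf
      obtain ⟨j, hj, hkj⟩ := hncf
      obtain ⟨g, -, hg⟩ := ω.2.arc_nth hj
      have hgf : g ≠ f₀ := by
        rintro rfl
        have hmf := hfilt hj hg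
        rw [hq1, List.mem_singleton] at hmf
        rw [hmf, hk] at hkj
        exact hkc (Option.some_injective _ hkj)
      have hgmem : g ∈ ω.2.facesVisited := (ω.2.mem_facesVisited_iff).2 ⟨_, ω.2.arc_nth_mem hj, hg⟩
      have hE0 : E = 0 :=
        Finset.prod_eq_zero (Finset.mem_erase.2 ⟨hgf, hgmem⟩) (locW_eq_zero_of_coCorner ω.2 h2 hw2 hj hg hkj)
      rw [hE0]
      ring
  · exfalso
    have hm : ∀ q, q ∈ [q₁, q₂] → q ∈ ω.2.arcs := by
      intro q hq
      have : q ∈ (arcsOf ω.2.mids).filter fun q => arcFace q = some f₀ := by rw [hq2]; exact hq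
      exact (List.mem_filter.1 this).1
    have hq₁m := hm q₁ (by simp)
    have hq₂m := hm q₂ (by simp)
    obtain ⟨e11, e12, e21, e22⟩ := arcs_ends_ne ω.2 hq₁m hq₂m hne hq₁ hq₂
    obtain ⟨s₁, s₂, h12, hs₁, hs₂, -⟩ := exists_sides_of_arcFace hq₁
    obtain ⟨s₃, s₄, h34, hs₃, hs₄, -⟩ := exists_sides_of_arcFace hq₂
    obtain ⟨i, hi, hqi⟩ := (ω.2.mem_arcs_iff_nth).1 hq₁m
    obtain ⟨j, hj, hqj⟩ := (ω.2.mem_arcs_iff_nth).1 hq₂m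
    obtain ⟨hne₁, hne₂⟩ := ends_ne_of_arc h hi (by rw [← hqi]; exact hq₁)
    obtain ⟨hne₃, hne₄⟩ := ends_ne_of_arc h hj (by rw [← hqj]; exact hq₂)
    rw [hqi] at hs₁ hs₂
    rw [hqj] at hs₃ hs₄
    rw [hqi, hqj] at e11 e12 e21 e22
    simp only at hs₁ hs₂ hs₃ hs₄ e11 e12 e21 e22
    rw [← hs₁] at e11 e12 hne₁
    rw [← hs₂] at e21 e22 hne₂
    rw [← hs₃] at e11 e21 hne₃
    rw [← hs₄] at e12 e22 hne₄
    have n13 : s₁ ≠ s₃ := fun e => e11 (by rw [e])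
    have n14 : s₁ ≠ s₄ := fun e => e12 (by rw [e])
    have n23 : s₂ ≠ s₃ := fun e => e21 (by rw [e])
    have n24 : s₂ ≠ s₄ := fun e => e22 (by rw [e])
    have n1 : ω.1 ≠ s₁ := fun e => hne₁ (by rw [e])
    have n2 : ω.1 ≠ s₂ := fun e => hne₂ (by rw [e])
    have n3 : ω.1 ≠ s₃ := fun e => hne₃ (by rw [e])
    have n4 : ω.1 ≠ s₄ := fun e => hne₄ (by rw [e])
    exact side_five h12 n13 n14 n23 n24 h34 n1 n2 n3 n4

/-- **Necessity on the mirror corner `u₂ = 0`** (any `u₁, v, w₁, w₂`, any phase): a nonzero exact vertex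
relation forces `(1+v−u₁)(1+v+u₁)(1−v−u₁)(1−v+u₁) = 0`. [cite: Glazman2015WeightedSAW, Lemma 3.1 (proof: "solving this linear system")] -/
theorem quartic_eq_zero_of_exactPlaquetteVertexRelation_of_u₂_eq_zero
    (hrel : ExactPlaquetteVertexRelation W t c) (ht : t ≠ 0) (h2 : W.u₂ = 0) (hc : c ≠ 0) :
    (1 + W.v - W.u₁) * (1 + W.v + W.u₁) * (1 - W.v - W.u₁) * (1 - W.v + W.u₁) = 0 := by
  have rE := groupOne_row_of_exactPlaquetteVertexRelation hrel .E
  have rN := groupOne_row_of_exactPlaquetteVertexRelation hrel .N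
  have rW := groupOne_row_of_exactPlaquetteVertexRelation hrel .W
  have rS := groupOne_row_of_exactPlaquetteVertexRelation hrel .S
  rw [sum_side] at rE rN rW rS
  simp only [slotIdx, arcKind, arcW, qTurn, h2, zpow_zero, zpow_one, zpow_neg, mul_one, mul_zero,
    zero_mul, add_zero, zero_add, Int.reduceNeg] at rE rN rW rS
  have hti : t * t⁻¹ = 1 := mul_inv_cancel₀ ht
  -- rows (u₂ = 0): E: c0 + c3 u₁ t + c2 v; N: c1 + c2 u₁ t⁻¹ + c3 v; W: c2 + c1 u₁ t + c0 v; S: c3 + c0 u₁ t⁻¹ + c1 v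
  have hA : (1 + W.v) * (c 0 + c 2) + W.u₁ * t * (c 1 + c 3) = 0 := by
    linear_combination rE + rW
  have hB : W.u₁ * (c 0 + c 2) + (1 + W.v) * t * (c 1 + c 3) = 0 := by
    linear_combination t * rN + t * rS - (W.u₁ * (c 0 + c 2)) * hti
  have hA' : (1 - W.v) * (c 0 - c 2) - W.u₁ * t * (c 1 - c 3) = 0 := by
    linear_combination rE - rW
  have hB' : -(W.u₁ * (c 0 - c 2)) + (1 - W.v) * t * (c 1 - c 3) = 0 := by
    linear_combination t * rN - t * rS + (W.u₁ * (c 0 - c 2)) * hti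
  have hP : ((1 + W.v) ^ 2 - W.u₁ ^ 2) * (c 0 + c 2) = 0 := by
    linear_combination (1 + W.v) * hA - W.u₁ * hB
  have hP2 : ((1 + W.v) ^ 2 - W.u₁ ^ 2) * ((c 1 + c 3) * t) = 0 := by
    linear_combination (1 + W.v) * hB - W.u₁ * hA
  have hM : ((1 - W.v) ^ 2 - W.u₁ ^ 2) * (c 0 - c 2) = 0 := by
    linear_combination (1 - W.v) * hA' + W.u₁ * hB'
  have hM2 : ((1 - W.v) ^ 2 - W.u₁ ^ 2) * ((c 1 - c 3) * t) = 0 := by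
    linear_combination (1 - W.v) * hB' + W.u₁ * hA'
  by_contra hq
  have hp : (1 + W.v) ^ 2 - W.u₁ ^ 2 ≠ 0 := by
    intro h0; apply hq; linear_combination ((1 - W.v - W.u₁) * (1 - W.v + W.u₁)) * h0
  have hm : (1 - W.v) ^ 2 - W.u₁ ^ 2 ≠ 0 := by
    intro h0; apply hq; linear_combination ((1 + W.v - W.u₁) * (1 + W.v + W.u₁)) * h0
  have e1 : c 0 + c 2 = 0 := (mul_eq_zero.1 hP).resolve_left hp
  have e2 : c 1 + c 3 = 0 := (mul_eq_zero.1 ((mul_eq_zero.1 hP2).resolve_left hp)).resolve_right ht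
  have e3 : c 0 - c 2 = 0 := (mul_eq_zero.1 hM).resolve_left hm
  have e4 : c 1 - c 3 = 0 := (mul_eq_zero.1 ((mul_eq_zero.1 hM2).resolve_left hm)).resolve_right ht
  apply hc
  funext i
  fin_cases i
  · show c 0 = 0
    linear_combination (e1 + e3) / 2
  · show c 1 = 0
    linear_combination (e2 + e4) / 2
  · show c 2 = 0
    linear_combination (e1 - e3) / 2
  · show c 3 = 0
    linear_combination (e2 - e4) / 2

/-- Rows for `(α, β, α, β)`, mirror corner, component `(1 + v)² = u₁²`. [folklore] -/
private theorem rows_sym' (ht : t ≠ 0) (h2 : W.u₂ = 0) (hq : (1 + W.v) ^ 2 = W.u₁ ^ 2) :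
    ∀ p : Side, ∑ x : Side, (![(1 + W.v) * t, -W.u₁, (1 + W.v) * t, -W.u₁] : Fin 4 → ℂ) (slotIdx x) *
      arcW W (arcKind p x) * t ^ qTurn p x = 0 := by
  have hti : t * t⁻¹ = 1 := mul_inv_cancel₀ ht
  intro p
  rw [sum_side]
  cases p <;>
    simp only [slotIdx, arcKind, arcW, qTurn, h2, Matrix.cons_val_zero, Matrix.cons_val_one, Matrix.head_cons,
      Matrix.cons_val_two, Matrix.tail_cons, Matrix.cons_val_three, zpow_zero, zpow_one, zpow_neg, mul_one,
      mul_zero, zero_mul, add_zero, zero_add, Int.reduceNeg] <;>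
    first
    | linear_combination t * hq
    | linear_combination -t * hq
    | linear_combination (W.u₁ * (1 + W.v)) * hti

/-- Rows for `(α, β, −α, −β)`, mirror corner, component `(1 − v)² = u₁²`. [folklore] -/
private theorem rows_antisym' (ht : t ≠ 0) (h2 : W.u₂ = 0) (hq : (1 - W.v) ^ 2 = W.u₁ ^ 2) :
    ∀ p : Side, ∑ x : Side, (![(1 - W.v) * t, W.u₁, -(1 - W.v) * t, -W.u₁] : Fin 4 → ℂ) (slotIdx x) *
      arcW W (arcKind p x) * t ^ qTurn p x = 0 := by
  have hti : t * t⁻¹ = 1 := mul_inv_cancel₀ ht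
  intro p
  rw [sum_side]
  cases p <;>
    simp only [slotIdx, arcKind, arcW, qTurn, h2, Matrix.cons_val_zero, Matrix.cons_val_one, Matrix.head_cons,
      Matrix.cons_val_two, Matrix.tail_cons, Matrix.cons_val_three, zpow_zero, zpow_one, zpow_neg, mul_one,
      mul_zero, zero_mul, add_zero, zero_add, Int.reduceNeg] <;>
    first
    | linear_combination t * hq
    | linear_combination -t * hq
    | linear_combination (W.u₁ * (1 - W.v)) * hti
    | linear_combination -(W.u₁ * (1 - W.v)) * hti

/-- Rows at the double point `u₁ = 0`, `v = −1` (mirror corner) for `(1, 0, 1, 0)`. [folklore] -/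
private theorem rows_sym0' (h2 : W.u₂ = 0) (hu : W.u₁ = 0) (hv : 1 + W.v = 0) :
    ∀ p : Side, ∑ x : Side, (![1, 0, 1, 0] : Fin 4 → ℂ) (slotIdx x) * arcW W (arcKind p x) * t ^ qTurn p x = 0 := by
  intro p
  rw [sum_side]
  cases p <;>
    simp only [slotIdx, arcKind, arcW, qTurn, h2, hu, Matrix.cons_val_zero, Matrix.cons_val_one, Matrix.head_cons,
      Matrix.cons_val_two, Matrix.tail_cons, Matrix.cons_val_three, zpow_zero, mul_one,
      mul_zero, zero_mul, add_zero] <;>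
    linear_combination hv

/-- Rows at the double point `u₁ = 0`, `v = 1` (mirror corner) for `(1, 0, −1, 0)`. [folklore] -/
private theorem rows_antisym0' (h2 : W.u₂ = 0) (hu : W.u₁ = 0) (hv : 1 - W.v = 0) :
    ∀ p : Side, ∑ x : Side, (![1, 0, -1, 0] : Fin 4 → ℂ) (slotIdx x) * arcW W (arcKind p x) * t ^ qTurn p x = 0 := by
  intro p
  rw [sum_side]
  cases p <;>
    simp only [slotIdx, arcKind, arcW, qTurn, h2, hu, Matrix.cons_val_zero, Matrix.cons_val_one, Matrix.head_cons,
      Matrix.cons_val_two, Matrix.tail_cons, Matrix.cons_val_three, zpow_zero, mul_one,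
      mul_zero, zero_mul, add_zero] <;>
    first
    | linear_combination hv
    | linear_combination -hv

/-- ★ **Two-sided classification of the mirror corner `u₂ = w₂ = 0`** (any `u₁, v, w₁`, any phase
`t ≠ 0`): a nonzero exact vertex relation exists iff `(1+v−u₁)(1+v+u₁)(1−v−u₁)(1−v+u₁) = 0`.
[cite: Glazman2015WeightedSAW, Lemma 3.1 (proof: "solving this linear system")] -/
theorem exactPlaquetteVertexRelation_iff_quartic' (W : CWeights) {t : ℂ} (ht : t ≠ 0) (h2 : W.u₂ = 0)
    (hw2 : W.w₂ = 0) :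
    (∃ c : Fin 4 → ℂ, c ≠ 0 ∧ ExactPlaquetteVertexRelation W t c) ↔
      (1 + W.v - W.u₁) * (1 + W.v + W.u₁) * (1 - W.v - W.u₁) * (1 - W.v + W.u₁) = 0 := by
  constructor
  · rintro ⟨c, hc, hrel⟩
    exact quartic_eq_zero_of_exactPlaquetteVertexRelation_of_u₂_eq_zero hrel ht h2 hc
  · intro hq
    have hq' : (1 + W.v) ^ 2 - W.u₁ ^ 2 = 0 ∨ (1 - W.v) ^ 2 - W.u₁ ^ 2 = 0 := by
      have : ((1 + W.v) ^ 2 - W.u₁ ^ 2) * ((1 - W.v) ^ 2 - W.u₁ ^ 2) = 0 := by linear_combination hq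
      exact mul_eq_zero.1 this
    rcases hq' with hA | hB
    · by_cases hz : W.u₁ = 0 ∧ 1 + W.v = 0
      · refine ⟨![1, 0, 1, 0], fun h0 => ?_,
          exactPlaquetteVertexRelation_of_u₂_w₂_eq_zero ht h2 hw2 (rows_sym0' h2 hz.1 hz.2)⟩
        have := congrFun h0 0
        simp at this
      · refine ⟨![(1 + W.v) * t, -W.u₁, (1 + W.v) * t, -W.u₁], fun h0 => hz ?_,
          exactPlaquetteVertexRelation_of_u₂_w₂_eq_zero ht h2 hw2
            (rows_sym' ht h2 (by linear_combination hA))⟩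
        have e0 := congrFun h0 0
        have e1 := congrFun h0 1
        simp only [Matrix.cons_val_zero, Matrix.cons_val_one, Pi.zero_apply, neg_eq_zero, mul_eq_zero] at e0 e1
        exact ⟨e1, e0.resolve_right ht⟩
    · by_cases hz : W.u₁ = 0 ∧ 1 - W.v = 0
      · refine ⟨![1, 0, -1, 0], fun h0 => ?_,
          exactPlaquetteVertexRelation_of_u₂_w₂_eq_zero ht h2 hw2 (rows_antisym0' h2 hz.1 hz.2)⟩
        have := congrFun h0 0
        simp at this
      · refine ⟨![(1 - W.v) * t, W.u₁, -(1 - W.v) * t, -W.u₁], fun h0 => hz ?_,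
          exactPlaquetteVertexRelation_of_u₂_w₂_eq_zero ht h2 hw2
            (rows_antisym' ht h2 (by linear_combination hB))⟩
        have e0 := congrFun h0 0
        have e1 := congrFun h0 1
        simp only [Matrix.cons_val_zero, Matrix.cons_val_one, Pi.zero_apply, mul_eq_zero] at e0 e1
        exact ⟨e1, e0.resolve_right ht⟩

/-- **Barrier `PlaquetteWalkMirrorCornerClassification`** (named statement): on the mirror corner
`u₂ = w₂ = 0` (no weight for one or two co-corner arcs; `u₁, v, w₁` arbitrary complex, any phase `t ≠ 0`)
a nonzero exact constant-coefficient vertex relation on every finite face list for every boundary root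
exists iff `(1+v−u₁)(1+v+u₁)(1−v−u₁)(1−v+u₁) = 0`. A THEOREM of this file
(`PlaquetteWalkMirrorCornerClassification_holds`); same D-0021 block as
`PlaquetteWalkDirectedCornerClassification` with corner ↔ co-corner, `ψ ↦` the anti-diagonal potential
`2(k + j)` and `(u₂, w₂) ↔ (u₁, w₁)`. [cite: Glazman2015WeightedSAW, Lemma 3.1] -/
def _root_.Literature.Barriers.CriticalPhenomena.PlaquetteWalkMirrorCornerClassification : Prop :=
  ∀ (W : CWeights) (t : ℂ), t ≠ 0 → W.u₂ = 0 → W.w₂ = 0 →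
    ((∃ c : Fin 4 → ℂ, c ≠ 0 ∧ ExactPlaquetteVertexRelation W t c) ↔
      (1 + W.v - W.u₁) * (1 + W.v + W.u₁) * (1 - W.v - W.u₁) * (1 - W.v + W.u₁) = 0)

/-- **`PlaquetteWalkMirrorCornerClassification` holds.** [cite: Glazman2015WeightedSAW, Lemma 3.1] -/
theorem _root_.Literature.Barriers.CriticalPhenomena.PlaquetteWalkMirrorCornerClassification_holds :
    PlaquetteWalkMirrorCornerClassification :=
  fun W _ ht h2 hw2 => exactPlaquetteVertexRelation_iff_quartic' W ht h2 hw2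

end MirrorCorner


/-! ### Appended: no Yang–Baxter walk doubles all its corner plaquettes — the slivers
`{u₁ = 0, w₁ ≠ 0}` and `{u₂ = 0, w₂ ≠ 0}` closed, the branches `u₁ = 0` and `u₂ = 0` classified for
ALL weights

The LEVEL `k − j` of the plaquette `(k, j)` of the `i`-th arc of a walk moves by `±1` from arc to arc
(`+1` through an `S` or `E` side, `−1` through `W` or `N`): a corner arc `{W, N}` is a strict local
MAXIMUM of the level sequence, a corner arc `{S, E}` a strict local MINIMUM, every other arc is monotone
(`arcKindOf_eq_corner_of_peak`). ★ `exists_kindsIn_eq_corner`: a walk with a corner arc has a plaquette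
crossed exactly once, by a corner arc — take a corner arc of maximal level `d`; were its plaquette
crossed twice, the other arc would be the complementary corner arc, one of the two would join `S` and
`E`, its walk-neighbour would sit at level `d + 1`, and between that neighbour and the other arc of the
plaquette the level would reach a strict local maximum `≥ d + 1`: a corner arc above the maximal level
(`exists_peak`). The mirror statement `exists_kindsIn_eq_coCorner` uses the co-level `k + j`.
Consequences: `exactPlaquetteVertexRelation_of_u₁_eq_zero` / `_of_u₂_eq_zero` (sufficiency of the four
group-one rows on the WHOLE branches `u₁ = 0` / `u₂ = 0` — a returning walk has a corner arc, hence a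
plaquette weighing `u₁ = 0`, so only fresh arrivals contribute), the two-sided classifications
`exactPlaquetteVertexRelation_iff_quartic_of_u₁_eq_zero` / `_of_u₂_eq_zero`, named
**`PlaquetteWalkCornerBranchClassification(_holds)`** / **`PlaquetteWalkMirrorBranchClassification(_holds)`**.
With `PlaquetteWalkDegenerateClassification` and the tree's `PlaquetteWalkNoAllRootsRelation` the
all-boundary-roots class is now classified on ALL of `ℂ⁵ × {t ≠ 0}` (assembled in
`PlaquetteWalkAllRootsClassification`). Written for the venture lane «pcv-sawmu» (seat b-engine-1 gen 13).
-/

section CornerSlivers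

open ΩF

variable {D : Set Face} {a z : MidEdge}

/-! #### The level of a plaquette along a walk -/

/-- The LEVEL of a plaquette `(k, j)`: `k − j` (constant along the anti-diagonals; the east and south
neighbours of a plaquette sit one level higher, the west and north neighbours one level lower). [folklore] -/
def lev (f : Face) : ℤ := f.1 - f.2

/-- The level step through a side: `+1` through `S` or `E`, `−1` through `W` or `N`. [folklore] -/
def sideSgn : Side → ℤ
  | .S => 1
  | .E => 1
  | .W => -1
  | .N => -1

/-- The level of an arc: the level of the plaquette it is drawn in (junk `0` otherwise). [folklore] -/
def arcLev (p : MidEdge × MidEdge) : ℤ :=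
  match arcFace p with
  | some f => lev f
  | none => 0

/-- The level of an arc drawn in `f` is the level of `f`. [folklore] -/
private theorem arcLev_of_arcFace {p : MidEdge × MidEdge} {f : Face} (h : arcFace p = some f) : arcLev p = lev f := by
  simp [arcLev, h]

/-- **Crossing a side changes the level by its sign**: the other plaquette bordering the side `s` of `f`
has level `lev f + sideSgn s` (arc after the crossing). [folklore] -/
private theorem lev_of_adj_right {f f' : Face} {s : Side} {y : MidEdge} (h : arcFace (f.side s, y) = some f')
    (hne : f' ≠ f) : lev f' = lev f + sideSgn s := by
  obtain ⟨-, h2, -⟩ := MidEdge.commonFace_eq_some h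
  obtain ⟨k, j⟩ := f
  obtain ⟨k', j'⟩ := f'
  cases s <;>
    simp only [Face.side, MidEdge.faces, Prod.mk.injEq, lev, sideSgn, ne_eq] at h2 hne ⊢ <;> omega

/-- The same for the arc before the crossing. [folklore] -/
private theorem lev_of_adj_left {f f' : Face} {s : Side} {x : MidEdge} (h : arcFace (x, f.side s) = some f')
    (hne : f' ≠ f) : lev f' = lev f + sideSgn s := by
  obtain ⟨-, -, h2⟩ := MidEdge.commonFace_eq_some h
  obtain ⟨k, j⟩ := f
  obtain ⟨k', j'⟩ := f'
  cases s <;>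
    simp only [Face.side, MidEdge.faces, Prod.mk.injEq, lev, sideSgn, ne_eq] at h2 hne ⊢ <;> omega

/-- The sign of a side is `±1`. [folklore] -/
private theorem sideSgn_eq_or (s : Side) : sideSgn s = 1 ∨ sideSgn s = -1 := by cases s <;> simp [sideSgn]

/-- A corner arc joins two sides of the same sign (`{W,N}` or `{S,E}`). [folklore] -/
private theorem sideSgn_eq_of_corner {s u : Side} (h : arcKind s u = .corner) : sideSgn s = sideSgn u := by
  revert h; cases s <;> cases u <;> simp [arcKind, sideSgn]

/-- Two distinct sides of sign `−1` are `{W, N}`: the arc joining them is a corner arc. [folklore] -/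
private theorem arcKind_eq_corner_of_sideSgn {s u : Side} (hsu : s ≠ u) (hs : sideSgn s = -1) (hu : sideSgn u = -1) :
    arcKind s u = .corner := by
  revert hsu hs hu; cases s <;> cases u <;> simp [arcKind, sideSgn]

/-- Among two disjoint pairs of equal-sign sides, one pair has sign `+1`. [folklore] -/
private theorem sideSgn_pos_of_four {s u s' u' : Side} (h0 : s ≠ u) (h0' : s' ≠ u') (h1 : s ≠ s') (h2 : s ≠ u')
    (h3 : u ≠ s') (h4 : u ≠ u') (hsu : sideSgn s = sideSgn u) (hsu' : sideSgn s' = sideSgn u') :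
    sideSgn s = 1 ∨ sideSgn s' = 1 := by
  revert h0 h0' h1 h2 h3 h4 hsu hsu'; cases s <;> cases u <;> cases s' <;> cases u' <;> simp [sideSgn]

/-- The level of the `i`-th arc of a walk. [folklore] -/
def alev (γ : YBWalk D a z) (i : ℕ) : ℤ := arcLev (γ.nth i, γ.nth (i + 1))

/-- **Consecutive arcs differ by one level**, the sign being that of the crossed side: if arc `i` is
drawn in `f` and leaves through the side `u` of `f`, arc `i + 1` has level `lev f + sideSgn u`. [folklore] -/
private theorem alev_succ_eq (γ : YBWalk D a z) {i : ℕ} (hi : i + 1 < γ.arcs.length) {f : Face}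
    (hf : arcFace (γ.nth i, γ.nth (i + 1)) = some f) {u : Side} (hu : f.side u = γ.nth (i + 1)) :
    alev γ (i + 1) = lev f + sideSgn u := by
  obtain ⟨f', -, hf'⟩ := γ.arc_nth hi
  have hne : f' ≠ f := by
    intro e; subst e
    exact γ.chain_nth hi (by rw [hf, show i + 1 + 1 = i + 2 from rfl, hf'])
  rw [alev, show i + 1 + 1 = i + 2 from rfl, arcLev_of_arcFace hf']
  rw [← hu, show i + 1 + 1 = i + 2 from rfl] at hf'
  exact lev_of_adj_right hf' hne

/-- The same one arc back: if arc `i + 1` is drawn in `f` and enters through the side `s` of `f`, arc `i`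
has level `lev f + sideSgn s`. [folklore] -/
private theorem alev_pred_eq (γ : YBWalk D a z) {i : ℕ} (hi : i + 1 < γ.arcs.length) {f : Face}
    (hf : arcFace (γ.nth (i + 1), γ.nth (i + 2)) = some f) {s : Side} (hs : f.side s = γ.nth (i + 1)) :
    alev γ i = lev f + sideSgn s := by
  obtain ⟨f', -, hf'⟩ := γ.arc_nth (show i < γ.arcs.length by omega)
  have hne : f' ≠ f := by
    intro e; subst e
    exact γ.chain_nth hi (by rw [hf', hf])
  rw [alev, arcLev_of_arcFace hf']
  rw [← hs] at hf'
  exact lev_of_adj_left hf' hne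

/-- Consecutive levels differ by `±1`. [folklore] -/
private theorem alev_succ_eq_or (γ : YBWalk D a z) {i : ℕ} (hi : i + 1 < γ.arcs.length) :
    alev γ (i + 1) = alev γ i + 1 ∨ alev γ (i + 1) = alev γ i - 1 := by
  obtain ⟨f, -, hf⟩ := γ.arc_nth (show i < γ.arcs.length by omega)
  obtain ⟨s, u, -, -, hu, -⟩ := exists_sides_of_arcFace hf
  simp only at hu
  have e0 : alev γ i = lev f := arcLev_of_arcFace hf
  rw [alev_succ_eq γ hi hf hu, e0]
  rcases sideSgn_eq_or u with h | h <;> rw [h]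
  · exact Or.inl rfl
  · exact Or.inr (by ring)

/-- **A strict local maximum of the level is a corner arc** (both walk-neighbours of the plaquette lie
one level lower, so the arc joins its `W` and `N` sides). [folklore] -/
private theorem arcKindOf_eq_corner_of_peak (γ : YBWalk D a z) {r : ℕ} (hr1 : 1 ≤ r) (hr2 : r + 1 < γ.arcs.length)
    (hL : alev γ (r - 1) = alev γ r - 1) (hR : alev γ (r + 1) = alev γ r - 1) :
    arcKindOf (γ.nth r, γ.nth (r + 1)) = some .corner := by
  obtain ⟨f, -, hf⟩ := γ.arc_nth (show r < γ.arcs.length by omega)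
  obtain ⟨s, u, hsu, hs, hu, hk⟩ := exists_sides_of_arcFace hf
  simp only at hs hu
  have e0 : alev γ r = lev f := arcLev_of_arcFace hf
  have e1 := alev_succ_eq γ hr2 hf hu
  obtain ⟨r', rfl⟩ : ∃ r', r = r' + 1 := ⟨r - 1, by omega⟩
  have e2 := alev_pred_eq γ (i := r') (by omega) hf hs
  rw [show r' + 1 - 1 = r' by omega] at hL
  rw [hk, arcKind_eq_corner_of_sideSgn hsu (by linarith) (by linarith)]

/-- **Peak lemma**: if the level on an index interval `[lo, hi]` reaches `M` somewhere while the two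
flanking arcs `lo − 1`, `hi + 1` lie below `M`, then some arc of the interval is a strict local
maximum of the level, of level `≥ M`. [folklore] -/
private theorem exists_peak (γ : YBWalk D a z) {lo hi : ℕ} (hlo : 1 ≤ lo) (hlh : lo ≤ hi) (hhi : hi + 1 < γ.arcs.length)
    {M : ℤ} (hL : alev γ (lo - 1) < M) (hR : alev γ (hi + 1) < M) (hM : ∃ k, lo ≤ k ∧ k ≤ hi ∧ M ≤ alev γ k) :
    ∃ r, lo ≤ r ∧ r ≤ hi ∧ alev γ (r - 1) = alev γ r - 1 ∧ alev γ (r + 1) = alev γ r - 1 ∧ M ≤ alev γ r := by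
  obtain ⟨k, hk1, hk2, hkM⟩ := hM
  obtain ⟨r, hr, hmax⟩ := Finset.exists_max_image (Finset.Icc lo hi) (alev γ) ⟨k, Finset.mem_Icc.2 ⟨hk1, hk2⟩⟩
  rw [Finset.mem_Icc] at hr
  have hMr : M ≤ alev γ r := hkM.trans (hmax k (Finset.mem_Icc.2 ⟨hk1, hk2⟩))
  refine ⟨r, hr.1, hr.2, ?_, ?_, hMr⟩
  · obtain ⟨r', rfl⟩ : ∃ r', r = r' + 1 := ⟨r - 1, by omega⟩
    rw [show r' + 1 - 1 = r' by omega]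
    rcases alev_succ_eq_or γ (i := r') (by omega) with h | h
    · omega
    · exfalso
      by_cases h' : lo ≤ r'
      · have := hmax r' (Finset.mem_Icc.2 ⟨h', by omega⟩); omega
      · have : r' = lo - 1 := by omega
        subst this; omega
  · rcases alev_succ_eq_or γ (i := r) (by omega) with h | h
    · exfalso
      by_cases h' : r + 1 ≤ hi
      · have := hmax (r + 1) (Finset.mem_Icc.2 ⟨by omega, h'⟩); omega
      · have : r = hi := by omega
        subst this; omega
    · exact h

/-- ★ **No Yang–Baxter walk doubles all its corner plaquettes**: a walk with a corner arc has a
plaquette containing exactly one of its arcs, that arc a corner arc (so the plaquette weighs `u₁`).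
Proof: a corner arc of MAXIMAL level; were its plaquette `f` crossed twice, the second arc would be the
complementary corner arc, one of the two would join the `S` and `E` sides, its walk-neighbour would lie
at level `lev f + 1`, and between it and the other arc of `f` the level would have a strict local
maximum `≥ lev f + 1` — a corner arc above the maximal level. [cite: GlazmanManolescu2019, §1, Fig. 1 (the local configurations u₁ / w₁ of the plaquette walk; the statement itself is not in print)] -/
theorem exists_kindsIn_eq_corner (γ : YBWalk D a z) {i : ℕ} (hi : i < γ.arcs.length)
    (hk : arcKindOf (γ.nth i, γ.nth (i + 1)) = some .corner) : ∃ g, γ.kindsIn g = [.corner] := by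
  classical
  -- a corner arc `j` of maximal level
  set C : Finset ℕ := (Finset.range γ.arcs.length).filter fun j =>
    arcKindOf (γ.nth j, γ.nth (j + 1)) = some .corner with hC
  have hiC : i ∈ C := by rw [hC, Finset.mem_filter, Finset.mem_range]; exact ⟨hi, hk⟩
  obtain ⟨j, hjC, hjmax⟩ := Finset.exists_max_image C (alev γ) ⟨i, hiC⟩
  rw [hC, Finset.mem_filter, Finset.mem_range] at hjC
  obtain ⟨hj, hjk⟩ := hjC
  obtain ⟨f, -, hf⟩ := γ.arc_nth hj
  have hjlev : alev γ j = lev f := arcLev_of_arcFace hf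
  have hmemj : (γ.nth j, γ.nth (j + 1)) ∈ (arcsOf γ.mids).filter fun p => arcFace p = some f :=
    List.mem_filter.2 ⟨γ.arc_nth_mem hj, by simpa using hf⟩
  refine ⟨f, ?_⟩
  rcases filter_face_cases γ f with h0 | ⟨p, h1, hpf⟩ | ⟨p, q, h2, hpq, hpf, hqf, hkk⟩
  · rw [h0] at hmemj; simp at hmemj
  · -- exactly one arc in `f`: it is the corner arc `j`
    rw [h1, List.mem_singleton] at hmemj
    refine γ.kindsIn_eq_singleton (γ.arc_nth_mem hj) hf (fun q hq hqf => ?_) hjk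
    have : q ∈ (arcsOf γ.mids).filter fun p => arcFace p = some f := List.mem_filter.2 ⟨hq, by simpa using hqf⟩
    rw [h1, List.mem_singleton] at this
    rw [this, hmemj]
  · -- two arcs in `f`: the other one, `o`, is a corner arc too, at some index `m`
    exfalso
    have hmem : ∀ o, o ∈ [p, q] → o ∈ γ.arcs := by
      intro o ho
      have : o ∈ (arcsOf γ.mids).filter fun p => arcFace p = some f := by rw [h2]; exact ho
      exact (List.mem_filter.1 this).1
    obtain ⟨o, hoa, hof, hoj, hok⟩ : ∃ o ∈ γ.arcs, arcFace o = some f ∧ o ≠ (γ.nth j, γ.nth (j + 1)) ∧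
        arcKindOf o = some .corner := by
      rw [h2] at hmemj
      simp only [List.mem_cons, List.not_mem_nil, or_false] at hmemj
      rcases hmemj with e | e
      · refine ⟨q, hmem q (by simp), hqf, by rw [e]; exact hpq.symm, ?_⟩
        rw [← hkk, ← e]; exact hjk
      · refine ⟨p, hmem p (by simp), hpf, by rw [e]; exact hpq, ?_⟩
        rw [hkk, ← e]; exact hjk
    obtain ⟨m, hm, hom⟩ := (γ.mem_arcs_iff_nth).1 hoa
    rw [hom] at hof hoj hok
    have hmlev : alev γ m = lev f := arcLev_of_arcFace hof
    -- sides: arc `j` = (s, u), arc `m` = (s', u'), four distinct sides of `f`, both pairs corner pairs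
    obtain ⟨s, u, hsu, hs, hu, hks⟩ := exists_sides_of_arcFace hf
    obtain ⟨s', u', hsu', hs', hu', hks'⟩ := exists_sides_of_arcFace hof
    simp only at hs hu hs' hu'
    rw [hks, Option.some.injEq] at hjk
    rw [hks', Option.some.injEq] at hok
    obtain ⟨e11, e12, e21, e22⟩ := arcs_ends_ne γ (γ.arc_nth_mem hj) hoa (Ne.symm (hom ▸ hoj)) hf (hom ▸ hof)
    rw [hom] at e11 e12 e21 e22
    simp only at e11 e12 e21 e22
    rw [← hs, ← hs'] at e11
    rw [← hs, ← hu'] at e12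
    rw [← hu, ← hs'] at e21
    rw [← hu, ← hu'] at e22
    have n1 : s ≠ s' := fun e => e11 (by rw [e])
    have n2 : s ≠ u' := fun e => e12 (by rw [e])
    have n3 : u ≠ s' := fun e => e21 (by rw [e])
    have n4 : u ≠ u' := fun e => e22 (by rw [e])
    have hsg := sideSgn_eq_of_corner hjk
    have hsg' := sideSgn_eq_of_corner hok
    -- `j ≠ m`, and they are not consecutive (consecutive arcs lie in different plaquettes)
    have hjm : j ≠ m := by rintro rfl; exact hoj rfl
    have hjm1 : m ≠ j + 1 := by
      rintro rfl
      exact γ.chain_nth hm (by rw [hf, show j + 1 + 1 = j + 2 from rfl, hof])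
    have hmj1 : j ≠ m + 1 := by
      rintro rfl
      exact γ.chain_nth hj (by rw [hof, show m + 1 + 1 = m + 2 from rfl, hf])
    -- the interval strictly between the two arcs, and a point of level `lev f + 1` in it
    have key : ∀ {e e' : ℕ} {σ τ : Side}, e < γ.arcs.length → e' < γ.arcs.length → e ≠ e' → e' ≠ e + 1 →
        e ≠ e' + 1 → arcFace (γ.nth e, γ.nth (e + 1)) = some f → arcFace (γ.nth e', γ.nth (e' + 1)) = some f →
        f.side σ = γ.nth e → f.side τ = γ.nth (e + 1) → sideSgn σ = 1 → sideSgn τ = 1 → False := by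
      intro e e' σ τ he he' hne h1 h2 hef hef' hσ hτ sσ sτ
      have le : alev γ e = lev f := arcLev_of_arcFace hef
      have le' : alev γ e' = lev f := arcLev_of_arcFace hef'
      rcases Nat.lt_or_gt_of_ne hne with hlt | hlt
      · -- `e < e'`: interval `[e+1, e'-1]`, the arc `e+1` has level `lev f + 1`
        have hl1 : alev γ (e + 1) = lev f + 1 := by rw [alev_succ_eq γ (by omega) hef hτ, sτ]
        obtain ⟨r, hr1, hr2, hrL, hrR, hrM⟩ := exists_peak γ (lo := e + 1) (hi := e' - 1) (M := lev f + 1)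
          (by omega) (by omega) (by rw [show e' - 1 + 1 = e' by omega]; exact he')
          (by rw [show e + 1 - 1 = e by omega, le]; linarith)
          (by rw [show e' - 1 + 1 = e' by omega, le']; linarith) ⟨e + 1, le_rfl, by omega, hl1.ge⟩
        have hrc := arcKindOf_eq_corner_of_peak γ (by omega) (by omega) hrL hrR
        have hrC : r ∈ C := by rw [hC, Finset.mem_filter, Finset.mem_range]; exact ⟨by omega, hrc⟩
        have := hjmax r hrC
        rw [hjlev] at this
        linarith
      · -- `e' < e`: interval `[e'+1, e-1]`, the arc `e-1` has level `lev f + 1`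
        obtain ⟨e₀, rfl⟩ : ∃ e₀, e = e₀ + 1 := ⟨e - 1, by omega⟩
        have hl1 : alev γ e₀ = lev f + 1 := by rw [alev_pred_eq γ (by omega) hef hσ, sσ]
        obtain ⟨r, hr1, hr2, hrL, hrR, hrM⟩ := exists_peak γ (lo := e' + 1) (hi := e₀) (M := lev f + 1)
          (by omega) (by omega) (by omega)
          (by rw [show e' + 1 - 1 = e' by omega, le']; linarith)
          (by rw [le]; linarith) ⟨e₀, by omega, le_rfl, hl1.ge⟩
        have hrc := arcKindOf_eq_corner_of_peak γ (by omega) (by omega) hrL hrR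
        have hrC : r ∈ C := by rw [hC, Finset.mem_filter, Finset.mem_range]; exact ⟨by omega, hrc⟩
        have := hjmax r hrC
        rw [hjlev] at this
        linarith
    rcases sideSgn_pos_of_four hsu hsu' n1 n2 n3 n4 hsg hsg' with h | h
    · exact key hj hm hjm hjm1 hmj1 hf hof hs hu h (hsg ▸ h)
    · exact key hm hj (Ne.symm hjm) hmj1 hjm1 hof hf hs' hu' h (hsg' ▸ h)

/-! #### The co-level (mirror) -/

/-- The CO-LEVEL of a plaquette `(k, j)`: `k + j` (constant along the diagonals; the east and north
neighbours of a plaquette sit one co-level higher, the west and south neighbours one lower). [folklore] -/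
def levM (f : Face) : ℤ := f.1 + f.2

/-- The co-level step through a side: `+1` through `N` or `E`, `−1` through `W` or `S`. [folklore] -/
def sideSgnM : Side → ℤ
  | .S => -1
  | .E => 1
  | .W => -1
  | .N => 1

/-- The co-level of an arc: the co-level of the plaquette it is drawn in (junk `0` otherwise). [folklore] -/
def arcLevM (p : MidEdge × MidEdge) : ℤ :=
  match arcFace p with
  | some f => levM f
  | none => 0

/-- The co-level of an arc drawn in `f` is the co-level of `f`. [folklore] -/
private theorem arcLevM_of_arcFace {p : MidEdge × MidEdge} {f : Face} (h : arcFace p = some f) : arcLevM p = levM f := by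
  simp [arcLevM, h]

/-- **Crossing a side changes the co-level by its sign**: the other plaquette bordering the side `s` of `f`
has co-level `levM f + sideSgnM s` (arc after the crossing). [folklore] -/
private theorem levM_of_adj_right {f f' : Face} {s : Side} {y : MidEdge} (h : arcFace (f.side s, y) = some f')
    (hne : f' ≠ f) : levM f' = levM f + sideSgnM s := by
  obtain ⟨-, h2, -⟩ := MidEdge.commonFace_eq_some h
  obtain ⟨k, j⟩ := f
  obtain ⟨k', j'⟩ := f'
  cases s <;>
    simp only [Face.side, MidEdge.faces, Prod.mk.injEq, levM, sideSgnM, ne_eq] at h2 hne ⊢ <;> omega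

/-- The same for the arc before the crossing. [folklore] -/
private theorem levM_of_adj_left {f f' : Face} {s : Side} {x : MidEdge} (h : arcFace (x, f.side s) = some f')
    (hne : f' ≠ f) : levM f' = levM f + sideSgnM s := by
  obtain ⟨-, -, h2⟩ := MidEdge.commonFace_eq_some h
  obtain ⟨k, j⟩ := f
  obtain ⟨k', j'⟩ := f'
  cases s <;>
    simp only [Face.side, MidEdge.faces, Prod.mk.injEq, levM, sideSgnM, ne_eq] at h2 hne ⊢ <;> omega

/-- The sign of a side is `±1`. [folklore] -/
private theorem sideSgnM_eq_or (s : Side) : sideSgnM s = 1 ∨ sideSgnM s = -1 := by cases s <;> simp [sideSgnM]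

/-- A co-corner arc joins two sides of the same co-sign (`{W,S}` or `{N,E}`). [folklore] -/
private theorem sideSgnM_eq_of_coCorner {s u : Side} (h : arcKind s u = .coCorner) : sideSgnM s = sideSgnM u := by
  revert h; cases s <;> cases u <;> simp [arcKind, sideSgnM]

/-- Two distinct sides of co-sign `−1` are `{W, S}`: the arc joining them is a co-corner arc. [folklore] -/
private theorem arcKind_eq_coCorner_of_sideSgnM {s u : Side} (hsu : s ≠ u) (hs : sideSgnM s = -1) (hu : sideSgnM u = -1) :
    arcKind s u = .coCorner := by
  revert hsu hs hu; cases s <;> cases u <;> simp [arcKind, sideSgnM]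

/-- Among two disjoint pairs of equal-sign sides, one pair has sign `+1`. [folklore] -/
private theorem sideSgnM_pos_of_four {s u s' u' : Side} (h0 : s ≠ u) (h0' : s' ≠ u') (h1 : s ≠ s') (h2 : s ≠ u')
    (h3 : u ≠ s') (h4 : u ≠ u') (hsu : sideSgnM s = sideSgnM u) (hsu' : sideSgnM s' = sideSgnM u') :
    sideSgnM s = 1 ∨ sideSgnM s' = 1 := by
  revert h0 h0' h1 h2 h3 h4 hsu hsu'; cases s <;> cases u <;> cases s' <;> cases u' <;> simp [sideSgnM]

/-- The co-level of the `i`-th arc of a walk. [folklore] -/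
def alevM (γ : YBWalk D a z) (i : ℕ) : ℤ := arcLevM (γ.nth i, γ.nth (i + 1))

/-- **Consecutive arcs differ by one co-level**, the sign being that of the crossed side: if arc `i` is
drawn in `f` and leaves through the side `u` of `f`, arc `i + 1` has co-level `levM f + sideSgnM u`. [folklore] -/
private theorem alevM_succ_eq (γ : YBWalk D a z) {i : ℕ} (hi : i + 1 < γ.arcs.length) {f : Face}
    (hf : arcFace (γ.nth i, γ.nth (i + 1)) = some f) {u : Side} (hu : f.side u = γ.nth (i + 1)) :
    alevM γ (i + 1) = levM f + sideSgnM u := by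
  obtain ⟨f', -, hf'⟩ := γ.arc_nth hi
  have hne : f' ≠ f := by
    intro e; subst e
    exact γ.chain_nth hi (by rw [hf, show i + 1 + 1 = i + 2 from rfl, hf'])
  rw [alevM, show i + 1 + 1 = i + 2 from rfl, arcLevM_of_arcFace hf']
  rw [← hu, show i + 1 + 1 = i + 2 from rfl] at hf'
  exact levM_of_adj_right hf' hne

/-- The same one arc back: if arc `i + 1` is drawn in `f` and enters through the side `s` of `f`, arc `i`
has co-level `levM f + sideSgnM s`. [folklore] -/
private theorem alevM_pred_eq (γ : YBWalk D a z) {i : ℕ} (hi : i + 1 < γ.arcs.length) {f : Face}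
    (hf : arcFace (γ.nth (i + 1), γ.nth (i + 2)) = some f) {s : Side} (hs : f.side s = γ.nth (i + 1)) :
    alevM γ i = levM f + sideSgnM s := by
  obtain ⟨f', -, hf'⟩ := γ.arc_nth (show i < γ.arcs.length by omega)
  have hne : f' ≠ f := by
    intro e; subst e
    exact γ.chain_nth hi (by rw [hf', hf])
  rw [alevM, arcLevM_of_arcFace hf']
  rw [← hs] at hf'
  exact levM_of_adj_left hf' hne

/-- Consecutive co-levels differ by `±1`. [folklore] -/
private theorem alevM_succ_eq_or (γ : YBWalk D a z) {i : ℕ} (hi : i + 1 < γ.arcs.length) :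
    alevM γ (i + 1) = alevM γ i + 1 ∨ alevM γ (i + 1) = alevM γ i - 1 := by
  obtain ⟨f, -, hf⟩ := γ.arc_nth (show i < γ.arcs.length by omega)
  obtain ⟨s, u, -, -, hu, -⟩ := exists_sides_of_arcFace hf
  simp only at hu
  have e0 : alevM γ i = levM f := arcLevM_of_arcFace hf
  rw [alevM_succ_eq γ hi hf hu, e0]
  rcases sideSgnM_eq_or u with h | h <;> rw [h]
  · exact Or.inl rfl
  · exact Or.inr (by ring)

/-- **A strict local maximum of the co-level is a co-corner arc** (both walk-neighbours of the plaquette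
lie one co-level lower, so the arc joins its `W` and `S` sides). [folklore] -/
private theorem arcKindOf_eq_coCorner_of_peakM (γ : YBWalk D a z) {r : ℕ} (hr1 : 1 ≤ r) (hr2 : r + 1 < γ.arcs.length)
    (hL : alevM γ (r - 1) = alevM γ r - 1) (hR : alevM γ (r + 1) = alevM γ r - 1) :
    arcKindOf (γ.nth r, γ.nth (r + 1)) = some .coCorner := by
  obtain ⟨f, -, hf⟩ := γ.arc_nth (show r < γ.arcs.length by omega)
  obtain ⟨s, u, hsu, hs, hu, hk⟩ := exists_sides_of_arcFace hf
  simp only at hs hu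
  have e0 : alevM γ r = levM f := arcLevM_of_arcFace hf
  have e1 := alevM_succ_eq γ hr2 hf hu
  obtain ⟨r', rfl⟩ : ∃ r', r = r' + 1 := ⟨r - 1, by omega⟩
  have e2 := alevM_pred_eq γ (i := r') (by omega) hf hs
  rw [show r' + 1 - 1 = r' by omega] at hL
  rw [hk, arcKind_eq_coCorner_of_sideSgnM hsu (by linarith) (by linarith)]

/-- **Peak lemma**: if the co-level on an index interval `[lo, hi]` reaches `M` somewhere while the two
flanking arcs `lo − 1`, `hi + 1` lie below `M`, then some arc of the interval is a strict local
maximum of the co-level, of co-level `≥ M`. [folklore] -/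
private theorem exists_peakM (γ : YBWalk D a z) {lo hi : ℕ} (hlo : 1 ≤ lo) (hlh : lo ≤ hi) (hhi : hi + 1 < γ.arcs.length)
    {M : ℤ} (hL : alevM γ (lo - 1) < M) (hR : alevM γ (hi + 1) < M) (hM : ∃ k, lo ≤ k ∧ k ≤ hi ∧ M ≤ alevM γ k) :
    ∃ r, lo ≤ r ∧ r ≤ hi ∧ alevM γ (r - 1) = alevM γ r - 1 ∧ alevM γ (r + 1) = alevM γ r - 1 ∧ M ≤ alevM γ r := by
  obtain ⟨k, hk1, hk2, hkM⟩ := hM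
  obtain ⟨r, hr, hmax⟩ := Finset.exists_max_image (Finset.Icc lo hi) (alevM γ) ⟨k, Finset.mem_Icc.2 ⟨hk1, hk2⟩⟩
  rw [Finset.mem_Icc] at hr
  have hMr : M ≤ alevM γ r := hkM.trans (hmax k (Finset.mem_Icc.2 ⟨hk1, hk2⟩))
  refine ⟨r, hr.1, hr.2, ?_, ?_, hMr⟩
  · obtain ⟨r', rfl⟩ : ∃ r', r = r' + 1 := ⟨r - 1, by omega⟩
    rw [show r' + 1 - 1 = r' by omega]
    rcases alevM_succ_eq_or γ (i := r') (by omega) with h | h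
    · omega
    · exfalso
      by_cases h' : lo ≤ r'
      · have := hmax r' (Finset.mem_Icc.2 ⟨h', by omega⟩); omega
      · have : r' = lo - 1 := by omega
        subst this; omega
  · rcases alevM_succ_eq_or γ (i := r) (by omega) with h | h
    · exfalso
      by_cases h' : r + 1 ≤ hi
      · have := hmax (r + 1) (Finset.mem_Icc.2 ⟨by omega, h'⟩); omega
      · have : r = hi := by omega
        subst this; omega
    · exact h

/-- ★ **No Yang–Baxter walk doubles all its co-corner plaquettes**: a walk with a co-corner arc has a
plaquette containing exactly one of its arcs, that arc a co-corner arc (so the plaquette weighs `u₂`).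
The mirror image of `exists_kindsIn_eq_corner`, with the co-level `k + j` in place of the co-level. [cite: GlazmanManolescu2019, §1, Fig. 1 (the local configurations u₂ / w₂ of the plaquette walk; the statement itself is not in print)] -/
theorem exists_kindsIn_eq_coCorner (γ : YBWalk D a z) {i : ℕ} (hi : i < γ.arcs.length)
    (hk : arcKindOf (γ.nth i, γ.nth (i + 1)) = some .coCorner) : ∃ g, γ.kindsIn g = [.coCorner] := by
  classical
  -- a co-corner arc `j` of maximal co-level
  set C : Finset ℕ := (Finset.range γ.arcs.length).filter fun j =>
    arcKindOf (γ.nth j, γ.nth (j + 1)) = some .coCorner with hC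
  have hiC : i ∈ C := by rw [hC, Finset.mem_filter, Finset.mem_range]; exact ⟨hi, hk⟩
  obtain ⟨j, hjC, hjmax⟩ := Finset.exists_max_image C (alevM γ) ⟨i, hiC⟩
  rw [hC, Finset.mem_filter, Finset.mem_range] at hjC
  obtain ⟨hj, hjk⟩ := hjC
  obtain ⟨f, -, hf⟩ := γ.arc_nth hj
  have hjlev : alevM γ j = levM f := arcLevM_of_arcFace hf
  have hmemj : (γ.nth j, γ.nth (j + 1)) ∈ (arcsOf γ.mids).filter fun p => arcFace p = some f :=
    List.mem_filter.2 ⟨γ.arc_nth_mem hj, by simpa using hf⟩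
  refine ⟨f, ?_⟩
  rcases filter_face_cases γ f with h0 | ⟨p, h1, hpf⟩ | ⟨p, q, h2, hpq, hpf, hqf, hkk⟩
  · rw [h0] at hmemj; simp at hmemj
  · -- exactly one arc in `f`: it is the co-corner arc `j`
    rw [h1, List.mem_singleton] at hmemj
    refine γ.kindsIn_eq_singleton (γ.arc_nth_mem hj) hf (fun q hq hqf => ?_) hjk
    have : q ∈ (arcsOf γ.mids).filter fun p => arcFace p = some f := List.mem_filter.2 ⟨hq, by simpa using hqf⟩
    rw [h1, List.mem_singleton] at this
    rw [this, hmemj]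
  · -- two arcs in `f`: the other one, `o`, is a co-corner arc too, at some index `m`
    exfalso
    have hmem : ∀ o, o ∈ [p, q] → o ∈ γ.arcs := by
      intro o ho
      have : o ∈ (arcsOf γ.mids).filter fun p => arcFace p = some f := by rw [h2]; exact ho
      exact (List.mem_filter.1 this).1
    obtain ⟨o, hoa, hof, hoj, hok⟩ : ∃ o ∈ γ.arcs, arcFace o = some f ∧ o ≠ (γ.nth j, γ.nth (j + 1)) ∧
        arcKindOf o = some .coCorner := by
      rw [h2] at hmemj
      simp only [List.mem_cons, List.not_mem_nil, or_false] at hmemj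
      rcases hmemj with e | e
      · refine ⟨q, hmem q (by simp), hqf, by rw [e]; exact hpq.symm, ?_⟩
        rw [← hkk, ← e]; exact hjk
      · refine ⟨p, hmem p (by simp), hpf, by rw [e]; exact hpq, ?_⟩
        rw [hkk, ← e]; exact hjk
    obtain ⟨m, hm, hom⟩ := (γ.mem_arcs_iff_nth).1 hoa
    rw [hom] at hof hoj hok
    have hmlev : alevM γ m = levM f := arcLevM_of_arcFace hof
    -- sides: arc `j` = (s, u), arc `m` = (s', u'), four distinct sides of `f`, both pairs corner pairs
    obtain ⟨s, u, hsu, hs, hu, hks⟩ := exists_sides_of_arcFace hf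
    obtain ⟨s', u', hsu', hs', hu', hks'⟩ := exists_sides_of_arcFace hof
    simp only at hs hu hs' hu'
    rw [hks, Option.some.injEq] at hjk
    rw [hks', Option.some.injEq] at hok
    obtain ⟨e11, e12, e21, e22⟩ := arcs_ends_ne γ (γ.arc_nth_mem hj) hoa (Ne.symm (hom ▸ hoj)) hf (hom ▸ hof)
    rw [hom] at e11 e12 e21 e22
    simp only at e11 e12 e21 e22
    rw [← hs, ← hs'] at e11
    rw [← hs, ← hu'] at e12
    rw [← hu, ← hs'] at e21
    rw [← hu, ← hu'] at e22
    have n1 : s ≠ s' := fun e => e11 (by rw [e])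
    have n2 : s ≠ u' := fun e => e12 (by rw [e])
    have n3 : u ≠ s' := fun e => e21 (by rw [e])
    have n4 : u ≠ u' := fun e => e22 (by rw [e])
    have hsg := sideSgnM_eq_of_coCorner hjk
    have hsg' := sideSgnM_eq_of_coCorner hok
    -- `j ≠ m`, and they are not consecutive (consecutive arcs lie in different plaquettes)
    have hjm : j ≠ m := by rintro rfl; exact hoj rfl
    have hjm1 : m ≠ j + 1 := by
      rintro rfl
      exact γ.chain_nth hm (by rw [hf, show j + 1 + 1 = j + 2 from rfl, hof])
    have hmj1 : j ≠ m + 1 := by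
      rintro rfl
      exact γ.chain_nth hj (by rw [hof, show m + 1 + 1 = m + 2 from rfl, hf])
    -- the interval strictly between the two arcs, and a point of co-level `levM f + 1` in it
    have key : ∀ {e e' : ℕ} {σ τ : Side}, e < γ.arcs.length → e' < γ.arcs.length → e ≠ e' → e' ≠ e + 1 →
        e ≠ e' + 1 → arcFace (γ.nth e, γ.nth (e + 1)) = some f → arcFace (γ.nth e', γ.nth (e' + 1)) = some f →
        f.side σ = γ.nth e → f.side τ = γ.nth (e + 1) → sideSgnM σ = 1 → sideSgnM τ = 1 → False := by
      intro e e' σ τ he he' hne h1 h2 hef hef' hσ hτ sσ sτ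
      have le : alevM γ e = levM f := arcLevM_of_arcFace hef
      have le' : alevM γ e' = levM f := arcLevM_of_arcFace hef'
      rcases Nat.lt_or_gt_of_ne hne with hlt | hlt
      · -- `e < e'`: interval `[e+1, e'-1]`, the arc `e+1` has co-level `levM f + 1`
        have hl1 : alevM γ (e + 1) = levM f + 1 := by rw [alevM_succ_eq γ (by omega) hef hτ, sτ]
        obtain ⟨r, hr1, hr2, hrL, hrR, hrM⟩ := exists_peakM γ (lo := e + 1) (hi := e' - 1) (M := levM f + 1)
          (by omega) (by omega) (by rw [show e' - 1 + 1 = e' by omega]; exact he')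
          (by rw [show e + 1 - 1 = e by omega, le]; linarith)
          (by rw [show e' - 1 + 1 = e' by omega, le']; linarith) ⟨e + 1, le_rfl, by omega, hl1.ge⟩
        have hrc := arcKindOf_eq_coCorner_of_peakM γ (by omega) (by omega) hrL hrR
        have hrC : r ∈ C := by rw [hC, Finset.mem_filter, Finset.mem_range]; exact ⟨by omega, hrc⟩
        have := hjmax r hrC
        rw [hjlev] at this
        linarith
      · -- `e' < e`: interval `[e'+1, e-1]`, the arc `e-1` has co-level `levM f + 1`
        obtain ⟨e₀, rfl⟩ : ∃ e₀, e = e₀ + 1 := ⟨e - 1, by omega⟩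
        have hl1 : alevM γ e₀ = levM f + 1 := by rw [alevM_pred_eq γ (by omega) hef hσ, sσ]
        obtain ⟨r, hr1, hr2, hrL, hrR, hrM⟩ := exists_peakM γ (lo := e' + 1) (hi := e₀) (M := levM f + 1)
          (by omega) (by omega) (by omega)
          (by rw [show e' + 1 - 1 = e' by omega, le']; linarith)
          (by rw [le]; linarith) ⟨e₀, by omega, le_rfl, hl1.ge⟩
        have hrc := arcKindOf_eq_coCorner_of_peakM γ (by omega) (by omega) hrL hrR
        have hrC : r ∈ C := by rw [hC, Finset.mem_filter, Finset.mem_range]; exact ⟨by omega, hrc⟩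
        have := hjmax r hrC
        rw [hjlev] at this
        linarith
    rcases sideSgnM_pos_of_four hsu hsu' n1 n2 n3 n4 hsg hsg' with h | h
    · exact key hj hm hjm hjm1 hmj1 hf hof hs hu h (hsg ▸ h)
    · exact key hm hj (Ne.symm hjm) hmj1 hjm1 hof hf hs' hu' h (hsg' ▸ h)

variable {Dl : List Face} {f₀ : Face} {W : CWeights} {t : ℂ} {c : Fin 4 → ℂ}

/-! #### The branch `u₁ = 0` -/

/-- ★ in membership form: a walk with a corner arc has a plaquette carrying exactly one of its arcs, a
corner arc. [cite: GlazmanManolescu2019, §1, Fig. 1 (the local configurations u₁ / w₁ of the plaquette walk; the statement itself is not in print)] -/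
theorem exists_kindsIn_eq_corner_of_mem (γ : YBWalk D a z) {p : MidEdge × MidEdge} (hp : p ∈ γ.arcs)
    (hk : arcKindOf p = some .corner) : ∃ g, γ.kindsIn g = [.corner] := by
  obtain ⟨i, hi, rfl⟩ := (γ.mem_arcs_iff_nth).1 hp
  exact exists_kindsIn_eq_corner γ hi hk

/-- A plaquette carrying exactly one arc, a corner arc, kills the exterior weight at any other
plaquette when `u₁ = 0`. [cite: GlazmanManolescu2019, §1, Fig. 1, eq. (1) (one corner arc weighs u₁)] -/
theorem extW_eq_zero_of_kindsIn_corner {W : CWeights} (h1 : W.u₁ = 0) (γ : YBWalk D a z) {f₀ g : Face}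
    (hg : γ.kindsIn g = [.corner]) (hgf : g ≠ f₀) : extW W γ f₀ = 0 := by
  have hgmem : g ∈ γ.facesVisited := by
    by_contra h
    rw [YBWalk.kindsIn_eq_nil h] at hg
    exact List.cons_ne_nil _ _ hg.symm
  exact Finset.prod_eq_zero (Finset.mem_erase.2 ⟨hgf, hgmem⟩) (by rw [hg, locW_single, arcW, h1])

/-- ★ **Sufficiency on the whole branch `u₁ = 0`** (ANY `u₂, v, w₁, w₂`): every coefficient vector
satisfying the four group-one rows is an exact vertex relation at EVERY face of EVERY finite face list
for EVERY boundary root. Compared with `exactPlaquetteVertexRelation_of_u₁_w₁_eq_zero` the hypothesis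
`w₁ = 0` is gone: a doubled corner plaquette may weigh `w₁ ≠ 0`, but a walk that doubles a corner
plaquette — or returns to any plaquette at all — has a corner arc, hence (no walk doubles all its
corner plaquettes, `exists_kindsIn_eq_corner`) a plaquette weighing `u₁ = 0` elsewhere, so its whole
group has exterior weight `0`; the remaining groups are fresh arrivals = the group-one rows.
[cite: Glazman2015WeightedSAW, Lemma 3.1 (proof: the one-visit group, eq. (3.11))] -/
theorem exactPlaquetteVertexRelation_of_u₁_eq_zero (ht : t ≠ 0) (h1 : W.u₁ = 0)
    (hrow : ∀ p : Side, ∑ x : Side, c (slotIdx x) * arcW W (arcKind p x) * t ^ qTurn p x = 0) :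
    ExactPlaquetteVertexRelation W t c := by
  intro Dl a f₀ hf ha
  rw [vertexFunctional_eq_sum_term, sum_eq_sum_bracket hf]
  refine Finset.sum_eq_zero fun ω hω => ?_
  have h : ¬ω.IsExt := by simpa [setArr] using hω
  -- generic expansion of the group of `ω` (as in `bracket_eq_zero`)
  set p := ω.1 with hp
  set E := extW W ω.2 f₀ with hE
  set T := t ^ quarterTurnsL ω.2.mids with hT
  have hself : term W t c ω = c (slotIdx p) * (E * locW W (ω.2.kindsIn f₀) * T) := by
    rw [term, weightL_eq_extW_mul]
  have hext : ∀ x ∈ ω.admSet, term W t c (ω.ext hf x) =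
      E * T * (c (slotIdx x) * locW W (ω.2.kindsIn f₀ ++ [arcKind p x]) * t ^ qTurn p x) := by
    intro x hx
    have hx' : ω.Adm x := mem_admSet.1 hx
    have harcs := ext_snd_arcs hf h hx'
    have hpx : p ≠ x := Ne.symm hx'.1
    have hfa : arcFace (f₀.side p, f₀.side x) = some f₀ := arcFace_side_side f₀ p x hpx
    rw [term, weightL_eq_extW_mul W _ f₀, extW_of_snoc W ω.2 _ f₀ harcs hfa,
      YBWalk.kindsIn_of_snoc ω.2 _ f₀ harcs hfa, arcKindOf_eq hfa rfl rfl,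
      quarterTurnsL_of_snoc ω.2 _ harcs, qTurnOf_side_side f₀ hpx, zpow_add₀ ht, ext_fst hf h hx']
    simp only [List.reduceOption_cons_of_some, List.reduceOption_nil]
    ring
  -- the exterior weight of an admissible extension is `E`, and the extension keeps the kinds outside `f₀`
  have hextE : ∀ x ∈ ω.admSet, ∀ g, g ≠ f₀ → (ω.ext hf x).2.kindsIn g = ω.2.kindsIn g := by
    intro x hx g hg
    have hx' : ω.Adm x := mem_admSet.1 hx
    exact YBWalk.kindsIn_of_snoc_of_ne ω.2 _ f₀ (ext_snd_arcs hf h hx')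
      (arcFace_side_side f₀ p x (Ne.symm hx'.1)) hg
  rw [hself, Finset.sum_congr rfl hext, ← Finset.mul_sum]
  have hfilt : ∀ {i : ℕ}, i < ω.2.arcs.length → arcFace (ω.2.nth i, ω.2.nth (i + 1)) = some f₀ →
      (ω.2.nth i, ω.2.nth (i + 1)) ∈ (arcsOf ω.2.mids).filter fun q => arcFace q = some f₀ :=
    fun hi e => List.mem_filter.2 ⟨ω.2.arc_nth_mem hi, by simpa using e⟩
  rcases filter_face_cases ω.2 f₀ with h0 | ⟨q₁, hq1, hq₁⟩ | ⟨q₁, q₂, h2, hne, hq₁, hq₂, -⟩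
  · -- fresh plaquette: the group-one row
    have hK : ω.2.kindsIn f₀ = [] := by rw [kindsIn_eq_filterMap_filter, h0]; rfl
    have hno : ∀ i < ω.2.arcs.length, arcFace (ω.2.nth i, ω.2.nth (i + 1)) ≠ some f₀ := by
      intro i hi e
      have := hfilt hi e
      rw [h0] at this
      simp at this
    have hadm : ω.admSet = Finset.univ.erase p := by
      ext x
      simp only [mem_admSet, Finset.mem_erase, Finset.mem_univ, and_true]
      exact ⟨fun hx => hx.1, fun hx => adm_of_no_arc hf ha h hno hx⟩
    rw [hK, hadm]
    have key := hrow p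
    rw [← Finset.add_sum_erase _ _ (Finset.mem_univ p), arcKind_self, qTurn_self] at key
    simp only [List.nil_append, locW_single, locW_nil, arcW, zpow_zero, mul_one] at key ⊢
    linear_combination E * T * key
  · -- one earlier arc `q₁` in `f₀`, at index `i`
    have hq₁m : q₁ ∈ ω.2.arcs := by
      have : q₁ ∈ (arcsOf ω.2.mids).filter fun q => arcFace q = some f₀ := by rw [hq1]; simp
      exact (List.mem_filter.1 this).1
    obtain ⟨s₁, s₂, h12, hs₁, hs₂, hk⟩ := exists_sides_of_arcFace hq₁
    obtain ⟨i, hi, hqi⟩ := (ω.2.mem_arcs_iff_nth).1 hq₁m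
    have hK : ω.2.kindsIn f₀ = [arcKind s₁ s₂] := by
      rw [kindsIn_eq_filterMap_filter, hq1, List.filterMap_cons, hk, List.filterMap_nil]
    rw [hK]
    by_cases hkc : arcKind s₁ s₂ = .corner
    · -- a corner arc in `f₀`: the walk weighs `u₁ = 0` there; an admissible completion DOUBLES the corner
      -- plaquette `f₀`, so the completed walk has a single corner plaquette `g ≠ f₀`: `E = 0`
      have hE0 : ∀ x ∈ ω.admSet, E = 0 := by
        intro x hx
        have hx' : ω.Adm x := mem_admSet.1 hx
        have harcs := ext_snd_arcs hf h hx'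
        have hq₁m' : q₁ ∈ (ω.ext hf x).2.arcs := by rw [harcs]; exact List.mem_append_left _ hq₁m
        obtain ⟨g, hg⟩ := exists_kindsIn_eq_corner_of_mem _ hq₁m' (by rw [hk, hkc])
        have hfa : arcFace (f₀.side p, f₀.side x) = some f₀ := arcFace_side_side f₀ p x (Ne.symm hx'.1)
        have hgf : g ≠ f₀ := by
          intro e
          rw [e, YBWalk.kindsIn_of_snoc ω.2 _ f₀ harcs hfa, hK, arcKindOf_eq hfa rfl rfl] at hg
          simp at hg
        rw [hextE x hx g hgf] at hg
        exact extW_eq_zero_of_kindsIn_corner h1 ω.2 hg hgf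
      rw [hkc]
      have hu : locW W [ArcKind.corner] = 0 := by rw [locW_single, arcW, h1]
      rw [hu]
      by_cases hne : ω.admSet = ∅
      · rw [hne, Finset.sum_empty]; ring
      · obtain ⟨x, hx⟩ := Finset.nonempty_iff_ne_empty.2 hne
        rw [hE0 x hx]; ring
    · -- otherwise the walk returned to `f₀`, so it is not corner-free; by ★ some plaquette `g` carries a
      -- single corner arc, `g ≠ f₀` (whose only arc is not a corner): `E = 0`
      have hncf : ¬CornerFree ω.2 := fun hcf =>
        no_arc_of_cornerFree ω h hcf i hi (by rw [← hqi]; exact hq₁)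
      simp only [CornerFree, not_forall, not_not, exists_prop] at hncf
      obtain ⟨j, hj, hkj⟩ := hncf
      obtain ⟨g, hg⟩ := exists_kindsIn_eq_corner ω.2 hj hkj
      have hgf : g ≠ f₀ := by
        rintro rfl
        rw [hK] at hg
        exact hkc (List.singleton_injective hg)
      have hE0 : E = 0 := extW_eq_zero_of_kindsIn_corner h1 ω.2 hg hgf
      rw [hE0]
      ring
  · -- two arcs in `f₀`: impossible for an arrival
    exfalso
    have hm : ∀ q, q ∈ [q₁, q₂] → q ∈ ω.2.arcs := by
      intro q hq
      have : q ∈ (arcsOf ω.2.mids).filter fun q => arcFace q = some f₀ := by rw [h2]; exact hq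
      exact (List.mem_filter.1 this).1
    have hq₁m := hm q₁ (by simp)
    have hq₂m := hm q₂ (by simp)
    obtain ⟨e11, e12, e21, e22⟩ := arcs_ends_ne ω.2 hq₁m hq₂m hne hq₁ hq₂
    obtain ⟨s₁, s₂, h12, hs₁, hs₂, -⟩ := exists_sides_of_arcFace hq₁
    obtain ⟨s₃, s₄, h34, hs₃, hs₄, -⟩ := exists_sides_of_arcFace hq₂
    obtain ⟨i, hi, hqi⟩ := (ω.2.mem_arcs_iff_nth).1 hq₁m
    obtain ⟨j, hj, hqj⟩ := (ω.2.mem_arcs_iff_nth).1 hq₂m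
    obtain ⟨hne₁, hne₂⟩ := ends_ne_of_arc h hi (by rw [← hqi]; exact hq₁)
    obtain ⟨hne₃, hne₄⟩ := ends_ne_of_arc h hj (by rw [← hqj]; exact hq₂)
    rw [hqi] at hs₁ hs₂
    rw [hqj] at hs₃ hs₄
    rw [hqi, hqj] at e11 e12 e21 e22
    simp only at hs₁ hs₂ hs₃ hs₄ e11 e12 e21 e22
    rw [← hs₁] at e11 e12 hne₁
    rw [← hs₂] at e21 e22 hne₂
    rw [← hs₃] at e11 e21 hne₃
    rw [← hs₄] at e12 e22 hne₄
    have n13 : s₁ ≠ s₃ := fun e => e11 (by rw [e])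
    have n14 : s₁ ≠ s₄ := fun e => e12 (by rw [e])
    have n23 : s₂ ≠ s₃ := fun e => e21 (by rw [e])
    have n24 : s₂ ≠ s₄ := fun e => e22 (by rw [e])
    have n1 : ω.1 ≠ s₁ := fun e => hne₁ (by rw [e])
    have n2 : ω.1 ≠ s₂ := fun e => hne₂ (by rw [e])
    have n3 : ω.1 ≠ s₃ := fun e => hne₃ (by rw [e])
    have n4 : ω.1 ≠ s₄ := fun e => hne₄ (by rw [e])
    exact side_five h12 n13 n14 n23 n24 h34 n1 n2 n3 n4

/-- ★★ **Two-sided classification of the whole branch `u₁ = 0`** (ANY `u₂, v, w₁, w₂ ∈ ℂ`, any phase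
`t ≠ 0`): a nonzero exact vertex relation on every finite face list for every boundary root exists iff
`(1+v−u₂)(1+v+u₂)(1−v−u₂)(1−v+u₂) = 0`. This closes the sliver `{u₁ = 0, w₁ ≠ 0}` left open by
`exactPlaquetteVertexRelation_iff_quartic`: the weight `w₁` of a doubled corner plaquette is invisible to
the class, because no Yang–Baxter walk doubles all its corner plaquettes.
[cite: Glazman2015WeightedSAW, Lemma 3.1 (proof: "solving this linear system")] -/
theorem exactPlaquetteVertexRelation_iff_quartic_of_u₁_eq_zero (W : CWeights) {t : ℂ} (ht : t ≠ 0)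
    (h1 : W.u₁ = 0) :
    (∃ c : Fin 4 → ℂ, c ≠ 0 ∧ ExactPlaquetteVertexRelation W t c) ↔
      (1 + W.v - W.u₂) * (1 + W.v + W.u₂) * (1 - W.v - W.u₂) * (1 - W.v + W.u₂) = 0 := by
  constructor
  · rintro ⟨c, hc, hrel⟩
    exact quartic_eq_zero_of_exactPlaquetteVertexRelation_of_u₁_eq_zero hrel ht h1 hc
  · intro hq
    have hq' : (1 + W.v) ^ 2 - W.u₂ ^ 2 = 0 ∨ (1 - W.v) ^ 2 - W.u₂ ^ 2 = 0 := by
      have : ((1 + W.v) ^ 2 - W.u₂ ^ 2) * ((1 - W.v) ^ 2 - W.u₂ ^ 2) = 0 := by linear_combination hq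
      exact mul_eq_zero.1 this
    rcases hq' with hA | hB
    · by_cases hz : W.u₂ = 0 ∧ 1 + W.v = 0
      · refine ⟨![1, 0, 1, 0], fun h0 => ?_,
          exactPlaquetteVertexRelation_of_u₁_eq_zero ht h1 (rows_sym0 h1 hz.1 hz.2)⟩
        have := congrFun h0 0
        simp at this
      · refine ⟨![W.u₂, -(1 + W.v) * t, W.u₂, -(1 + W.v) * t], fun h0 => hz ?_,
          exactPlaquetteVertexRelation_of_u₁_eq_zero ht h1 (rows_sym ht h1 (by linear_combination hA))⟩
        have e0 := congrFun h0 0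
        have e1 := congrFun h0 1
        simp only [Matrix.cons_val_zero, Matrix.cons_val_one, Pi.zero_apply, neg_mul,
          neg_eq_zero, mul_eq_zero] at e0 e1
        exact ⟨e0, e1.resolve_right ht⟩
    · by_cases hz : W.u₂ = 0 ∧ 1 - W.v = 0
      · refine ⟨![1, 0, -1, 0], fun h0 => ?_,
          exactPlaquetteVertexRelation_of_u₁_eq_zero ht h1 (rows_antisym0 h1 hz.1 hz.2)⟩
        have := congrFun h0 0
        simp at this
      · refine ⟨![W.u₂, -(1 - W.v) * t, -W.u₂, (1 - W.v) * t], fun h0 => hz ?_,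
          exactPlaquetteVertexRelation_of_u₁_eq_zero ht h1 (rows_antisym ht h1 (by linear_combination hB))⟩
        have e0 := congrFun h0 0
        have e1 := congrFun h0 1
        simp only [Matrix.cons_val_zero, Matrix.cons_val_one, Pi.zero_apply, neg_mul,
          neg_eq_zero, mul_eq_zero] at e0 e1
        exact ⟨e0, e1.resolve_right ht⟩

/-- **Barrier `PlaquetteWalkCornerBranchClassification`** (named statement): on the whole branch `u₁ = 0`
of the five-weight plaquette walk on `ℤ²` (`u₂, v, w₁, w₂` arbitrary complex, any phase `t ≠ 0`) the
all-boundary-roots technique class is classified two-sidedly: a nonzero exact constant-coefficient vertex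
relation exists iff `(1+v−u₂)(1+v+u₂)(1−v−u₂)(1−v+u₂) = 0`. A THEOREM of this file
(`PlaquetteWalkCornerBranchClassification_holds`); it supersedes `PlaquetteWalkDirectedCornerClassification`
(`w₁ = 0`).

BARRIER (structured block, D-0021):
- technique_class: plaquette-local linear vertex relations `Σ_{s ∈ (E,N,W,S)} c_s F(z_s) = 0`, constant `c ∈ ℂ⁴ ∖ {0}`, for the Glazman–Manolescu plaquette walk on `ℤ²` with complex weights `(0, u₂, v, w₁, w₂)` and phase `t ≠ 0` per left quarter turn, at every face of every finite face list for every boundary root — `ExactPlaquetteVertexRelation W t c`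
- blocks: any such identity off the quartic `(1 ± v)² = u₂²`; conversely it PROVIDES the identity on the quartic at EVERY phase and for EVERY `w₁` (the doubled-corner weight is invisible: no walk of nonzero weight ever doubles a corner plaquette, since it would need a single corner plaquette elsewhere)
- because: necessity = the four one-plaquette rows (`quartic_eq_zero_of_exactPlaquetteVertexRelation_of_u₁_eq_zero`); sufficiency = `exactPlaquetteVertexRelation_of_u₁_eq_zero`: a returning walk has a corner arc (`ΩF.no_arc_of_cornerFree`), hence a plaquette weighing `u₁ = 0` (`exists_kindsIn_eq_corner`: the corner arc of maximal level `k − j` sits alone in its plaquette), so only fresh arrivals contribute — the group-one rows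
- evasions_known: `u₁ ≠ 0` (then `PlaquetteWalkDegenerateClassification` on `v = 0` / `PlaquetteWalkNoAllRootsRelation` on `v ≠ 0`); the mirror branch `u₂ = 0` is `PlaquetteWalkMirrorBranchClassification` below; non-constant or root-dependent coefficients
- scope_caveats: EXACT constant-coefficient identities of the five-weight plaquette class only
- status: established — `PlaquetteWalkCornerBranchClassification_holds` (this file); not located in print [cite: Glazman2015WeightedSAW, Lemma 3.1]
[cite: Glazman2015WeightedSAW, Lemma 3.1] -/
def _root_.Literature.Barriers.CriticalPhenomena.PlaquetteWalkCornerBranchClassification : Prop :=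
  ∀ (W : CWeights) (t : ℂ), t ≠ 0 → W.u₁ = 0 →
    ((∃ c : Fin 4 → ℂ, c ≠ 0 ∧ ExactPlaquetteVertexRelation W t c) ↔
      (1 + W.v - W.u₂) * (1 + W.v + W.u₂) * (1 - W.v - W.u₂) * (1 - W.v + W.u₂) = 0)

/-- **`PlaquetteWalkCornerBranchClassification` holds.** [cite: Glazman2015WeightedSAW, Lemma 3.1] -/
theorem _root_.Literature.Barriers.CriticalPhenomena.PlaquetteWalkCornerBranchClassification_holds :
    PlaquetteWalkCornerBranchClassification :=
  fun W _ ht h1 => exactPlaquetteVertexRelation_iff_quartic_of_u₁_eq_zero W ht h1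

/-! #### The branch `u₂ = 0` -/

/-- ★ in membership form (mirror): a walk with a co-corner arc has a plaquette carrying exactly one of
its arcs, a co-corner arc. [cite: GlazmanManolescu2019, §1, Fig. 1 (the local configurations u₂ / w₂ of the plaquette walk; the statement itself is not in print)] -/
theorem exists_kindsIn_eq_coCorner_of_mem (γ : YBWalk D a z) {p : MidEdge × MidEdge} (hp : p ∈ γ.arcs)
    (hk : arcKindOf p = some .coCorner) : ∃ g, γ.kindsIn g = [.coCorner] := by
  obtain ⟨i, hi, rfl⟩ := (γ.mem_arcs_iff_nth).1 hp
  exact exists_kindsIn_eq_coCorner γ hi hk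

/-- A plaquette carrying exactly one arc, a co-corner arc, kills the exterior weight at any other
plaquette when `u₂ = 0`. [cite: GlazmanManolescu2019, §1, Fig. 1, eq. (1) (one co-corner arc weighs u₂)] -/
theorem extW_eq_zero_of_kindsIn_coCorner {W : CWeights} (h2 : W.u₂ = 0) (γ : YBWalk D a z) {f₀ g : Face}
    (hg : γ.kindsIn g = [.coCorner]) (hgf : g ≠ f₀) : extW W γ f₀ = 0 := by
  have hgmem : g ∈ γ.facesVisited := by
    by_contra h
    rw [YBWalk.kindsIn_eq_nil h] at hg
    exact List.cons_ne_nil _ _ hg.symm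
  exact Finset.prod_eq_zero (Finset.mem_erase.2 ⟨hgf, hgmem⟩) (by rw [hg, locW_single, arcW, h2])

/-- ★ **Sufficiency on the whole branch `u₂ = 0`** (ANY `u₁, v, w₁, w₂`): the mirror image of
`exactPlaquetteVertexRelation_of_u₁_eq_zero` — the hypothesis `w₂ = 0` of
`exactPlaquetteVertexRelation_of_u₂_w₂_eq_zero` is gone (no walk doubles all its co-corner plaquettes,
`exists_kindsIn_eq_coCorner`).
[cite: Glazman2015WeightedSAW, Lemma 3.1 (proof: the one-visit group, eq. (3.11))] -/
theorem exactPlaquetteVertexRelation_of_u₂_eq_zero (ht : t ≠ 0) (h2 : W.u₂ = 0)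
    (hrow : ∀ p : Side, ∑ x : Side, c (slotIdx x) * arcW W (arcKind p x) * t ^ qTurn p x = 0) :
    ExactPlaquetteVertexRelation W t c := by
  intro Dl a f₀ hf ha
  rw [vertexFunctional_eq_sum_term, sum_eq_sum_bracket hf]
  refine Finset.sum_eq_zero fun ω hω => ?_
  have h : ¬ω.IsExt := by simpa [setArr] using hω
  -- generic expansion of the group of `ω` (as in `bracket_eq_zero`)
  set p := ω.1 with hp
  set E := extW W ω.2 f₀ with hE
  set T := t ^ quarterTurnsL ω.2.mids with hT
  have hself : term W t c ω = c (slotIdx p) * (E * locW W (ω.2.kindsIn f₀) * T) := by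
    rw [term, weightL_eq_extW_mul]
  have hext : ∀ x ∈ ω.admSet, term W t c (ω.ext hf x) =
      E * T * (c (slotIdx x) * locW W (ω.2.kindsIn f₀ ++ [arcKind p x]) * t ^ qTurn p x) := by
    intro x hx
    have hx' : ω.Adm x := mem_admSet.1 hx
    have harcs := ext_snd_arcs hf h hx'
    have hpx : p ≠ x := Ne.symm hx'.1
    have hfa : arcFace (f₀.side p, f₀.side x) = some f₀ := arcFace_side_side f₀ p x hpx
    rw [term, weightL_eq_extW_mul W _ f₀, extW_of_snoc W ω.2 _ f₀ harcs hfa,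
      YBWalk.kindsIn_of_snoc ω.2 _ f₀ harcs hfa, arcKindOf_eq hfa rfl rfl,
      quarterTurnsL_of_snoc ω.2 _ harcs, qTurnOf_side_side f₀ hpx, zpow_add₀ ht, ext_fst hf h hx']
    simp only [List.reduceOption_cons_of_some, List.reduceOption_nil]
    ring
  -- the exterior weight of an admissible extension is `E`, and the extension keeps the kinds outside `f₀`
  have hextE : ∀ x ∈ ω.admSet, ∀ g, g ≠ f₀ → (ω.ext hf x).2.kindsIn g = ω.2.kindsIn g := by
    intro x hx g hg
    have hx' : ω.Adm x := mem_admSet.1 hx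
    exact YBWalk.kindsIn_of_snoc_of_ne ω.2 _ f₀ (ext_snd_arcs hf h hx')
      (arcFace_side_side f₀ p x (Ne.symm hx'.1)) hg
  rw [hself, Finset.sum_congr rfl hext, ← Finset.mul_sum]
  have hfilt : ∀ {i : ℕ}, i < ω.2.arcs.length → arcFace (ω.2.nth i, ω.2.nth (i + 1)) = some f₀ →
      (ω.2.nth i, ω.2.nth (i + 1)) ∈ (arcsOf ω.2.mids).filter fun q => arcFace q = some f₀ :=
    fun hi e => List.mem_filter.2 ⟨ω.2.arc_nth_mem hi, by simpa using e⟩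
  rcases filter_face_cases ω.2 f₀ with h0 | ⟨q₁, hq1, hq₁⟩ | ⟨q₁, q₂, h2, hne, hq₁, hq₂, -⟩
  · -- fresh plaquette: the group-one row
    have hK : ω.2.kindsIn f₀ = [] := by rw [kindsIn_eq_filterMap_filter, h0]; rfl
    have hno : ∀ i < ω.2.arcs.length, arcFace (ω.2.nth i, ω.2.nth (i + 1)) ≠ some f₀ := by
      intro i hi e
      have := hfilt hi e
      rw [h0] at this
      simp at this
    have hadm : ω.admSet = Finset.univ.erase p := by
      ext x
      simp only [mem_admSet, Finset.mem_erase, Finset.mem_univ, and_true]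
      exact ⟨fun hx => hx.1, fun hx => adm_of_no_arc hf ha h hno hx⟩
    rw [hK, hadm]
    have key := hrow p
    rw [← Finset.add_sum_erase _ _ (Finset.mem_univ p), arcKind_self, qTurn_self] at key
    simp only [List.nil_append, locW_single, locW_nil, arcW, zpow_zero, mul_one] at key ⊢
    linear_combination E * T * key
  · -- one earlier arc `q₁` in `f₀`, at index `i`
    have hq₁m : q₁ ∈ ω.2.arcs := by
      have : q₁ ∈ (arcsOf ω.2.mids).filter fun q => arcFace q = some f₀ := by rw [hq1]; simp
      exact (List.mem_filter.1 this).1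
    obtain ⟨s₁, s₂, h12, hs₁, hs₂, hk⟩ := exists_sides_of_arcFace hq₁
    obtain ⟨i, hi, hqi⟩ := (ω.2.mem_arcs_iff_nth).1 hq₁m
    have hK : ω.2.kindsIn f₀ = [arcKind s₁ s₂] := by
      rw [kindsIn_eq_filterMap_filter, hq1, List.filterMap_cons, hk, List.filterMap_nil]
    rw [hK]
    by_cases hkc : arcKind s₁ s₂ = .coCorner
    · -- a co-corner arc in `f₀`: the walk weighs `u₂ = 0` there; an admissible completion DOUBLES the co-corner
      -- plaquette `f₀`, so the completed walk has a single co-corner plaquette `g ≠ f₀`: `E = 0`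
      have hE0 : ∀ x ∈ ω.admSet, E = 0 := by
        intro x hx
        have hx' : ω.Adm x := mem_admSet.1 hx
        have harcs := ext_snd_arcs hf h hx'
        have hq₁m' : q₁ ∈ (ω.ext hf x).2.arcs := by rw [harcs]; exact List.mem_append_left _ hq₁m
        obtain ⟨g, hg⟩ := exists_kindsIn_eq_coCorner_of_mem _ hq₁m' (by rw [hk, hkc])
        have hfa : arcFace (f₀.side p, f₀.side x) = some f₀ := arcFace_side_side f₀ p x (Ne.symm hx'.1)
        have hgf : g ≠ f₀ := by
          intro e
          rw [e, YBWalk.kindsIn_of_snoc ω.2 _ f₀ harcs hfa, hK, arcKindOf_eq hfa rfl rfl] at hg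
          simp at hg
        rw [hextE x hx g hgf] at hg
        exact extW_eq_zero_of_kindsIn_coCorner h2 ω.2 hg hgf
      rw [hkc]
      have hu : locW W [ArcKind.coCorner] = 0 := by rw [locW_single, arcW, h2]
      rw [hu]
      by_cases hne : ω.admSet = ∅
      · rw [hne, Finset.sum_empty]; ring
      · obtain ⟨x, hx⟩ := Finset.nonempty_iff_ne_empty.2 hne
        rw [hE0 x hx]; ring
    · -- otherwise the walk returned to `f₀`, so it is not co-corner-free; by ★ some plaquette `g` carries a
      -- single co-corner arc, `g ≠ f₀` (whose only arc is not a co-corner): `E = 0`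
      have hncf : ¬CoCornerFree ω.2 := fun hcf =>
        no_arc_of_coCornerFree ω h hcf i hi (by rw [← hqi]; exact hq₁)
      simp only [CoCornerFree, not_forall, not_not, exists_prop] at hncf
      obtain ⟨j, hj, hkj⟩ := hncf
      obtain ⟨g, hg⟩ := exists_kindsIn_eq_coCorner ω.2 hj hkj
      have hgf : g ≠ f₀ := by
        rintro rfl
        rw [hK] at hg
        exact hkc (List.singleton_injective hg)
      have hE0 : E = 0 := extW_eq_zero_of_kindsIn_coCorner h2 ω.2 hg hgf
      rw [hE0]
      ring
  · -- two arcs in `f₀`: impossible for an arrival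
    exfalso
    have hm : ∀ q, q ∈ [q₁, q₂] → q ∈ ω.2.arcs := by
      intro q hq
      have : q ∈ (arcsOf ω.2.mids).filter fun q => arcFace q = some f₀ := by rw [h2]; exact hq
      exact (List.mem_filter.1 this).1
    have hq₁m := hm q₁ (by simp)
    have hq₂m := hm q₂ (by simp)
    obtain ⟨e11, e12, e21, e22⟩ := arcs_ends_ne ω.2 hq₁m hq₂m hne hq₁ hq₂
    obtain ⟨s₁, s₂, h12, hs₁, hs₂, -⟩ := exists_sides_of_arcFace hq₁
    obtain ⟨s₃, s₄, h34, hs₃, hs₄, -⟩ := exists_sides_of_arcFace hq₂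
    obtain ⟨i, hi, hqi⟩ := (ω.2.mem_arcs_iff_nth).1 hq₁m
    obtain ⟨j, hj, hqj⟩ := (ω.2.mem_arcs_iff_nth).1 hq₂m
    obtain ⟨hne₁, hne₂⟩ := ends_ne_of_arc h hi (by rw [← hqi]; exact hq₁)
    obtain ⟨hne₃, hne₄⟩ := ends_ne_of_arc h hj (by rw [← hqj]; exact hq₂)
    rw [hqi] at hs₁ hs₂
    rw [hqj] at hs₃ hs₄
    rw [hqi, hqj] at e11 e12 e21 e22
    simp only at hs₁ hs₂ hs₃ hs₄ e11 e12 e21 e22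
    rw [← hs₁] at e11 e12 hne₁
    rw [← hs₂] at e21 e22 hne₂
    rw [← hs₃] at e11 e21 hne₃
    rw [← hs₄] at e12 e22 hne₄
    have n13 : s₁ ≠ s₃ := fun e => e11 (by rw [e])
    have n14 : s₁ ≠ s₄ := fun e => e12 (by rw [e])
    have n23 : s₂ ≠ s₃ := fun e => e21 (by rw [e])
    have n24 : s₂ ≠ s₄ := fun e => e22 (by rw [e])
    have n1 : ω.1 ≠ s₁ := fun e => hne₁ (by rw [e])
    have n2 : ω.1 ≠ s₂ := fun e => hne₂ (by rw [e])
    have n3 : ω.1 ≠ s₃ := fun e => hne₃ (by rw [e])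
    have n4 : ω.1 ≠ s₄ := fun e => hne₄ (by rw [e])
    exact side_five h12 n13 n14 n23 n24 h34 n1 n2 n3 n4

/-- ★★ **Two-sided classification of the whole branch `u₂ = 0`** (ANY `u₁, v, w₁, w₂ ∈ ℂ`, any phase
`t ≠ 0`): a nonzero exact vertex relation exists iff `(1+v−u₁)(1+v+u₁)(1−v−u₁)(1−v+u₁) = 0` — the
sliver `{u₂ = 0, w₂ ≠ 0}` of `exactPlaquetteVertexRelation_iff_quartic'` closed.
[cite: Glazman2015WeightedSAW, Lemma 3.1 (proof: "solving this linear system")] -/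
theorem exactPlaquetteVertexRelation_iff_quartic_of_u₂_eq_zero (W : CWeights) {t : ℂ} (ht : t ≠ 0)
    (h2 : W.u₂ = 0) :
    (∃ c : Fin 4 → ℂ, c ≠ 0 ∧ ExactPlaquetteVertexRelation W t c) ↔
      (1 + W.v - W.u₁) * (1 + W.v + W.u₁) * (1 - W.v - W.u₁) * (1 - W.v + W.u₁) = 0 := by
  constructor
  · rintro ⟨c, hc, hrel⟩
    exact quartic_eq_zero_of_exactPlaquetteVertexRelation_of_u₂_eq_zero hrel ht h2 hc
  · intro hq
    have hq' : (1 + W.v) ^ 2 - W.u₁ ^ 2 = 0 ∨ (1 - W.v) ^ 2 - W.u₁ ^ 2 = 0 := by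
      have : ((1 + W.v) ^ 2 - W.u₁ ^ 2) * ((1 - W.v) ^ 2 - W.u₁ ^ 2) = 0 := by linear_combination hq
      exact mul_eq_zero.1 this
    rcases hq' with hA | hB
    · by_cases hz : W.u₁ = 0 ∧ 1 + W.v = 0
      · refine ⟨![1, 0, 1, 0], fun h0 => ?_,
          exactPlaquetteVertexRelation_of_u₂_eq_zero ht h2 (rows_sym0' h2 hz.1 hz.2)⟩
        have := congrFun h0 0
        simp at this
      · refine ⟨![(1 + W.v) * t, -W.u₁, (1 + W.v) * t, -W.u₁], fun h0 => hz ?_,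
          exactPlaquetteVertexRelation_of_u₂_eq_zero ht h2 (rows_sym' ht h2 (by linear_combination hA))⟩
        have e0 := congrFun h0 0
        have e1 := congrFun h0 1
        simp only [Matrix.cons_val_zero, Matrix.cons_val_one, Pi.zero_apply, neg_eq_zero, mul_eq_zero] at e0 e1
        exact ⟨e1, e0.resolve_right ht⟩
    · by_cases hz : W.u₁ = 0 ∧ 1 - W.v = 0
      · refine ⟨![1, 0, -1, 0], fun h0 => ?_,
          exactPlaquetteVertexRelation_of_u₂_eq_zero ht h2 (rows_antisym0' h2 hz.1 hz.2)⟩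
        have := congrFun h0 0
        simp at this
      · refine ⟨![(1 - W.v) * t, W.u₁, -(1 - W.v) * t, -W.u₁], fun h0 => hz ?_,
          exactPlaquetteVertexRelation_of_u₂_eq_zero ht h2 (rows_antisym' ht h2 (by linear_combination hB))⟩
        have e0 := congrFun h0 0
        have e1 := congrFun h0 1
        simp only [Matrix.cons_val_zero, Matrix.cons_val_one, Pi.zero_apply, mul_eq_zero] at e0 e1
        exact ⟨e1, e0.resolve_right ht⟩

/-- **Barrier `PlaquetteWalkMirrorBranchClassification`** (named statement): on the whole branch `u₂ = 0`
(`u₁, v, w₁, w₂` arbitrary complex, any phase `t ≠ 0`) a nonzero exact constant-coefficient vertex relation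
on every finite face list for every boundary root exists iff `(1+v−u₁)(1+v+u₁)(1−v−u₁)(1−v+u₁) = 0`.
A THEOREM of this file (`PlaquetteWalkMirrorBranchClassification_holds`); same D-0021 block as
`PlaquetteWalkCornerBranchClassification` with corner ↔ co-corner, the co-level `k + j` in place of the
level and `(u₂, w₂) ↔ (u₁, w₁)`; it supersedes `PlaquetteWalkMirrorCornerClassification` (`w₂ = 0`).
[cite: Glazman2015WeightedSAW, Lemma 3.1] -/
def _root_.Literature.Barriers.CriticalPhenomena.PlaquetteWalkMirrorBranchClassification : Prop :=
  ∀ (W : CWeights) (t : ℂ), t ≠ 0 → W.u₂ = 0 →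
    ((∃ c : Fin 4 → ℂ, c ≠ 0 ∧ ExactPlaquetteVertexRelation W t c) ↔
      (1 + W.v - W.u₁) * (1 + W.v + W.u₁) * (1 - W.v - W.u₁) * (1 - W.v + W.u₁) = 0)

/-- **`PlaquetteWalkMirrorBranchClassification` holds.** [cite: Glazman2015WeightedSAW, Lemma 3.1] -/
theorem _root_.Literature.Barriers.CriticalPhenomena.PlaquetteWalkMirrorBranchClassification_holds :
    PlaquetteWalkMirrorBranchClassification :=
  fun W _ ht h2 => exactPlaquetteVertexRelation_iff_quartic_of_u₂_eq_zero W ht h2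

end CornerSlivers

end PlaquetteWalk

end Literature.Barriers.CriticalPhenomena
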